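import Summits.Langlands.Langlands.Theses.PhantomRMYoshida
import Literature.AlgebraicGeometry.Dimension.PointDimension
import Literature.NumberTheory.GaloisRepresentations.ModNCyclotomicCharacter
import Literature.RingTheory.CompleteIntersection.NumericalCriterion
import Literature.NumberTheory.GaloisRepresentations.CompactImageCharpolyIntegral
import Summits.Langlands.Langlands.Theorems.PhantomRMYoshidaResiduallyYoshidaLiftingNumericalCriterionDVR

/-!
# Disproof of `ResiduallyYoshidaLifting` — standing adversary file (cdisprove gen 5; gens 1–4 content kept verbatim)

Crux item stmt-Langlands-13639 = `Summit.Langlands.Langlands.Theses.PhantomRMYoshida.ResiduallyYoshidaLifting`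
(route-Langlands-PhantomRMYoshida, rank 2).  Prose only in docstrings; every `theorem` below is
kernel-checked (`lean check` rc 0, no `sorry` unless marked NEAR-MISS).

## Findings index (gens 3–5; gen-4 additions = §6; gen-5 additions = §7, listed right below the verdict)

VERDICT: RESISTS.  The crux is an instance of conjunct (B) (Fontaine–Mazur–Langlands for odd
symplectic Greenberg-ordinary weight-(2,2) `ρ : Γ_ℚ → GL₄(ℚ̄_p)`); `¬ crux` is unprovable in the
tree for a STRUCTURAL reason: every hypothesis set of the crux (and of the picked line's stubs 1, 4)
contains `IsIrreducible` of a Galois representation of dimension ≥ 2 over an algebraically closed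
field, and the tree constructs NO such representation of `Γ_ℚ` (abelian images are reducible over
`k = k̄`; no non-abelian number-field Galois groups, Tate modules or modular Galois representations
are constructed).  So no witness, no finite shadow, no junk model: refutable only by `¬(B)`.
Moreover the crux is RELATIVE: `¬ crux` needs `Aut ρ₀` for an EXHIBITED `ρ₀`, i.e. a genuine
`CuspidalAutomorphicRepData 4 ℚ` with prescribed Satake parameters (no junk inhabitant: drefute
gen-2 audit §A) — a second independent wall.

* §7  (GEN 5, 2026-08-16) two structural lemmas hidden in `Sh`, kernel-checked as abstract linear
      algebra, T12 also at crux level: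
  - T12 `invariantPlane_lagrangian_or_split` / `sh_invariantPlane_lagrangian_or_split`: an invariant
    PLANE `W` of a symplectic `Sh`-representation is LAGRANGIAN (`W^⊥ = W`) or SPLITS OFF (`K⁴ = W ⊕ W^⊥`,
    `W^⊥` invariant); T12⁺ `lagrangian_dual` (`W ≃ (K⁴/W)^∨`, similitude-equivariant) and
    `J₂_conj_eq_det_smul_inv_transpose` (`σ ≅ σ^∨ ⊗ det σ` on `GL₂`) make the exclusion explicit: on the
    crux's residual type (`σ̄ ≇ σ̄'`, `det = ε̄⁻¹ = ν̄`) Lagrangian is excluded, so REDUCIBLE = SPLIT — the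
    Yoshida locus is the product of the two `GL₂` ordinary problems (no `Ext` directions; the datum's
    `K ≤ I` = integral big `R = T` for BOTH constituents), unimodular lattices reduce SPLIT, and the
    `GSp₄`-problem at `σ̄ ⊕ σ̄'` is Schur EXACTLY because of `hnc` (decoration for truth, load-bearing
    for every engine).
  - T13 `finrank_inf_eq_one_of_fixedPlane` (+ `…sup_eq_three…`, `sub_mem_of_mem_sup_fixedPlane`,
    `inf_fixed_and_stable`), TYPED: `exists_greenbergPlane` (the Greenberg plane of
    `IsGreenbergOrdinaryOfShape (0,0,1,1)` as a `Γ_{ℚ_v}`-stable inertia-trivial submodule),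
    `greenbergPlane_inf_line`, `greenbergPlaneAt_inf_line`, `sh_greenbergPlaneAt_inf_line`: the Greenberg
    plane of ANY `Sh`-point meets each residual constituent in a LINE — `σ̄|_{G_{ℚ_p}}`, `σ̄'|_{G_{ℚ_p}}`
    both carry an unramified stable line (free cohomological `p`-ordinarity; uses `p ≠ 2` via "`ε̄`
    ramified"); fibres with a "wrong-way" non-split constituent carry NO `Sh`-point (vacuous sub-locus of
    crux, target and `StableYoshidaCongruence`); with distinguishedness `H⁰(ℚ_p, Hom(σ̄', σ̄)) = 0`.
  - T14 `sh_greenbergPlane_lagrangian` (+ `toBilin'_eq_zero_of_fixed`): given ONE inertia element at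
    `v` with `ε ≠ 1` (hypothesis; true at `v = p`), the Greenberg plane of an `Sh`-point is ISOTROPIC,
    hence LAGRANGIAN (`U^⊥ = U`, `ℚ̄_p⁴/U ≅ U^∨ ⊗ ε⁻¹`): the quotient characters are forced,
    `(α, β | ε⁻¹β⁻¹, ε⁻¹α⁻¹)`, and distinguishedness on the `ε⁻¹`-block repeats `ᾱ ≠ β̄`.
  - T15 `blockScalar_mem_gsp_iff`, `offDiagRotation_facts` (matrix half of "hnc = Schur"):
    `diag(x,x,y,y) ∈ 𝔤𝔰𝔭(J₂ ⊕ J₂) ⇔ x = y`; without non-conjugacy `[[0, aI], [-aI, 0]]` is a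
    non-scalar trace-zero `𝔰𝔭`-equivariant endomorphism of `σ̄ ⊕ σ̄`.
  - T16 `det_sq_eq_of_symplectic`, `det_sq_eq_of_isSymplecticWithMultiplierFun`: `det ρ(g)² = ε(g)⁻⁴`
    (`det ρ = ±ε⁻²` pointwise; `+` by connectedness of `GSp₄`, not formalised) — the normalisation
    `|ι(Frobenius eigenvalue)| = q^{-1/2}` of gen 1's audit, kernel-side.
  - T17 (paper): (a) level — `ρ` of arbitrary tame conductor vs fixed `ρ₀`: every proof is non-minimal
    (`v`-old Yoshida family at level `N(ρ)`); (b) the datum's `K ≤ I` is INTEGRAL big `R^{ord} = T^{ord}` for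
    both constituents (TW-adequacy of `σ̄|_{ℚ(ζ_p)}` or a reduced-quotient re-cut); (c) odd-twist fibres
    `σ̄' ≅ σ̄ ⊗ η`, `p` split in `K`: the transverse tangent module contains `η` and the INDUCED locus
    `Ind_K^ℚ(ρ_F|_{G_K} ⊗ ψ)` is full-dimensional — whole components `C_ind` of `Spec R^{ps,ord}`, modular
    by base change + automorphic induction, crossing `Y` along the diagonal height-one prime: a third kind
    of component the propagation must traverse (test sub-family for STUB 1; breaks nothing);
    (d) `ρ₀` idle everywhere except line 3's seed.
  - T18 `not_crux_iff_two_walls`, `not_phantomRMSector_of_not_crux`: `¬ crux` ⟺ an admissible fibre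
    with an automorphic irreducible `Sh`-point AND a non-automorphic one — both walls at once; the
    second alone sinks the route target.
* §8  (GEN 5, 04:40Z) TARGETS of the SECOND lead (line `endoscopic-crossing-euler`, 7 stubs by `stub-add`):
      `stub_numericalCriterion` CLOSED (line A's STUB 2 landed p78501 via the proved Literature Criterion I;
      T5); 2a–2c TRUE (Chebotarev + `red` locally constant; Brauer–Nesbitt-by-charpoly over ANY field); 2d TRUE and
      TIGHT in the value group — `splitFrame_discreteShadow_false` (kernel-checked: over `ℚ_p` the block-unipotent
      `1 + [[0,I],[pI,0]]` has no integral conjugate with block-diagonal reduction); 3 = lever, inert conjuncts,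
      content `ProAut` ~ `EveryShIsLimit` (promote-stub grade); 4 ≤ route target.  No `_false` theorem.
  - STUB 2 LANDED (p78501): `numericalCriterionDVR_holds`, `stubs14_iff_absolute_and_everyShIsLimit'`,
    `crux_of_stubs14` — line A = STUBS 1 + 4 unconditionally.  Gen-5 verdict: RESISTS, unchanged;
    literature refresh degraded (crossref only; nothing new on the crux).

* §0  Verbatim copy of the vocabulary of the PICKED line `Lines/yoshida-divisor-selmer-count.lean`
      (skeleton RE-REGISTERED by the lead 2026-08-16T00:58Z, sha edead940…, after adopting this file's
      reshapes T4(a)(b); the Lines file is not an importable module): `εb DetC Aut Sh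
      IsOrdinaryClassicalLimit IsConnectedInDimTwo LocalCriterionDatum YoshidaFamilyDatum` and the
      four stub statements `YoshidaFamilyExists NumericalCriterionDVR StableComponentsModular
      OrdinaryLimitClassicality`.  Theorems below about these names apply verbatim to the skeleton.
* §1  `crux_iff` — the crux over this vocabulary (`Iff.rfl`).
* §2  Structure of the crux: `Absolute` (the ρ₀-free statement), `crux_of_absolute`,
      `of_phantomRMSector` (target ⇒ crux, ρ₀ idle), `iff_absoluteOnFibres` (relative = absolute
      on every residual fibre carrying an irreducible automorphic `Sh`-point).
* §3  TARGETS = the four registered stubs of the picked line.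
  - T0 `absolute_of_stubs`: the four stubs prove `Absolute`, i.e. the line never touches
    `Aut ρ₀` / `ρ₀` (kernel-checked; the lead's `ResiduallyYoshidaLifting_of` discards them).
  - T1 `nonempty_localCriterionDatum_iff`: modulo STUB 2, `Nonempty (LocalCriterionDatum K P)` is
    EQUIVALENT to its own `reflects`-conclusion `∀ 𝔮 ∈ minimalPrimes R, 𝔮 ≤ P → K ≤ 𝔮`
    (witness: the trivial datum `O = A = B = ℤ₂`, `φ = π = id`, `η = ⊤`, `Φ = Ψ = 0`); the
    unconditional direction `nonempty_localCriterionDatum_of` needs no stub.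
  - T1' `yoshidaFamilyExists_iff_everyShIsLimit`: modulo STUBS 2–3, STUB 1 is EQUIVALENT to
    `EveryShIsLimit` := "every irreducible `Sh`-representation (residual pair `σ̄, σ̄'`) is an
    `IsOrdinaryClassicalLimit`"; the direction `EveryShIsLimit → YoshidaFamilyExists` is
    UNCONDITIONAL (junk datum `R = ℚ̄_p`, `I = K = ⊥`, `x = id`).  Hence the ring-theoretic
    fields of `YoshidaFamilyDatum` (`R I K connected₂ generic_propagation heightOne_criterion`) and
    STUBS 2–3 are LOGICALLY INERT: `absolute_of_limit_of_classicality : EveryShIsLimit →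
    OrdinaryLimitClassicality → Absolute` is the whole line.  The Wiles–Lenstra / propagation
    architecture constrains the INTENDED PROOF of STUB 1, not its statement.
  - T2 STUB 2 (`NumericalCriterionDVR`): **LANDED 2026-08-16T04:11Z (p78501) — Criterion I is now PROVED in
    the tree (`Literature.RingTheory.CompleteIntersection.bijective_of_length_cotangentModule_le`)**; TRUE in print (dSRS 1997 Criterion I, page-verified by the
    drefute seat: any residue field; = DDT Thm 5.3).  `numericalCriterionDVR_rankOne`: the case `B = O`
    is Nakayama (proved).  `eta_ne_bot` is load-bearing: without it `Ψ = ℓ(O/0) = ⊤` and ANY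
    non-injective surjection `A ↠ B` satisfies the hypotheses — KERNEL-CHECKED by the drefute seat
    (`numericalCriterionDVR_false_without_eta`, witness `ℤ₂⟦X⟧ ↠ ℤ₂⟦X⟧/(X²) → ℤ₂`, their
    `DrefuteStubNumericalCriterionDVR.md` in this directory); see also T5 (= Literature's Criterion I).
  - T3 STUB 3 (`StableComponentsModular`): **PROVED** — `stableComponentsModular_holds` (sorry-free,
    axioms standard) — and since LANDED by the lead verbatim as
    `Theorems/PhantomRMYoshidaResiduallyYoshidaLiftingDefs.lean` (`stub_stableComponentsModular`), via `exists_prime_ringKrullDim_quotient_eq_two` (a prime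
    maximal among those above `J` of coheight `≥ 2` has `dim R/P = 2` exactly — no `dim R < ⊤`
    needed; `IsLocalRing R` unused).  Hence `yoshidaFamilyExists_iff_everyShIsLimit'` is conditional
    on STUB 2 only, and `crux_of_stubs124`.
  - T3' RESHAPE for STUB 1's field `generic_propagation`: as registered it demands propagation across
    EVERY dimension-≥2 meeting of two stable components, including meetings lying entirely inside the
    Yoshida divisor `V(I)`, where the intended ANT/Thorne engine (patching at a 1-dimensional prime
    with absolutely irreducible `ρ_𝔭`) has nothing to patch; `StableComponentsModularWeak` asks it
    only across meetings leaving `V(I)` in dimension 2 and is still a theorem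
    (`stableComponentsModularWeak_holds`); `genericPropagationWeak_of_registered` shows the reshape
    only removes an obligation.
  - T4 STUB 4 (`OrdinaryLimitClassicality`) — two MISSTATEMENT-GRADE hazards (not falsity; both are
    (B)-consequences) — BOTH RESHAPES ADOPTED in the re-registered skeleton sha edead940…:
    (a) it is stated WITHOUT the residual hypotheses (`σ̄, σ̄'` irreducible, `DetC`, non-conjugate):
        it asserts weight-(2,2) classicality of ordinary classical limits at EVERY residual type
        `P̄ = P₁·P₂` incl. four characters / Eisenstein² / `σ̄' ≅ σ̄`; `ordinaryLimitClassicality_res`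
        shows the glue only needs the version WITH them (free reshape: pass `hσirr hσ'irr hdet hnc`).
    (b) `IsOrdinaryClassicalLimit` lets the approximants' shapes `a_n` be ANY `StrictMono` tuple;
        congruence to `ρ` mod `p^n` forces the inertial exponents to agree with `(0,0,1,1)` only as
        MULTISETS mod `(p-1)p^(n-1)`, which has TWO regular solutions: `(0, N, N+1, 2N+1)` = Siegel
        weights `(N+2, N+2) → (2,2)` AND `(0, 1, N, N+1)` = weights `(N+1, 3) → (1,3)` p-adically
        (`strictMono_shape22/13`, `shape22_mod/shape13_mod`, `shape13_sameMultiset`).  A (1,3)-chamber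
        approximating sequence lands the limit eigensystem at p-adic weight (1,3), where the intended
        engine (weight-(2,2) classicality on the higher-Hida complex) does not apply — a GSp₄
        companion-form transfer in IRREGULAR weight would be needed.  RESHAPE (free for STUB 1, whose
        intended approximants are (2,2)-chamber anyway): add positional congruences
        `a 0 = 0 ∧ (a 1 : ZMod ((p-1)*p^n)) = 0 ∧ (a 2 : ZMod ((p-1)*p^n)) = 1` to
        `IsOrdinaryClassicalLimit` [now registered].
    (c) the clause `r'.IsResiduallyDistinguishedAt v a` of `IsOrdinaryClassicalLimit` is VACUOUS for
        `StrictMono a` (no equal weights): `isResiduallyDistinguishedAt_of_greenberg_of_strictMono`,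
        `isOrdinaryClassicalLimit_iff_withoutDistinguished` — the approximants are not required to
        be `p`-distinguished in any sense, contrary to the docstring's gloss.
* §5  TARGETS on the two other registered lines (`endoscopic-crossing-euler`, 4 stubs, 00:18Z;
      `cross-regular-annihilator-primes`, 5 stubs, the ACTIVE skeleton sha 623781a5…, 00:45Z):
  - T5 `numericalCriterionDVR_iff_line3`: line 1's STUB 2 and line 3's Stub 1 are the same statement;
    `numericalCriterionDVR_of_literature`: both are exactly the forward half of the unproved Literature
    named fact `numericalCriterion_eq_iff.{0,0,0}` (dSRS Criterion I) given the proved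
    `numericalCriterion_le_holds` — ONE debt, one proof, two lines.
  - T6a `CR.not_exactCross_of_frobTwist_three`: `ExactCross σ σ' red ρ` (S1's conclusion) is
    UNSATISFIABLE for every `ρ`, `red` at `p = 3` whenever `charpoly σ̄'(γ) = Frob(charpoly σ̄(γ))` for
    all `γ` (the phantom-RM pairs `σ̄' = σ̄^(3)` of the route's own source) — S1 (`stub_exactCrossElement`)
    is false at every such admissible input (`CR.s1_frobTwist_three_iff_vacuous`: S1 there ⟺ vacuity);
    algebraic core `CR.no_exactCross_frobTwist_char3` (all fields of characteristic 3: `e³ = e`,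
    `e²ab = 1`, `Gen e a b`, `(X−ea)(X−b) = Frob((X−a)(X−eb))` contradictory; certifies triage r1-1's
    exhaustive search) + `CR.frobenius_apply_padicInt` (`red(ε(γ)) ∈ 𝔽₃`).  No formal `¬ S1`: no
    admissible pair is constructible in the tree.
  - T6b `CR.S4Seeded` + `CR.s4Seeded_of_s4` + `CR.crux_of_stubs_seeded`: the registered S4 fixes the
    ×-family level `𝔫₁` BEFORE the seed level `𝔫₀` (`∃ 𝔫₁ ∀ … (∃ 𝔫₀ …) → …`), silently demanding a
    level-lowering of arbitrary-level seeds; swapping to `∀ 𝔫₀ T₀, ∃ 𝔫₁ T₁` only removes that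
    obligation and the lead's composition goes through verbatim (S3 yields `𝔫₀, T₀` first).  Also
    recorded: line 2 is genuinely RELATIVE (`Aut ρ₀` consumed by S3), line 1 is not.
  - T7 (prose) line `endoscopic-crossing-euler`: its glue discards four conjuncts of the lever Stub 3
    (descent of `rbar`, `ρR ∈ 𝒞`, universality, `𝒯 = tr ρR`) — used are `φ : R ↠ 𝕋`, `x ∘ 𝒯 = tr ρ`,
    the Criterion-I data at `P`, the commuting square, the CROSSING `ker ιR ≤ ker x` and DENSITY; its
    Stub 4 allows ENDOSCOPIC approximants `Endo r'` with NO modularity / oddness / de Rham condition on the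
    summands (weaker than intended ⇒ harder; still a (B)-consequence); its Stub 2 (self-dual lattice ⇒
    split reduction) is TRUE by the Lagrangian-or-non-degenerate dichotomy (now T12; see §8 for the
    second lead's reshaped 2a–2d).
* §4  Mutation table / why each crux hypothesis is (not) load-bearing — from gens 1–2 (their files
      live under run/gate/evidence, not mounted in refuter jails; statements recorded here, proofs
      re-derived only where cheap): oddness ×2 = decoration — RE-PROVED here: `εb p` is
      definitionally Literature's `modNCyclotomicCharacter ℚ p`, `εb_of_isComplexConjugation`
      (`ε̄(c) = −1`, any `p`), `isOdd_of_detC`, `iff_withoutOdd`, `phantomRMSector_iff_absolute`;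
      residual a.e.-unramifiedness of `σ̄, σ̄'` = decoration (discrete coefficients); `ρ.IsIrreducible`
      load-bearing (`ρ_f ⊕ ρ_f'` has `Sh`, is an ordinary classical limit, and is not cuspidal on
      GL₄ — Jacquet–Shalika); `red` rigid (factors through `𝔽̄_p`); all clauses frame-invariant;
      `tr ρ(c) = 0` for every symplectic-`ε⁻¹` `ρ` (c cannot separate the Yoshida locus);
      Greenberg–Wiles count: reducible locus of expected codimension 0 (the line embraces this:
      `yoshida_minimal`).
* §6  (GEN 4, 2026-08-16) T8 `ordinaryLimitClassicality_of_absolute` / `_of_phantomRMSector`: STUB 4 (as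
      registered) follows from `Absolute`, hence from the route TARGET — it carries no risk beyond the
      route's own; `stubs14_iff_absolute_and_everyShIsLimit` (mod STUB 2; STUB 3 proved):
      (STUB 1 ∧ STUB 4) ⟺ (Absolute ∧ EveryShIsLimit), and given the target
      (STUB 1 ∧ STUB 4) ⟺ EveryShIsLimit (`stubs14_iff_everyShIsLimit_of_target`): the line's excess
      over the crux is EXACTLY `EveryShIsLimit` (regular-weight pro-automorphy of every irreducible
      `Sh`-point — an `R^{ord} ↪ 𝕋` density statement) and sits entirely in STUB 1.
      T9 `not_stableComponentsModularOffElt` with the kernel-checked model `CharPCrossing.*`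
      (`R = A ×_{A/ϖ} A`, `A = ℚ⟦X⟧⟦Y⟧⟦Z⟧`: `minimalPrimes_eq` (exactly two, `Y = V(𝔮₁)`, `C = V(𝔮₂)`),
      `ringKrullDim_A = 3` (both full-dimensional), `sup_eq_ker` + `ringKrullDim_quotient_crossing = 2`
      (they cross ONLY at the prime `P₀ = 𝔮₁ + 𝔮₂`, of coheight exactly `2`), `t_mem_sup`
      (`t = (ϖ,ϖ) ∈ P₀`, `t` a regular non-unit), `isConnectedInDimTwo`, local + Noetherian instances):
      STUB 3 with the height-one criterion restricted to primes AVOIDING `t` (= `p · 1`) is FALSE.  Hence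
      the datum's `heightOne_criterion` at primes `P ∋ p` of the Yoshida divisor — Wiles–Lenstra over a
      DVR of residue characteristic `p`, where `Φ_P ≤ Ψ_P` is an inequality of `μ`-INVARIANTS (BF Selmer
      bound vs. Yoshida congruence ideal) that no cited source provides (KLZ17 / HsiehPalvannan2025 /
      the announced Hsieh–Liu `θ ∣ 𝒞` all invert `p` or hold up to `μ`) — is LOAD-BEARING for the
      propagation architecture and cannot be re-cut away: STUB 1 silently contains a `μ = 0`-type input at
      `Y` (equivalently: must exclude `μ`-type crossings `C ∩ Y ⊆ V(p)` of the stable component through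
      `x_ρ`).  Landed as `Theorems/ResiduallyYoshidaLifting/Negative/StableComponentsModularOffCharP.lean`
      (proposal p75578, review-queued).
      T10 `red_eq_zero_of_norm_lt_one` (any `red : 𝒪_{ℚ̄_p} → k` kills `𝔪`; re-derived gen-2 rigidity),
      `map_red_eq_of_congruent` / `residualFactorisation_of_congruent`: along the coefficientwise
      congruences of `IsOrdinaryClassicalLimit` (`n ≥ 1`) the reduction `P.map red` is CONSTANT — every
      approximant has the same residual Yoshida factorisation `P₁ · P₂` (the approximating classical
      points never leave the residual fibre; the clause need not be restated and cannot be varied).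
      T11 `D4Datum.*`: kernel-checked algebraic core of regime (c) below — `no_common_eigenvector`
      (absolute irreducibility mod 3 via `s = diag(1,−1)` and a swap, `decide`), `rotation_facts`
      (`r² = −1`, `r⁴ = 1`, `det r = 1`, `det s = −1`: the determinant-one image `⟨r⟩` is cyclic, so
      `σ̄|_{G_{ℚ(ζ₃)}}` is abelian), `sq_eq_neg_twelve` + `swap_factor` + `det_signed_swap`
      (`√−3 = (θ²−2)θθ'/2 ∈ L` and `g(√−3) = det σ̄(g)·√−3`, i.e. `det σ̄ = ε̄₃` exactly).
* REGIMES / FAMILIES re-examined in gen 4 (paper; details in the §6 docstrings) — none yields a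
  counterexample, each sharpens WHY the crux resists and where engines die:
  (a) IMPRIMITIVE sub-locus (admissible: the crux allows twist-equivalent pairs `σ̄' ≅ σ̄ ⊗ ω_K`): for
      `ρ ≅ ρ ⊗ ω_K`, `ρ = Ind_K^ℚ τ` and cyclic automorphic induction (Arthur–Clozel) reduces `Aut ρ` to
      weight-2 `p`-ordinary automorphy of `τ : G_K → GL₂(ℚ̄_p)` over the quadratic field `K` (cuspidality
      of the induced `π` ⟺ `τ ≇ τ^c` ⟺ `ρ` irreducible); real quadratic `K`: Hilbert modularity lifting;
      imaginary quadratic: the ordinary cases of Allen–Khare–Thorne / Caraiani–Newton — no counterexample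
      can come from there short of a failure of `GL₂`-reciprocity over a quadratic field.
  (b) ρ of the crux's exact shape WITHOUT an abelian surface behind it: `4`-dimensional constituents of
      `V_p` of abelian fourfolds with quaternionic multiplication (the reason the paramodular conjecture
      had to be amended by Brumer–Kramer after Calegari's remark) — equally inside (B); the crux asserts
      automorphy, not geometric origin, so these are not counterexamples either.
  (c) THE WORST ADMISSIBLE CORNER, EXPLICITLY: `p = 3`, `L = ℚ(θ, θ')`, `θ = √(2+√6)`, `θθ' = √−2`
      (splitting field of `x⁴ − 4x² − 2`, Eisenstein at 2; `[L:ℚ] = 8` because `√−2 ∉ ℚ(θ) ⊂ ℝ`;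
      `Gal(L/ℚ) ≅ D₄` = ALL signed permutations of `{θ, θ'}`), `σ̄ : G_ℚ → GL₂(ℤ) → GL₂(𝔽₃)` the
      signed-permutation representation: absolutely irreducible mod 3 (`3 ∤ 8`; `diag(1,−1)` and an
      antidiagonal element share no line), odd (`c : θ ↦ θ, θ' ↦ −θ'`), and `det σ̄ = χ_{ℚ(√−3)} = ε̄₃
      = ε̄₃⁻¹` EXACTLY, because `√−3 = (θ² − 2)·θθ'/2` (square it: `6·(−2)/4`) transforms under a signed
      permutation `g` by the factor `det σ̄(g)`; `σ̄' := σ̄ ⊗ ω₅` (same determinant, irreducible,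
      `≇ σ̄` since `σ̄ ≅ σ̄ ⊗ χ` iff `χ ∈ {1, ω₆, ω₋₂, ω₋₃}`).  On this fibre `σ̄|_{G_{ℚ(ζ₃)}}` = the
      rotation subgroup `C₄` is ABELIAN (Taylor–Wiles adequacy fails: Wiles' bad-dihedral case
      `ℚ(√−3) ⊂ L`), the image of `σ̄ ⊗ σ̄'^∨` is a 2-group (no big-image Euler-system input), `p = 3`
      (`SL₂(𝔽₃)` soluble, BK/HP-type `p ≥ 5` hypotheses fail), and cross-regular supply is as thin as it
      gets.  The same TYPE of datum (own `L_E`) comes from any `E/ℚ` with good ordinary reduction at 3 and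
      mod-3 image the normaliser of a split Cartan: `(σ̄, σ̄') = (Ē[3], Ē^{(ℓ)}[3])`, reducible `Sh`-point
      `ρ_E ⊕ ρ_{E^{(ℓ)}}` (3-distinguished iff `(ℓ/3) = −1`, as `a₃(E^{(ℓ)}) = (ℓ/3)·a₃(E)`; e.g. `ℓ = 5`).
      The (fixed) crux quantifies over all of it; every engine of every filed line is void there; truth
      there is (B) and nothing less — recorded for the route planner's `p ≥ 5 ∧ σ̄|_{ℚ(ζ_p)} irreducible`
      sharpening option (triage r1-1), which a LINE cannot adopt.
  (d) CONDUCTOR BOUND for the approximants of `IsOrdinaryClassicalLimit` (for STUB 4): for `v ∈ S`,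
      `v ∤ p`, `tr r' ≡ tr r (mod p^n)` on `G_ℚ` (Čebotarev + continuity) with `p^n > 4` (`n = 2`; for
      `p = 3`, `n = 1` is NOT enough: `1³ ⊕ χ` vs `χ ⊕ χ'³`) forces `r'|_{P_v} ≅ r|_{P_v}` on WILD inertia
      (finite `v`-groups, `v ≠ p`: multiplicities agree mod `p^n` and are `≤ 4`).  Hence equal Swan
      conductors; the tame level of every approximant with `n ≥ 2` divides `∏_{v ∈ S, v ∤ p} v^{sw_v(r)+4}`:
      ONE tame level `N(r, S)` suffices.
  (e) Formal status (now T18): `¬ crux` needs an admissible `(σ̄, σ̄')` (no irreducible `Γ_ℚ`-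
      representation of dimension ≥ 2 is constructed in the tree; (c) is the cheapest conceivable one, a `D₄`
      splitting field), an automorphic `ρ₀`, AND `¬ Aut ρ` — a statement about ALL
      `CuspidalAutomorphicRepData 4 ℚ` (the tree proves no boundedness property of their Satake parameters:
      `hasSatakeParamAt_ne_zero`, `hasSatakeParamAt_unique` are named facts).  The Greenberg form of
      `IsGreenbergOrdinaryOfShapeAt (0,0,1,1)` closes the only semantic loophole (a Borel-ordinary
      non-de-Rham `ρ`), so every `Sh`-`ρ` is semistable at `p`: the crux is a clean instance of (B).
-/

noncomputable section

set_option linter.dupNamespace false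
set_option linter.unusedVariables false
set_option autoImplicit false

open IsDedekindDomain Filter
open Literature.NumberTheory.GaloisRepresentations Literature.NumberTheory.Automorphic

namespace Summit.Langlands.Langlands.Cruxes.ResiduallyYoshidaLifting.Disproof

/-! ## §0 Vocabulary of the picked line (VERBATIM from `Lines/yoshida-divisor-selmer-count.lean`,
skeleton sha 4b1378e8c5cec836…; copied because Cruxes/Lines files are not importable modules) -/

/-- The route's inline mod-`p` cyclotomic character `ε̄ : Γ_ℚ → (ℤ/p)ˣ` (verbatim `let εb` of the crux). -/
def εb (p : ℕ) [Fact p.Prime] : Field.absoluteGaloisGroup ℚ →* (ZMod p)ˣ :=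
  (modularCyclotomicCharacter (AlgebraicClosure ℚ)
    (HasEnoughRootsOfUnity.natCard_rootsOfUnity (AlgebraicClosure ℚ) p)).comp
    (MulSemiringAction.toRingAut (Field.absoluteGaloisGroup ℚ) (AlgebraicClosure ℚ))

/-- `det σ̄ = det σ̄' = ε̄⁻¹` (verbatim determinant clause of the crux). -/
def DetC (p : ℕ) [Fact p.Prime] (k : Type) [Field k] [CharP k p] [TopologicalSpace k]
    [DiscreteTopology k] (σ σ' : FramedGaloisRep ℚ k 2) : Prop :=
  ∀ g, FramedRep.det σ g = (Units.map (ZMod.castHom (dvd_refl p) k).toMonoidHom (εb p g))⁻¹ ∧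
    FramedRep.det σ' g = FramedRep.det σ g

/-- `Aut r` — the automorphy clause of the crux, verbatim (`let Aut` there): an L-algebraic cuspidal
`π` on `GL₄(𝔸_ℚ)` whose Satake parameters match the arithmetic-Frobenius polynomials of `r` a.e. -/
def Aut (p : ℕ) [Fact p.Prime] (hcpt : isCompact_glFiniteIntegralLevel 4 ℚ) (ι : PadicAlgCl p ≃+* ℂ)
    (r : FramedGaloisRep ℚ (PadicAlgCl p) 4) : Prop :=
  ∃ π : CuspidalAutomorphicRepData 4 ℚ hcpt, π.1.IsLAlgebraic ∧
    ∀ᶠ v : HeightOneSpectrum (NumberField.RingOfIntegers ℚ) in Filter.cofinite, ∃ a : Multiset ℂ,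
      π.1.HasSatakeParamAt v a ∧ r.IsUnramifiedAt v ∧
        r.HasFrobCharpolyAt v (arithFrobPolyOfSatake ι v.residueCard 1 a)

/-- `Sh r` — the shape clause of the crux, verbatim (`let Sh` there): symplectic with similitude
`ε⁻¹`, Greenberg-ordinary of Hodge–Tate shape `(0,0,1,1)` and residually distinguished at `p`, and
residually of Yoshida type `σ̄ ⊕ σ̄'` through `red` (a.e. Frobenius polynomial `≡ charpoly σ̄ · charpoly σ̄'`). -/
def Sh (p : ℕ) [Fact p.Prime] (k : Type) [Field k] [TopologicalSpace k]
    (red : Valued.integer (PadicAlgCl p) →+* k) (σ σ' : FramedGaloisRep ℚ k 2)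
    (r : FramedGaloisRep ℚ (PadicAlgCl p) 4) : Prop :=
  (r.IsSymplecticWithMultiplierFun (fun g => algebraMap ℚ_[p] (PadicAlgCl p)
      ((((GaloisRep.cyclotomicCharacter ℚ p g)⁻¹ : ℤ_[p]ˣ) : ℤ_[p]) : ℚ_[p]))) ∧
    (∀ v : HeightOneSpectrum (NumberField.RingOfIntegers ℚ),
      ((p : ℕ) : NumberField.RingOfIntegers ℚ) ∈ v.asIdeal →
        r.IsGreenbergOrdinaryOfShapeAt v ![0, 0, 1, 1] ∧ r.IsResiduallyDistinguishedAt v ![0, 0, 1, 1]) ∧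
    (∀ᶠ v : HeightOneSpectrum (NumberField.RingOfIntegers ℚ) in Filter.cofinite,
      r.IsUnramifiedAt v ∧ σ.IsUnramifiedAt v ∧ σ'.IsUnramifiedAt v ∧
        ∃ (P : Polynomial (Valued.integer (PadicAlgCl p))) (P₁ P₂ : Polynomial k),
          r.HasFrobCharpolyAt v (P.map (Valued.integer (PadicAlgCl p)).subtype) ∧
            σ.HasFrobCharpolyAt v P₁ ∧ σ'.HasFrobCharpolyAt v P₂ ∧ P.map red = P₁ * P₂)

/-! ## Objects posited by the line (interfaces only; existence is `stub_yoshidaFamily`) -/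

/-- `r` is an ORDINARY CLASSICAL LIMIT: outside one finite set `S` of places, for every `n`, the
Frobenius polynomials of `r` are congruent modulo `p^n` (coefficientwise, in `𝒪_{ℚ̄_p}`) to those of
an AUTOMORPHIC `r'` (clause `Aut`) which is symplectic (some similitude), Greenberg-ordinary of some
REGULAR inertial shape `a` (strictly increasing Hodge–Tate numbers) lying in the (2,2)-CHAMBER — `a` is
POSITIONALLY congruent to `(0,0,1,1)` modulo `(p-1)·p^n` (lead reshape 2026-08-16 after Disproof T4(b):
multiset congruence alone also admits the (1,3)-chamber `(0,1,N,N+1)`, where no weight-(2,2)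
classicality engine applies) — and residually distinguished at `p` (vacuous for `StrictMono a`,
Disproof T4(c); kept verbatim).
Intended instances: the Galois representations of the classical cuspidal points of regular weight
`(k₁,k₂) → (2,2)` `p`-adically on the stable ordinary (Hida) component through `x_r`. -/
def IsOrdinaryClassicalLimit (p : ℕ) [Fact p.Prime] (hcpt : isCompact_glFiniteIntegralLevel 4 ℚ)
    (ι : PadicAlgCl p ≃+* ℂ) (r : FramedGaloisRep ℚ (PadicAlgCl p) 4) : Prop :=
  ∃ S : Set (HeightOneSpectrum (NumberField.RingOfIntegers ℚ)), S.Finite ∧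
    ∀ n : ℕ, ∃ (r' : FramedGaloisRep ℚ (PadicAlgCl p) 4) (a : Fin 4 → ℕ),
      Aut p hcpt ι r' ∧ StrictMono a ∧
      (a 0 = 0 ∧ (a 1 : ZMod ((p - 1) * p ^ n)) = 0 ∧ (a 2 : ZMod ((p - 1) * p ^ n)) = 1 ∧
        (a 3 : ZMod ((p - 1) * p ^ n)) = 1) ∧
      (∃ ν : Field.absoluteGaloisGroup ℚ → PadicAlgCl p, r'.IsSymplecticWithMultiplierFun ν) ∧
      (∀ v : HeightOneSpectrum (NumberField.RingOfIntegers ℚ),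
        ((p : ℕ) : NumberField.RingOfIntegers ℚ) ∈ v.asIdeal →
          r'.IsGreenbergOrdinaryOfShapeAt v a ∧ r'.IsResiduallyDistinguishedAt v a) ∧
      ∀ v ∉ S, r.IsUnramifiedAt v ∧ r'.IsUnramifiedAt v ∧
        ∃ P P' : Polynomial (Valued.integer (PadicAlgCl p)),
          r.HasFrobCharpolyAt v (P.map (Valued.integer (PadicAlgCl p)).subtype) ∧
          r'.HasFrobCharpolyAt v (P'.map (Valued.integer (PadicAlgCl p)).subtype) ∧
          ∀ i : ℕ, ‖((P.coeff i : Valued.integer (PadicAlgCl p)) : PadicAlgCl p) -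
              ((P'.coeff i : Valued.integer (PadicAlgCl p)) : PadicAlgCl p)‖ ≤ ‖(p : PadicAlgCl p)‖ ^ n

/-- `Spec R` is CONNECTED IN DIMENSION 2: the minimal primes of `R` cannot be split into two
non-empty classes all of whose cross-intersections `V(𝔮₁) ∩ V(𝔮₂) = V(𝔮₁ + 𝔮₂)` have dimension `< 2`. -/
def IsConnectedInDimTwo (R : Type) [CommRing R] : Prop :=
  ∀ 𝒜 : Set (Ideal R), 𝒜 ⊆ minimalPrimes R → 𝒜.Nonempty → (minimalPrimes R \ 𝒜).Nonempty →
    ∃ 𝔮₁ ∈ 𝒜, ∃ 𝔮₂ ∈ minimalPrimes R \ 𝒜, (2 : WithBot ℕ∞) ≤ ringKrullDim (R ⧸ (𝔮₁ ⊔ 𝔮₂))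

/-- THE HEIGHT-ONE NUMERICAL-CRITERION DATUM at a prime `P` of `R` (intended: `P ⊇ I` a height-one
prime of the Yoshida divisor `Y = V(I)`, `K = ker(R ↠ T)` the modular ideal).  Wiles–Lenstra data
`A ↠ B → O` over a complete DVR `O` (intended: `O` = completed local ring of the Yoshida branch
`R/I ≅ 𝕀_{F,G}` at `P/I`, whose residue field has characteristic `0` off the `μ`-part; `A = R_P^∧ ⊗ O`,
`B = T_P^∧ ⊗ O` finite free; `π` = the Yoshida branch as augmentation), TOGETHER WITH the Iwasawa-
theoretic inequality `Φ ≤ Ψ` (`Φ` = `O`-length of the cotangent `𝔭_A/𝔭_A²`, `𝔭_A = ker(π ∘ φ)`;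
`Ψ` = `O`-length of `O/η`, `η = π(Ann_B ker π)` the congruence ideal of the Yoshida branch) and the
MEANING of the criterion's conclusion back in `R` (`reflects`: if `φ` is bijective then every minimal
prime of `R` inside `P` is modular).  NO bijectivity is asserted: that is `stub_numericalCriterionDVR`. -/
structure LocalCriterionDatum {R : Type} [CommRing R] (K P : Ideal R) : Type 1 where
  /-- the base: a complete discrete valuation ring (ANY residue field) -/
  O : Type
  [commRingO : CommRing O]
  [isDomainO : IsDomain O]
  [dvrO : IsDiscreteValuationRing O]
  [completeO : IsAdicComplete (IsLocalRing.maximalIdeal O) O]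
  /-- the deformation side: a complete Noetherian local `O`-algebra -/
  A : Type
  [commRingA : CommRing A]
  [localA : IsLocalRing A]
  [noetherianA : IsNoetherianRing A]
  [algebraA : Algebra O A]
  [completeA : IsAdicComplete (IsLocalRing.maximalIdeal A) A]
  /-- the Hecke side: a local `O`-algebra, finite free as an `O`-module -/
  B : Type
  [commRingB : CommRing B]
  [localB : IsLocalRing B]
  [algebraB : Algebra O B]
  [finiteB : Module.Finite O B]
  [freeB : Module.Free O B]
  /-- `R → T` at `P` -/
  φ : A →ₐ[O] B
  /-- the Yoshida branch as augmentation -/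
  π : B →ₐ[O] O
  surjective : Function.Surjective φ
  /-- the congruence ideal `η = π(Ann_B(ker π))` is non-zero -/
  eta_ne_bot : Ideal.map (π : B →+* O) (RingHom.ker (π : B →+* O)).annihilator ≠ ⊥
  /-- `Φ ≤ Ψ`: (Beilinson–Flach upper bound on the transverse cotangent) ≤ (congruence length) -/
  phi_le_psi : Module.length O (RingHom.ker ((π : B →+* O).comp (φ : A →+* B))).Cotangent ≤
      Module.length O (O ⧸ Ideal.map (π : B →+* O) (RingHom.ker (π : B →+* O)).annihilator)
  /-- meaning: `R_P ≅ T_P` puts every irreducible component of `Spec R` through `P` inside `Spec T` -/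
  reflects : Function.Bijective φ → ∀ 𝔮 ∈ minimalPrimes R, 𝔮 ≤ P → K ≤ 𝔮

attribute [instance] LocalCriterionDatum.commRingO LocalCriterionDatum.isDomainO
  LocalCriterionDatum.dvrO LocalCriterionDatum.completeO LocalCriterionDatum.commRingA
  LocalCriterionDatum.localA LocalCriterionDatum.noetherianA LocalCriterionDatum.algebraA
  LocalCriterionDatum.completeA LocalCriterionDatum.commRingB LocalCriterionDatum.localB
  LocalCriterionDatum.algebraB LocalCriterionDatum.finiteB LocalCriterionDatum.freeB

/-- THE `Λ`-ADIC YOSHIDA FAMILY DATUM of `ρ` — the interface the line is stated over (existence is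
STUB 1, never smuggled: every field below is a claim about the intended instance
`R = R^{ps,ord}_{Λ₂,N}(tr σ̄ + tr σ̄')`, `I` = reducibility ideal, `K = ker(R ↠ T^{ord}_{𝔪,N})`).
Only `R` is a ring here; `T` enters through `K` and through the Hecke sides `B` of the local
criterion data; `Λ₂` enters through Krull dimensions only. -/
structure YoshidaFamilyDatum (p : ℕ) [Fact p.Prime] (hcpt : isCompact_glFiniteIntegralLevel 4 ℚ)
    (ι : PadicAlgCl p ≃+* ℂ) (k : Type) [Field k] [TopologicalSpace k]
    (red : Valued.integer (PadicAlgCl p) →+* k) (σ σ' : FramedGaloisRep ℚ k 2)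
    (ρ : FramedGaloisRep ℚ (PadicAlgCl p) 4) : Type 1 where
  /-- the big ordinary pseudodeformation ring `R = R^{ps,ord}_{Λ₂,N}(tr σ̄ + tr σ̄')` -/
  R : Type
  [commRing : CommRing R]
  [isNoetherianRing : IsNoetherianRing R]
  [isLocalRing : IsLocalRing R]
  /-- the reducibility ideal (`V(I) = Y`, the Yoshida divisor) -/
  I : Ideal R
  /-- the modular ideal `K = ker(R ↠ T^{ord}_𝔪)` -/
  K : Ideal R
  /-- the Yoshida (endoscopic) family is automorphic: `Y ⊆ Spec T` -/
  modular_le_reducible : K ≤ I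
  /-- the universal Frobenius polynomials (a.e. `v`) -/
  univPoly : HeightOneSpectrum (NumberField.RingOfIntegers ℚ) → Polynomial R
  /-- the point of `ρ` -/
  x : R →+* PadicAlgCl p
  charpoly_x : ∀ᶠ v : HeightOneSpectrum (NumberField.RingOfIntegers ℚ) in Filter.cofinite,
    ρ.HasFrobCharpolyAt v ((univPoly v).map x)
  /-- the Yoshida divisor is a union of irreducible components of `Spec R` (full `Λ`-dimension) -/
  yoshida_minimal : ∃ 𝔮 ∈ minimalPrimes R, I ≤ 𝔮
  /-- `Spec R` is connected in dimension `2` -/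
  connected₂ : IsConnectedInDimTwo R
  /-- generic propagation between STABLE components meeting in dimension `≥ 2` -/
  generic_propagation : ∀ 𝔮₁ ∈ minimalPrimes R, ∀ 𝔮₂ ∈ minimalPrimes R, ¬ I ≤ 𝔮₁ → ¬ I ≤ 𝔮₂ →
    (2 : WithBot ℕ∞) ≤ ringKrullDim (R ⧸ (𝔮₁ ⊔ 𝔮₂)) → K ≤ 𝔮₁ → K ≤ 𝔮₂
  /-- at every height-one prime of the Yoshida divisor: the numerical-criterion datum with `Φ ≤ Ψ` -/
  heightOne_criterion : ∀ P : Ideal R, P.IsPrime → I ≤ P → ringKrullDim (R ⧸ P) = 2 →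
    Nonempty (LocalCriterionDatum K P)
  /-- Galois points of modular irreducible components are ordinary classical limits -/
  classicalLimit : ∀ (r : FramedGaloisRep ℚ (PadicAlgCl p) 4) (y : R →+* PadicAlgCl p),
    r.toGaloisRep.IsIrreducible → Sh p k red σ σ' r →
      (∀ᶠ v : HeightOneSpectrum (NumberField.RingOfIntegers ℚ) in Filter.cofinite,
        r.HasFrobCharpolyAt v ((univPoly v).map y)) →
      (∃ 𝔮 ∈ minimalPrimes R, 𝔮 ≤ RingHom.ker y ∧ K ≤ 𝔮) → IsOrdinaryClassicalLimit p hcpt ι r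

attribute [instance] YoshidaFamilyDatum.commRing YoshidaFamilyDatum.isNoetherianRing
  YoshidaFamilyDatum.isLocalRing

/-! ## The four stub STATEMENTS (named `Prop`s) -/

/-- Statement of STUB 1 (`stub_yoshidaFamily`): the Λ-adic Yoshida family datum exists. -/
def YoshidaFamilyExists : Prop :=
  ∀ (p : ℕ) [Fact p.Prime], p ≠ 2 → ∀ (k : Type) [Field k] [CharP k p] [IsAlgClosed k]
    [TopologicalSpace k] [DiscreteTopology k] (red : Valued.integer (PadicAlgCl p) →+* k)
    (σ σ' : FramedGaloisRep ℚ k 2) (hcpt : isCompact_glFiniteIntegralLevel 4 ℚ) (ι : PadicAlgCl p ≃+* ℂ)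
    (ρ : FramedGaloisRep ℚ (PadicAlgCl p) 4),
    σ.toGaloisRep.IsIrreducible → σ'.toGaloisRep.IsIrreducible → DetC p k σ σ' →
    (¬ ∃ g : GL (Fin 2) k, ∀ x, g * σ x * g⁻¹ = σ' x) →
    ρ.toGaloisRep.IsIrreducible → Sh p k red σ σ' ρ →
    Nonempty (YoshidaFamilyDatum p hcpt ι k red σ σ' ρ)

/-- Statement of STUB 2 (`stub_numericalCriterionDVR`): Wiles–Lenstra over a complete DVR, any residue field. -/
def NumericalCriterionDVR : Prop :=
  ∀ (O : Type) [CommRing O] [IsDomain O] [IsDiscreteValuationRing O]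
    [IsAdicComplete (IsLocalRing.maximalIdeal O) O]
    (A : Type) [CommRing A] [IsLocalRing A] [IsNoetherianRing A] [Algebra O A]
    [IsAdicComplete (IsLocalRing.maximalIdeal A) A]
    (B : Type) [CommRing B] [IsLocalRing B] [Algebra O B] [Module.Finite O B] [Module.Free O B]
    (φ : A →ₐ[O] B) (π : B →ₐ[O] O),
    Function.Surjective φ →
    Ideal.map (π : B →+* O) (RingHom.ker (π : B →+* O)).annihilator ≠ ⊥ →
    Module.length O (RingHom.ker ((π : B →+* O).comp (φ : A →+* B))).Cotangent ≤
      Module.length O (O ⧸ Ideal.map (π : B →+* O) (RingHom.ker (π : B →+* O)).annihilator) →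
    Function.Bijective φ

/-- Statement of STUB 3 (`stub_stableComponentsModular`): propagation through the component graph. -/
def StableComponentsModular : Prop :=
  ∀ (R : Type) [CommRing R] [IsNoetherianRing R] [IsLocalRing R] (I K : Ideal R), K ≤ I →
    (∃ 𝔮 ∈ minimalPrimes R, I ≤ 𝔮) → IsConnectedInDimTwo R →
    (∀ 𝔮₁ ∈ minimalPrimes R, ∀ 𝔮₂ ∈ minimalPrimes R, ¬ I ≤ 𝔮₁ → ¬ I ≤ 𝔮₂ →
      (2 : WithBot ℕ∞) ≤ ringKrullDim (R ⧸ (𝔮₁ ⊔ 𝔮₂)) → K ≤ 𝔮₁ → K ≤ 𝔮₂) →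
    (∀ P : Ideal R, P.IsPrime → I ≤ P → ringKrullDim (R ⧸ P) = 2 →
      ∀ 𝔮 ∈ minimalPrimes R, 𝔮 ≤ P → K ≤ 𝔮) →
    ∀ 𝔮 ∈ minimalPrimes R, K ≤ 𝔮

/-- Statement of STUB 4 (`stub_ordinaryLimitClassicality`): weight-(2,2) classicality of ordinary classical limits. -/
def OrdinaryLimitClassicality : Prop :=
  ∀ (p : ℕ) [Fact p.Prime], p ≠ 2 → ∀ (k : Type) [Field k] [CharP k p] [IsAlgClosed k]
    [TopologicalSpace k] [DiscreteTopology k] (red : Valued.integer (PadicAlgCl p) →+* k)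
    (σ σ' : FramedGaloisRep ℚ k 2) (hcpt : isCompact_glFiniteIntegralLevel 4 ℚ) (ι : PadicAlgCl p ≃+* ℂ)
    (r : FramedGaloisRep ℚ (PadicAlgCl p) 4),
    σ.toGaloisRep.IsIrreducible → σ'.toGaloisRep.IsIrreducible → DetC p k σ σ' →
    (¬ ∃ g : GL (Fin 2) k, ∀ x, g * σ x * g⁻¹ = σ' x) →
    r.toGaloisRep.IsIrreducible → Sh p k red σ σ' r → IsOrdinaryClassicalLimit p hcpt ι r →
    Aut p hcpt ι r


/-! ## §1 The crux over this vocabulary -/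

/-- The crux, restated over `DetC / Aut / Sh` (definitional: the `let`s of the route decl
zeta-reduce to these constants). -/
theorem crux_iff :
    Summit.Langlands.Langlands.Theses.PhantomRMYoshida.ResiduallyYoshidaLifting ↔
    ∀ (p : ℕ) [Fact p.Prime], p ≠ 2 → ∀ (k : Type) [Field k] [CharP k p] [IsAlgClosed k]
      [TopologicalSpace k] [DiscreteTopology k] (red : Valued.integer (PadicAlgCl p) →+* k)
      (σ σ' : FramedGaloisRep ℚ k 2) (hcpt : isCompact_glFiniteIntegralLevel 4 ℚ) (ι : PadicAlgCl p ≃+* ℂ)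
      (ρ₀ ρ : FramedGaloisRep ℚ (PadicAlgCl p) 4),
      σ.IsOdd → σ'.IsOdd → σ.toGaloisRep.IsIrreducible → σ'.toGaloisRep.IsIrreducible →
      DetC p k σ σ' → (¬ ∃ g : GL (Fin 2) k, ∀ x, g * σ x * g⁻¹ = σ' x) →
      ρ₀.toGaloisRep.IsIrreducible → Sh p k red σ σ' ρ₀ → Aut p hcpt ι ρ₀ →
      ρ.toGaloisRep.IsIrreducible → Sh p k red σ σ' ρ → Aut p hcpt ι ρ :=
  Iff.rfl

/-! ## §2 Structure of the crux -/

/-- The ABSOLUTE (ρ₀-free, oddness-free) statement: every irreducible `Sh`-representation with an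
admissible residual pair is automorphic.  This is what the picked line actually proves (T0). -/
def Absolute : Prop :=
  ∀ (p : ℕ) [Fact p.Prime], p ≠ 2 → ∀ (k : Type) [Field k] [CharP k p] [IsAlgClosed k]
    [TopologicalSpace k] [DiscreteTopology k] (red : Valued.integer (PadicAlgCl p) →+* k)
    (σ σ' : FramedGaloisRep ℚ k 2) (hcpt : isCompact_glFiniteIntegralLevel 4 ℚ) (ι : PadicAlgCl p ≃+* ℂ)
    (ρ : FramedGaloisRep ℚ (PadicAlgCl p) 4),
    σ.toGaloisRep.IsIrreducible → σ'.toGaloisRep.IsIrreducible → DetC p k σ σ' →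
    (¬ ∃ g : GL (Fin 2) k, ∀ x, g * σ x * g⁻¹ = σ' x) →
    ρ.toGaloisRep.IsIrreducible → Sh p k red σ σ' ρ → Aut p hcpt ι ρ

/-- `Absolute ⇒ crux` (drop `ρ₀` and both oddness hypotheses). -/
theorem crux_of_absolute (h : Absolute) :
    Summit.Langlands.Langlands.Theses.PhantomRMYoshida.ResiduallyYoshidaLifting := by
  intro p _ hp k _ _ _ _ _ red σ σ' hcpt ι ρ₀ ρ _εb _Aut _Sh _ _ hσ hσ' hdet hnc _ _ _ hρ hSh
  exact h p hp k red σ σ' hcpt ι ρ hσ hσ' hdet hnc hρ hSh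

/-- `Absolute ⇒ target sector` as well (the sector keeps the two oddness hypotheses, unused). -/
theorem phantomRMSector_of_absolute (h : Absolute) :
    Summit.Langlands.Langlands.Theses.PhantomRMYoshida.PhantomRMSector := by
  intro p _ hp k _ _ _ _ _ red σ σ' hcpt ι ρ _εb _ _ hσ hσ' hdet hnc hρ hSh
  exact h p hp k red σ σ' hcpt ι ρ hσ hσ' hdet hnc hρ hSh

/-- Target ⇒ crux: `ρ₀` and its three hypotheses are idle once the sector is known (pure logic). -/
theorem of_phantomRMSector (h : Summit.Langlands.Langlands.Theses.PhantomRMYoshida.PhantomRMSector) :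
    Summit.Langlands.Langlands.Theses.PhantomRMYoshida.ResiduallyYoshidaLifting := by
  intro p _ hp k _ _ _ _ _ red σ σ' hcpt ι ρ₀ ρ _εb _Aut _Sh hodd hodd' hσ hσ' hdet hnc _ _ _ hρ hSh
  exact h p hp k red σ σ' hcpt ι ρ hodd hodd' hσ hσ' hdet hnc hρ hSh

/-- RELATIVE = ABSOLUTE ON FIBRES.  The crux is equivalent to: on every residual fibre
`(p, k, red, σ̄, σ̄', hcpt, ι)` that carries SOME irreducible automorphic `Sh`-point, EVERY
irreducible `Sh`-point is automorphic.  (`ρ₀` is tied to `ρ` only through the fibre, never through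
a common `ρ̄`-extension class, level, or component.) -/
theorem iff_absoluteOnFibres :
    Summit.Langlands.Langlands.Theses.PhantomRMYoshida.ResiduallyYoshidaLifting ↔
    ∀ (p : ℕ) [Fact p.Prime], p ≠ 2 → ∀ (k : Type) [Field k] [CharP k p] [IsAlgClosed k]
      [TopologicalSpace k] [DiscreteTopology k] (red : Valued.integer (PadicAlgCl p) →+* k)
      (σ σ' : FramedGaloisRep ℚ k 2) (hcpt : isCompact_glFiniteIntegralLevel 4 ℚ) (ι : PadicAlgCl p ≃+* ℂ),
      σ.IsOdd → σ'.IsOdd → σ.toGaloisRep.IsIrreducible → σ'.toGaloisRep.IsIrreducible →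
      DetC p k σ σ' → (¬ ∃ g : GL (Fin 2) k, ∀ x, g * σ x * g⁻¹ = σ' x) →
      (∃ ρ₀ : FramedGaloisRep ℚ (PadicAlgCl p) 4,
        ρ₀.toGaloisRep.IsIrreducible ∧ Sh p k red σ σ' ρ₀ ∧ Aut p hcpt ι ρ₀) →
      ∀ ρ : FramedGaloisRep ℚ (PadicAlgCl p) 4,
        ρ.toGaloisRep.IsIrreducible → Sh p k red σ σ' ρ → Aut p hcpt ι ρ := by
  constructor
  · intro h p _ hp k _ _ _ _ _ red σ σ' hcpt ι hodd hodd' hσ hσ' hdet hnc ⟨ρ₀, h₀, hSh₀, hA₀⟩ ρ hρ hSh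
    exact h p hp k red σ σ' hcpt ι ρ₀ ρ hodd hodd' hσ hσ' hdet hnc h₀ hSh₀ hA₀ hρ hSh
  · intro h p _ hp k _ _ _ _ _ red σ σ' hcpt ι ρ₀ ρ _εb _Aut _Sh hodd hodd' hσ hσ' hdet hnc h₀ hSh₀ hA₀ hρ hSh
    exact h p hp k red σ σ' hcpt ι hodd hodd' hσ hσ' hdet hnc ⟨ρ₀, h₀, hSh₀, hA₀⟩ ρ hρ hSh


/-! ## §3 TARGETS — the four registered stubs of `Lines/yoshida-divisor-selmer-count.lean` -/

/-! ### T1 — `LocalCriterionDatum` is inert modulo its own `reflects`-conclusion -/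

/-- The TRIVIAL numerical-criterion datum: `O = A = B = ℤ₂`, `φ = π = id`; then `η = ⊤ ≠ ⊥`,
`Φ = ℓ(0) = 0 ≤ Ψ`, and `reflects` is exactly the hypothesis `h`.  So whoever proves STUB 1 may
fill the field `heightOne_criterion` without any Wiles–Lenstra data as soon as the modularity
conclusion at `P` is known by other means. -/
def trivialLocalCriterionDatum {R : Type} [CommRing R] {K P : Ideal R}
    (h : ∀ 𝔮 ∈ minimalPrimes R, 𝔮 ≤ P → K ≤ 𝔮) : LocalCriterionDatum K P where
  O := ℤ_[2]
  A := ℤ_[2]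
  B := ℤ_[2]
  φ := AlgHom.id ℤ_[2] ℤ_[2]
  π := AlgHom.id ℤ_[2] ℤ_[2]
  surjective := Function.surjective_id
  eta_ne_bot := by
    have hk : RingHom.ker ((AlgHom.id ℤ_[2] ℤ_[2] : ℤ_[2] →ₐ[ℤ_[2]] ℤ_[2]) : ℤ_[2] →+* ℤ_[2]) = ⊥ := by
      ext x; simp [RingHom.mem_ker]
    rw [hk, Submodule.annihilator_bot, Ideal.map_top]
    exact top_ne_bot
  phi_le_psi := by
    have hk : RingHom.ker (((AlgHom.id ℤ_[2] ℤ_[2] : ℤ_[2] →ₐ[ℤ_[2]] ℤ_[2]) : ℤ_[2] →+* ℤ_[2]).comp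
        ((AlgHom.id ℤ_[2] ℤ_[2] : ℤ_[2] →ₐ[ℤ_[2]] ℤ_[2]) : ℤ_[2] →+* ℤ_[2])) = ⊥ := by
      ext x; simp [RingHom.mem_ker]
    have hsub : Subsingleton (RingHom.ker (((AlgHom.id ℤ_[2] ℤ_[2] : ℤ_[2] →ₐ[ℤ_[2]] ℤ_[2]) :
        ℤ_[2] →+* ℤ_[2]).comp ((AlgHom.id ℤ_[2] ℤ_[2] : ℤ_[2] →ₐ[ℤ_[2]] ℤ_[2]) :
        ℤ_[2] →+* ℤ_[2]))).Cotangent := by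
      rw [Ideal.cotangent_subsingleton_iff, hk]
      simp [IsIdempotentElem]
    rw [Module.length_eq_zero_iff.mpr hsub]
    exact bot_le
  reflects := fun _ => h

/-- Unconditional direction: the modularity conclusion at `P` already yields a datum. -/
theorem nonempty_localCriterionDatum_of {R : Type} [CommRing R] {K P : Ideal R}
    (h : ∀ 𝔮 ∈ minimalPrimes R, 𝔮 ≤ P → K ≤ 𝔮) : Nonempty (LocalCriterionDatum K P) :=
  ⟨trivialLocalCriterionDatum h⟩

/-- Modulo STUB 2, a height-one datum exists IFF its `reflects`-conclusion holds: the datum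
carries no information beyond "every minimal prime of `R` inside `P` is modular". -/
theorem nonempty_localCriterionDatum_iff (h₂ : NumericalCriterionDVR) {R : Type} [CommRing R]
    {K P : Ideal R} :
    Nonempty (LocalCriterionDatum K P) ↔ ∀ 𝔮 ∈ minimalPrimes R, 𝔮 ≤ P → K ≤ 𝔮 := by
  refine ⟨fun ⟨L⟩ => ?_, nonempty_localCriterionDatum_of⟩
  exact L.reflects (h₂ L.O L.A L.B L.φ L.π L.surjective L.eta_ne_bot L.phi_le_psi)

/-! ### T1' — STUB 1 is equivalent (mod STUBS 2–3) to "every irreducible `Sh`-point is an ordinary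
classical limit"; the datum's ring-theoretic fields are inert -/

/-- `EveryShIsLimit`: on every admissible residual fibre, every irreducible `Sh`-representation is
an ordinary classical limit.  (Same binders as `YoshidaFamilyExists`, conclusion replaced.) -/
def EveryShIsLimit : Prop :=
  ∀ (p : ℕ) [Fact p.Prime], p ≠ 2 → ∀ (k : Type) [Field k] [CharP k p] [IsAlgClosed k]
    [TopologicalSpace k] [DiscreteTopology k] (red : Valued.integer (PadicAlgCl p) →+* k)
    (σ σ' : FramedGaloisRep ℚ k 2) (hcpt : isCompact_glFiniteIntegralLevel 4 ℚ) (ι : PadicAlgCl p ≃+* ℂ)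
    (ρ : FramedGaloisRep ℚ (PadicAlgCl p) 4),
    σ.toGaloisRep.IsIrreducible → σ'.toGaloisRep.IsIrreducible → DetC p k σ σ' →
    (¬ ∃ g : GL (Fin 2) k, ∀ x, g * σ x * g⁻¹ = σ' x) →
    ρ.toGaloisRep.IsIrreducible → Sh p k red σ σ' ρ → IsOrdinaryClassicalLimit p hcpt ι ρ

/-- THE WHOLE LINE IN ONE LINE: limit property + classicality of limits ⇒ `Absolute` (⇒ crux).
STUBS 2–3 and every ring-theoretic field of the datum are bypassed. -/
theorem absolute_of_limit_of_classicality (hL : EveryShIsLimit) (h₄ : OrdinaryLimitClassicality) :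
    Absolute := by
  intro p _ hp k _ _ _ _ _ red σ σ' hcpt ι ρ hσ hσ' hdet hnc hρ hSh
  exact h₄ p hp k red σ σ' hcpt ι ρ hσ hσ' hdet hnc hρ hSh
    (hL p hp k red σ σ' hcpt ι ρ hσ hσ' hdet hnc hρ hSh)

open scoped Classical in
/-- A chosen Frobenius polynomial of `ρ` at `v` (junk `0` if none exists). -/
def frobPolyChoice {p : ℕ} [Fact p.Prime] (ρ : FramedGaloisRep ℚ (PadicAlgCl p) 4)
    (v : HeightOneSpectrum (NumberField.RingOfIntegers ℚ)) : Polynomial (PadicAlgCl p) :=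
  if h : ∃ P : Polynomial (PadicAlgCl p), ρ.HasFrobCharpolyAt v P then h.choose else 0

theorem hasFrobCharpolyAt_frobPolyChoice {p : ℕ} [Fact p.Prime]
    {ρ : FramedGaloisRep ℚ (PadicAlgCl p) 4} {v : HeightOneSpectrum (NumberField.RingOfIntegers ℚ)}
    (h : ∃ P : Polynomial (PadicAlgCl p), ρ.HasFrobCharpolyAt v P) :
    ρ.HasFrobCharpolyAt v (frobPolyChoice ρ v) := by
  classical
  rw [frobPolyChoice, dif_pos h]
  exact h.choose_spec

/-- `Sh ρ` supplies a Frobenius polynomial at almost every place. -/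
theorem eventually_exists_hasFrobCharpolyAt_of_sh {p : ℕ} [Fact p.Prime] {k : Type} [Field k]
    [TopologicalSpace k] {red : Valued.integer (PadicAlgCl p) →+* k} {σ σ' : FramedGaloisRep ℚ k 2}
    {ρ : FramedGaloisRep ℚ (PadicAlgCl p) 4} (hSh : Sh p k red σ σ' ρ) :
    ∀ᶠ v : HeightOneSpectrum (NumberField.RingOfIntegers ℚ) in Filter.cofinite,
      ∃ P : Polynomial (PadicAlgCl p), ρ.HasFrobCharpolyAt v P := by
  filter_upwards [hSh.2.2] with v hv
  obtain ⟨_, _, _, P, _, _, hP, _⟩ := hv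
  exact ⟨_, hP⟩

/-- THE JUNK YOSHIDA FAMILY DATUM.  `R = ℚ̄_p` (a field: Noetherian, local, one minimal prime `⊥`),
`I = K = ⊥`, `x = id`, `univPoly v` = the Frobenius polynomial of `ρ` itself; `yoshida_minimal`,
`connected₂`, `generic_propagation`, `heightOne_criterion` hold trivially (T1), and
`classicalLimit` is discharged by the GLOBAL limit hypothesis on the fibre (its `r` is an arbitrary
irreducible `Sh`-representation anyway, since ring endomorphisms `y` of `ℚ̄_p` are wild). -/
def junkYoshidaFamilyDatum {p : ℕ} [Fact p.Prime] (hcpt : isCompact_glFiniteIntegralLevel 4 ℚ)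
    (ι : PadicAlgCl p ≃+* ℂ) {k : Type} [Field k] [TopologicalSpace k]
    (red : Valued.integer (PadicAlgCl p) →+* k) (σ σ' : FramedGaloisRep ℚ k 2)
    (ρ : FramedGaloisRep ℚ (PadicAlgCl p) 4)
    (hae : ∀ᶠ v : HeightOneSpectrum (NumberField.RingOfIntegers ℚ) in Filter.cofinite,
      ∃ P : Polynomial (PadicAlgCl p), ρ.HasFrobCharpolyAt v P)
    (hlim : ∀ r : FramedGaloisRep ℚ (PadicAlgCl p) 4,
      r.toGaloisRep.IsIrreducible → Sh p k red σ σ' r → IsOrdinaryClassicalLimit p hcpt ι r) :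
    YoshidaFamilyDatum p hcpt ι k red σ σ' ρ where
  R := PadicAlgCl p
  I := ⊥
  K := ⊥
  modular_le_reducible := le_rfl
  univPoly := frobPolyChoice ρ
  x := RingHom.id (PadicAlgCl p)
  charpoly_x := by
    filter_upwards [hae] with v hv
    simpa only [Polynomial.map_id] using hasFrobCharpolyAt_frobPolyChoice hv
  yoshida_minimal := ⟨⊥, by simp [IsDomain.minimalPrimes_eq_singleton_bot], le_rfl⟩
  connected₂ := by
    intro 𝒜 h𝒜 hne hne'
    exfalso
    obtain ⟨q, hq, hq'⟩ := hne'
    obtain ⟨q₀, hq₀⟩ := hne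
    have h1 : q = ⊥ := by simpa [IsDomain.minimalPrimes_eq_singleton_bot] using hq
    have h2 : q₀ = ⊥ := by simpa [IsDomain.minimalPrimes_eq_singleton_bot] using h𝒜 hq₀
    exact hq' (h1 ▸ h2 ▸ hq₀)
  generic_propagation := fun _ _ _ _ _ _ _ _ => bot_le
  heightOne_criterion := fun _ _ _ _ => nonempty_localCriterionDatum_of fun _ _ _ => bot_le
  classicalLimit := fun r _ hirr hSh _ _ => hlim r hirr hSh

/-- UNCONDITIONAL: the limit property on fibres gives STUB 1 (junk datum). -/
theorem yoshidaFamilyExists_of_everyShIsLimit (hL : EveryShIsLimit) : YoshidaFamilyExists := by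
  intro p _ hp k _ _ _ _ _ red σ σ' hcpt ι ρ hσ hσ' hdet hnc hρ hSh
  exact ⟨junkYoshidaFamilyDatum hcpt ι red σ σ' ρ (eventually_exists_hasFrobCharpolyAt_of_sh hSh)
    fun r hr hShr => hL p hp k red σ σ' hcpt ι r hσ hσ' hdet hnc hr hShr⟩

/-- (Copy of the lead's glue.) In a datum, STUBS 2–3 make every minimal prime modular. -/
theorem modular_of_datum (h₂ : NumericalCriterionDVR) (h₃ : StableComponentsModular)
    {p : ℕ} [Fact p.Prime] {hcpt : isCompact_glFiniteIntegralLevel 4 ℚ} {ι : PadicAlgCl p ≃+* ℂ}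
    {k : Type} [Field k] [TopologicalSpace k] {red : Valued.integer (PadicAlgCl p) →+* k}
    {σ σ' : FramedGaloisRep ℚ k 2} {ρ : FramedGaloisRep ℚ (PadicAlgCl p) 4}
    (D : YoshidaFamilyDatum p hcpt ι k red σ σ' ρ) :
    ∀ 𝔮 ∈ minimalPrimes D.R, D.K ≤ 𝔮 := by
  refine h₃ D.R D.I D.K D.modular_le_reducible D.yoshida_minimal D.connected₂ D.generic_propagation ?_
  intro P hP hIP hdim 𝔮 h𝔮 hle
  obtain ⟨L⟩ := D.heightOne_criterion P hP hIP hdim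
  exact L.reflects (h₂ L.O L.A L.B L.φ L.π L.surjective L.eta_ne_bot L.phi_le_psi) 𝔮 h𝔮 hle

/-- (Copy of the lead's glue.) Hence the point `x_ρ` is an ordinary classical limit. -/
theorem isOrdinaryClassicalLimit_of_datum (h₂ : NumericalCriterionDVR) (h₃ : StableComponentsModular)
    {p : ℕ} [Fact p.Prime] {hcpt : isCompact_glFiniteIntegralLevel 4 ℚ} {ι : PadicAlgCl p ≃+* ℂ}
    {k : Type} [Field k] [TopologicalSpace k] {red : Valued.integer (PadicAlgCl p) →+* k}
    {σ σ' : FramedGaloisRep ℚ k 2} {ρ : FramedGaloisRep ℚ (PadicAlgCl p) 4}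
    (D : YoshidaFamilyDatum p hcpt ι k red σ σ' ρ)
    (hirr : ρ.toGaloisRep.IsIrreducible) (hSh : Sh p k red σ σ' ρ) :
    IsOrdinaryClassicalLimit p hcpt ι ρ := by
  haveI : (RingHom.ker D.x).IsPrime := RingHom.ker_isPrime D.x
  obtain ⟨𝔮, h𝔮, hle⟩ := Ideal.exists_minimalPrimes_le (bot_le : (⊥ : Ideal D.R) ≤ RingHom.ker D.x)
  exact D.classicalLimit ρ D.x hirr hSh D.charpoly_x ⟨𝔮, h𝔮, hle, modular_of_datum h₂ h₃ D 𝔮 h𝔮⟩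

/-- CONDITIONAL converse: modulo STUBS 2–3, STUB 1 gives the limit property. -/
theorem everyShIsLimit_of_yoshidaFamilyExists (h₂ : NumericalCriterionDVR)
    (h₃ : StableComponentsModular) (h₁ : YoshidaFamilyExists) : EveryShIsLimit := by
  intro p _ hp k _ _ _ _ _ red σ σ' hcpt ι ρ hσ hσ' hdet hnc hρ hSh
  obtain ⟨D⟩ := h₁ p hp k red σ σ' hcpt ι ρ hσ hσ' hdet hnc hρ hSh
  exact isOrdinaryClassicalLimit_of_datum h₂ h₃ D hρ hSh

/-- STUB 1 ⟺ limit property, modulo the two algebra stubs (both TRUE: T2, T3).  The `←` direction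
is unconditional (`yoshidaFamilyExists_of_everyShIsLimit`). -/
theorem yoshidaFamilyExists_iff_everyShIsLimit (h₂ : NumericalCriterionDVR)
    (h₃ : StableComponentsModular) : YoshidaFamilyExists ↔ EveryShIsLimit :=
  ⟨everyShIsLimit_of_yoshidaFamilyExists h₂ h₃, yoshidaFamilyExists_of_everyShIsLimit⟩

/-- T0: the four stubs prove `Absolute` — `ρ₀`, `Sh ρ₀`, `Aut ρ₀` are never consumed by the line. -/
theorem absolute_of_stubs (h₁ : YoshidaFamilyExists) (h₂ : NumericalCriterionDVR)
    (h₃ : StableComponentsModular) (h₄ : OrdinaryLimitClassicality) : Absolute :=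
  absolute_of_limit_of_classicality (everyShIsLimit_of_yoshidaFamilyExists h₂ h₃ h₁) h₄

/-- … and hence the crux (same composition as the lead's `ResiduallyYoshidaLifting_of`). -/
theorem crux_of_stubs (h₁ : YoshidaFamilyExists) (h₂ : NumericalCriterionDVR)
    (h₃ : StableComponentsModular) (h₄ : OrdinaryLimitClassicality) :
    Summit.Langlands.Langlands.Theses.PhantomRMYoshida.ResiduallyYoshidaLifting :=
  crux_of_absolute (absolute_of_stubs h₁ h₂ h₃ h₄)


/-! ### T4 — STUB 4 (`OrdinaryLimitClassicality`): two misstatement-grade hazards -/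

/-! (a) [ADOPTED by the lead, skeleton sha edead940…, 2026-08-16T00:58Z] STUB 4 was registered at
first WITHOUT the residual hypotheses (`σ̄, σ̄'` irreducible / `DetC` / non-conjugate); the re-registered
`OrdinaryLimitClassicality` (§0) now carries them, exactly the `OrdinaryLimitClassicalityRes` this file
proposed. -/

/-- (b) The (2,2)-chamber shape `(0, N, N+1, 2N+1)` (Siegel weight `(N+2, N+2)`, `N = (p-1)p^(n-1)·m`)
is regular … -/
theorem strictMono_shape22 (N : ℕ) (hN : 1 ≤ N) :
    StrictMono (![0, N, N + 1, 2 * N + 1] : Fin 4 → ℕ) := by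
  refine Fin.strictMono_iff_lt_succ.2 fun i => ?_
  fin_cases i <;> simp
  all_goals omega

/-- … and so is the (1,3)-chamber shape `(0, 1, N, N+1)` (Siegel weight `(N+1, 3)`, p-adic limit
weight `(1,3)`, OUTSIDE the classical cone `k₁ ≥ k₂`). -/
theorem strictMono_shape13 (N : ℕ) (hN : 2 ≤ N) :
    StrictMono (![0, 1, N, N + 1] : Fin 4 → ℕ) := by
  refine Fin.strictMono_iff_lt_succ.2 fun i => ?_
  fin_cases i <;> simp
  all_goals omega

/-- Modulo `N` the (2,2)-chamber shape IS the crux's shape `(0,0,1,1)` positionally … -/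
theorem shape22_mod (N : ℕ) (hN : 2 ≤ N) :
    (fun i => (![0, N, N + 1, 2 * N + 1] : Fin 4 → ℕ) i % N) = ![0, 0, 1, 1] := by
  have h1 : N % N = 0 := Nat.mod_self N
  have h2 : (N + 1) % N = 1 := by
    rw [show N + 1 = 1 + N * 1 by ring, Nat.add_mul_mod_self_left, Nat.mod_eq_of_lt (by omega)]
  have h3 : (2 * N + 1) % N = 1 := by
    rw [show 2 * N + 1 = 1 + N * 2 by ring, Nat.add_mul_mod_self_left, Nat.mod_eq_of_lt (by omega)]
  have h0 : 0 % N = 0 := Nat.zero_mod N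
  funext i
  fin_cases i <;> simp [h0, h1, h2, h3]

/-- … whereas the (1,3)-chamber shape reduces to `(0,1,0,1)`: the same MULTISET of inertial
exponents (so trace congruences mod `p^n` cannot tell the chambers apart) … -/
theorem shape13_mod (N : ℕ) (hN : 2 ≤ N) :
    (fun i => (![0, 1, N, N + 1] : Fin 4 → ℕ) i % N) = ![0, 1, 0, 1] := by
  have h1 : N % N = 0 := Nat.mod_self N
  have h2 : (N + 1) % N = 1 := by
    rw [show N + 1 = 1 + N * 1 by ring, Nat.add_mul_mod_self_left, Nat.mod_eq_of_lt (by omega)]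
  have h0 : 0 % N = 0 := Nat.zero_mod N
  have h1' : 1 % N = 1 := Nat.mod_eq_of_lt (by omega)
  funext i
  fin_cases i <;> simp [h0, h1, h1', h2]

/-- … a permutation of `(0,0,1,1)` … -/
theorem shape13_sameMultiset :
    (![0, 1, 0, 1] : Fin 4 → ℕ) = (![0, 0, 1, 1] : Fin 4 → ℕ) ∘ Equiv.swap (1 : Fin 4) 2 := by
  decide

/-- … but NOT the crux's ordinary shape positionally: a (1,3)-chamber approximating sequence puts
the limit eigensystem at p-adic weight `(1,3)`, where weight-(2,2) classicality engines do not
apply (a GSp₄ companion-form transfer in irregular weight would be needed).  This is why the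
registered `IsOrdinaryClassicalLimit` now (sha edead940…) pins the shape positionally. -/
theorem shape13_ne_shape22 : (![0, 1, 0, 1] : Fin 4 → ℕ) ≠ ![0, 0, 1, 1] := by
  decide

/-! (b) [ADOPTED by the lead, skeleton sha edead940…] the re-registered `IsOrdinaryClassicalLimit` (§0)
now carries the positional congruence clause `a 0 = 0 ∧ a 1 ≡ 0 ∧ a 2 ≡ 1 ∧ a 3 ≡ 1 (mod (p-1)p^n)`
proposed here as `IsOrdinaryClassicalLimitPos`; the four shape lemmas above remain as its justification. -/

/-! ### T2 — STUB 2 (`NumericalCriterionDVR`): the `O`-rank-one case is Nakayama -/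

/-- The numerical criterion when `B = O` (so `π = id`, `η = ⊤`, `Ψ = 0`): the hypothesis forces
`Φ_A = 0`, i.e. `ker φ = (ker φ)²`, and Krull/Nakayama in the Noetherian local ring `A` gives
`ker φ = 0`.  Completeness of `A` and all hypotheses on `O` beyond non-triviality are unused here. -/
theorem numericalCriterionDVR_rankOne (O : Type) [CommRing O] [Nontrivial O]
    (A : Type) [CommRing A] [IsLocalRing A] [IsNoetherianRing A] [Algebra O A]
    (φ : A →ₐ[O] O) (π : O →ₐ[O] O) (hφ : Function.Surjective φ)
    (hle : Module.length O (RingHom.ker ((π : O →+* O).comp (φ : A →+* O))).Cotangent ≤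
      Module.length O (O ⧸ Ideal.map (π : O →+* O) (RingHom.ker (π : O →+* O)).annihilator)) :
    Function.Bijective φ := by
  have hπ : ∀ x, π x = x := fun x => by simpa using π.commutes x
  have hkerπ : RingHom.ker (π : O →+* O) = ⊥ := by
    ext x; simp [RingHom.mem_ker, hπ]
  have hR : Module.length O
      (O ⧸ Ideal.map (π : O →+* O) (RingHom.ker (π : O →+* O)).annihilator) = 0 := by
    rw [hkerπ, Submodule.annihilator_bot, Ideal.map_top]
    exact Module.length_eq_zero_iff.mpr (Ideal.Quotient.subsingleton_iff.mpr rfl)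
  have hker : RingHom.ker ((π : O →+* O).comp (φ : A →+* O)) = RingHom.ker (φ : A →+* O) := by
    ext x; simp [RingHom.mem_ker, hπ]
  rw [hR, nonpos_iff_eq_zero, Module.length_eq_zero_iff, Ideal.cotangent_subsingleton_iff, hker,
    Ideal.isIdempotentElem_iff_eq_bot_or_top_of_isLocalRing] at hle
  rcases hle with h | h
  · refine ⟨?_, hφ⟩
    have : Function.Injective (φ : A →+* O) := (RingHom.injective_iff_ker_eq_bot _).mpr h
    exact this
  · exfalso
    have h1 : (1 : A) ∈ RingHom.ker (φ : A →+* O) := h ▸ Submodule.mem_top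
    simp [RingHom.mem_ker] at h1


/-- (c) In `IsOrdinaryClassicalLimit` the clause `r'.IsResiduallyDistinguishedAt v a` is VACUOUS for
the `StrictMono a` demanded there: it follows from `r'.IsGreenbergOrdinaryOfShapeAt v a` (pairwise
distinct weights ⇒ no pair to distinguish; Literature
`IsCrystallineOrdinaryOfShape.isResiduallyDistinguishedOfShape_of_injective`).  So the approximants
are NOT required to be `p`-distinguished in any sense (the docstring's "residually distinguished at
`p`" is not captured); whatever Hida-theoretic control STUB 4 needs for them must be derived from
`Sh r` (distinguishedness of `r` in shape `(0,0,1,1)`) plus the congruences. -/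
theorem isResiduallyDistinguishedAt_of_greenberg_of_strictMono {p : ℕ} [Fact p.Prime]
    {v : HeightOneSpectrum (NumberField.RingOfIntegers ℚ)} {r' : FramedGaloisRep ℚ (PadicAlgCl p) 4}
    {a : Fin 4 → ℕ} (ha : StrictMono a) (h : r'.IsGreenbergOrdinaryOfShapeAt v a) :
    r'.IsResiduallyDistinguishedAt v a :=
  FramedRep.IsCrystallineOrdinaryOfShape.isResiduallyDistinguishedOfShape_of_injective
    (FramedGaloisRep.IsGreenbergOrdinaryOfShapeAt.isCrystallineOrdinaryOfShapeAt h) ha.injective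

/-- Hence `IsOrdinaryClassicalLimit` is equivalent to the same definition with the distinguishedness
conjunct deleted. -/
theorem isOrdinaryClassicalLimit_iff_withoutDistinguished {p : ℕ} [Fact p.Prime]
    (hcpt : isCompact_glFiniteIntegralLevel 4 ℚ) (ι : PadicAlgCl p ≃+* ℂ)
    (r : FramedGaloisRep ℚ (PadicAlgCl p) 4) :
    IsOrdinaryClassicalLimit p hcpt ι r ↔
    ∃ S : Set (HeightOneSpectrum (NumberField.RingOfIntegers ℚ)), S.Finite ∧
      ∀ n : ℕ, ∃ (r' : FramedGaloisRep ℚ (PadicAlgCl p) 4) (a : Fin 4 → ℕ),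
        Aut p hcpt ι r' ∧ StrictMono a ∧
        (a 0 = 0 ∧ (a 1 : ZMod ((p - 1) * p ^ n)) = 0 ∧ (a 2 : ZMod ((p - 1) * p ^ n)) = 1 ∧
          (a 3 : ZMod ((p - 1) * p ^ n)) = 1) ∧
        (∃ ν : Field.absoluteGaloisGroup ℚ → PadicAlgCl p, r'.IsSymplecticWithMultiplierFun ν) ∧
        (∀ v : HeightOneSpectrum (NumberField.RingOfIntegers ℚ),
          ((p : ℕ) : NumberField.RingOfIntegers ℚ) ∈ v.asIdeal → r'.IsGreenbergOrdinaryOfShapeAt v a) ∧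
        ∀ v ∉ S, r.IsUnramifiedAt v ∧ r'.IsUnramifiedAt v ∧
          ∃ P P' : Polynomial (Valued.integer (PadicAlgCl p)),
            r.HasFrobCharpolyAt v (P.map (Valued.integer (PadicAlgCl p)).subtype) ∧
            r'.HasFrobCharpolyAt v (P'.map (Valued.integer (PadicAlgCl p)).subtype) ∧
            ∀ i : ℕ, ‖((P.coeff i : Valued.integer (PadicAlgCl p)) : PadicAlgCl p) -
                ((P'.coeff i : Valued.integer (PadicAlgCl p)) : PadicAlgCl p)‖ ≤ ‖(p : PadicAlgCl p)‖ ^ n := by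
  constructor
  · rintro ⟨S, hS, h⟩
    refine ⟨S, hS, fun n => ?_⟩
    obtain ⟨r', a, hA, ha, hpos, hν, hord, hcong⟩ := h n
    exact ⟨r', a, hA, ha, hpos, hν, fun v hv => (hord v hv).1, hcong⟩
  · rintro ⟨S, hS, h⟩
    refine ⟨S, hS, fun n => ?_⟩
    obtain ⟨r', a, hA, ha, hpos, hν, hord, hcong⟩ := h n
    exact ⟨r', a, hA, ha, hpos, hν, fun v hv =>
      ⟨hord v hv, isResiduallyDistinguishedAt_of_greenberg_of_strictMono ha (hord v hv)⟩, hcong⟩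


/-! ### T3 — STUB 3 (`StableComponentsModular`) is TRUE: full proof (candidate for the lead) -/

open Order in
/-- In a Noetherian ring, if `dim R/J ≥ 2` then some prime `P ⊇ J` has `dim R/P = 2` EXACTLY:
take `P` maximal among the primes above `J` of coheight `≥ 2` (Noetherian induction on ideals);
maximality forces coheight exactly `2` (`Order.coheight_eq_coe_iff_maximal_le_coheight`).  No
finiteness of `dim R` is used (the skeleton's docstring argues via "a longer chain above `P`",
which is this lemma). -/
theorem exists_prime_ringKrullDim_quotient_eq_two {R : Type} [CommRing R] [IsNoetherianRing R]
    (J : Ideal R) (hJ : (2 : WithBot ℕ∞) ≤ ringKrullDim (R ⧸ J)) :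
    ∃ P : Ideal R, P.IsPrime ∧ J ≤ P ∧ ringKrullDim (R ⧸ P) = 2 := by
  classical
  rw [ringKrullDim_quotient] at hJ
  have hJ' : ((2 : ℕ) : WithBot ℕ∞) ≤ Order.krullDim (PrimeSpectrum.zeroLocus (R := R) J) := by
    exact_mod_cast hJ
  obtain ⟨l, hl⟩ := Order.le_krullDim_iff.mp hJ'
  let l' : LTSeries (PrimeSpectrum R) := l.map Subtype.val (fun _ _ h => h)
  have hhead : J ≤ (l.head).val.asIdeal := by
    have hmem := (l.head).property
    rw [PrimeSpectrum.mem_zeroLocus] at hmem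
    intro x hx
    exact hmem hx
  have hcoht₀ : (2 : ℕ∞) ≤ coheight (l.head).val := by
    have h := Order.length_le_coheight_head (p := l')
    have hlen : l'.length = 2 := by simp [l', hl]
    have hh : l'.head = (l.head).val := by simp [l']
    rw [hlen, hh] at h
    exact_mod_cast h
  let S : Set (Ideal R) :=
    {I | ∃ y : PrimeSpectrum R, y.asIdeal = I ∧ J ≤ I ∧ (2 : ℕ∞) ≤ coheight y}
  have hSne : S.Nonempty := ⟨_, (l.head).val, rfl, hhead, hcoht₀⟩
  obtain ⟨M, ⟨P, rfl, hJP, hP2⟩, hmax⟩ :=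
    set_has_maximal_iff_noetherian.mpr (inferInstance : IsNoetherian R R) S hSne
  refine ⟨P.asIdeal, P.isPrime, hJP, ?_⟩
  have hcoht : coheight P = (2 : ℕ) := by
    rw [Order.coheight_eq_coe_iff_maximal_le_coheight]
    refine ⟨by exact_mod_cast hP2, fun y hy hPy => ?_⟩
    have hyS : y.asIdeal ∈ S :=
      ⟨y, rfl, hJP.trans ((PrimeSpectrum.asIdeal_le_asIdeal _ _).mpr hPy), by exact_mod_cast hy⟩
    have hnot := hmax y.asIdeal hyS
    by_contra hyP
    refine hnot (lt_of_le_of_ne ((PrimeSpectrum.asIdeal_le_asIdeal _ _).mpr hPy) fun h => hyP ?_)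
    exact le_of_eq (PrimeSpectrum.ext h.symm)
  rw [← Literature.AlgebraicGeometry.Dimension.PrimeSpectrum.coe_coheight_eq_ringKrullDim_quotient P,
    hcoht]
  rfl

/-- **STUB 3 PROVED** (`stub_stableComponentsModular`, verbatim statement): modularity propagates
through the component graph.  `𝒜 := {𝔮 minimal | K ≤ 𝔮}` ∋ the Yoshida minimal prime; if some
minimal `𝔮 ∉ 𝒜`, `connected₂` gives `𝔮₁ ∈ 𝒜`, `𝔮₂ ∉ 𝒜` meeting in dimension `≥ 2`; `I ⊄ 𝔮₂`
(as `K ≤ I`); if `I ⊄ 𝔮₁` generic propagation puts `𝔮₂ ∈ 𝒜`, else a prime `P ⊇ 𝔮₁ ⊔ 𝔮₂ ⊇ I`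
with `dim R/P = 2` exactly (`exists_prime_ringKrullDim_quotient_eq_two`) does, by the height-one
input — contradiction.  `IsLocalRing R` is unused.  A prover may paste this proof (with the lemma
above and `import Literature.AlgebraicGeometry.Dimension.PointDimension`) into the skeleton. -/
theorem stableComponentsModular_holds : StableComponentsModular := by
  intro R _ _ _ I K hKI hyos hconn hgen hht 𝔮 h𝔮
  obtain ⟨𝔮₀, h𝔮₀, hI𝔮₀⟩ := hyos
  by_contra hK𝔮
  let 𝒜 : Set (Ideal R) := {q | q ∈ minimalPrimes R ∧ K ≤ q}
  have h𝒜sub : 𝒜 ⊆ minimalPrimes R := fun q hq => hq.1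
  have h𝒜ne : 𝒜.Nonempty := ⟨𝔮₀, h𝔮₀, hKI.trans hI𝔮₀⟩
  have h𝒜c : (minimalPrimes R \ 𝒜).Nonempty := ⟨𝔮, h𝔮, fun h => hK𝔮 h.2⟩
  obtain ⟨𝔮₁, h𝔮₁, 𝔮₂, h𝔮₂, hdim⟩ := hconn 𝒜 h𝒜sub h𝒜ne h𝒜c
  have h𝔮₂min : 𝔮₂ ∈ minimalPrimes R := h𝔮₂.1
  have hK𝔮₂ : ¬ K ≤ 𝔮₂ := fun h => h𝔮₂.2 ⟨h𝔮₂min, h⟩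
  have hI𝔮₂ : ¬ I ≤ 𝔮₂ := fun h => hK𝔮₂ (hKI.trans h)
  by_cases hI𝔮₁ : I ≤ 𝔮₁
  · obtain ⟨P, hP, hle, hdimP⟩ := exists_prime_ringKrullDim_quotient_eq_two (𝔮₁ ⊔ 𝔮₂) hdim
    exact hK𝔮₂ (hht P hP (hI𝔮₁.trans (le_sup_left.trans hle)) hdimP 𝔮₂ h𝔮₂min
      (le_sup_right.trans hle))
  · exact hK𝔮₂ (hgen 𝔮₁ h𝔮₁.1 𝔮₂ h𝔮₂min hI𝔮₁ hI𝔮₂ hdim h𝔮₁.2)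

/-- With STUB 3 discharged, STUB 1 ⟺ the limit property modulo STUB 2 alone. -/
theorem yoshidaFamilyExists_iff_everyShIsLimit' (h₂ : NumericalCriterionDVR) :
    YoshidaFamilyExists ↔ EveryShIsLimit :=
  yoshidaFamilyExists_iff_everyShIsLimit h₂ stableComponentsModular_holds

/-- … and the crux follows from STUBS 1, 2, 4. -/
theorem crux_of_stubs124 (h₁ : YoshidaFamilyExists) (h₂ : NumericalCriterionDVR)
    (h₄ : OrdinaryLimitClassicality) :
    Summit.Langlands.Langlands.Theses.PhantomRMYoshida.ResiduallyYoshidaLifting :=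
  crux_of_stubs h₁ h₂ stableComponentsModular_holds h₄


/-! ### T3' — the datum's `generic_propagation` field over-demands; a weaker field suffices -/

/-- RESHAPE PROPOSAL for STUB 1's field `generic_propagation`.  As registered it must be proved for
EVERY pair of stable components `𝔮₁, 𝔮₂ ⊉ I` meeting in dimension `≥ 2` — including pairs whose
whole 2-dimensional meeting locus `V(𝔮₁ ⊔ 𝔮₂)` lies INSIDE the Yoshida divisor `V(I)` (e.g. two
stable components crossing `Y` along the same height-one locus of `Y`, a level-raising situation),
where the intended engine (Thorne / Allen–Newton–Thorne patching at a one-dimensional prime with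
ABSOLUTELY IRREDUCIBLE `ρ_𝔭`) has no prime to work at.  Those pairs are already handled by the
height-one input.  The weaker field below asks for propagation only across meetings that LEAVE `Y`
in dimension 2 (a coheight-2 prime `P ⊇ 𝔮₁ ⊔ 𝔮₂` with `I ⊄ P`; then `V(P) ⊄ Y` carries
one-dimensional primes off `Y`), and the propagation lemma survives (`stableComponentsModularWeak_holds`). -/
def StableComponentsModularWeak : Prop :=
  ∀ (R : Type) [CommRing R] [IsNoetherianRing R] [IsLocalRing R] (I K : Ideal R), K ≤ I →
    (∃ 𝔮 ∈ minimalPrimes R, I ≤ 𝔮) → IsConnectedInDimTwo R →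
    (∀ 𝔮₁ ∈ minimalPrimes R, ∀ 𝔮₂ ∈ minimalPrimes R, ¬ I ≤ 𝔮₁ → ¬ I ≤ 𝔮₂ →
      (∃ P : Ideal R, P.IsPrime ∧ 𝔮₁ ⊔ 𝔮₂ ≤ P ∧ ringKrullDim (R ⧸ P) = 2 ∧ ¬ I ≤ P) →
      K ≤ 𝔮₁ → K ≤ 𝔮₂) →
    (∀ P : Ideal R, P.IsPrime → I ≤ P → ringKrullDim (R ⧸ P) = 2 →
      ∀ 𝔮 ∈ minimalPrimes R, 𝔮 ≤ P → K ≤ 𝔮) →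
    ∀ 𝔮 ∈ minimalPrimes R, K ≤ 𝔮

/-- The propagation lemma with the WEAKER generic-propagation hypothesis (hence a stronger lemma). -/
theorem stableComponentsModularWeak_holds : StableComponentsModularWeak := by
  intro R _ _ _ I K hKI hyos hconn hgen hht 𝔮 h𝔮
  obtain ⟨𝔮₀, h𝔮₀, hI𝔮₀⟩ := hyos
  by_contra hK𝔮
  let 𝒜 : Set (Ideal R) := {q | q ∈ minimalPrimes R ∧ K ≤ q}
  have h𝒜sub : 𝒜 ⊆ minimalPrimes R := fun q hq => hq.1
  have h𝒜ne : 𝒜.Nonempty := ⟨𝔮₀, h𝔮₀, hKI.trans hI𝔮₀⟩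
  have h𝒜c : (minimalPrimes R \ 𝒜).Nonempty := ⟨𝔮, h𝔮, fun h => hK𝔮 h.2⟩
  obtain ⟨𝔮₁, h𝔮₁, 𝔮₂, h𝔮₂, hdim⟩ := hconn 𝒜 h𝒜sub h𝒜ne h𝒜c
  have h𝔮₂min : 𝔮₂ ∈ minimalPrimes R := h𝔮₂.1
  have hK𝔮₂ : ¬ K ≤ 𝔮₂ := fun h => h𝔮₂.2 ⟨h𝔮₂min, h⟩
  have hI𝔮₂ : ¬ I ≤ 𝔮₂ := fun h => hK𝔮₂ (hKI.trans h)
  obtain ⟨P, hP, hle, hdimP⟩ := exists_prime_ringKrullDim_quotient_eq_two (𝔮₁ ⊔ 𝔮₂) hdim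
  by_cases hIP : I ≤ P
  · exact hK𝔮₂ (hht P hP hIP hdimP 𝔮₂ h𝔮₂min (le_sup_right.trans hle))
  · have hI𝔮₁ : ¬ I ≤ 𝔮₁ := fun h => hIP (h.trans (le_sup_left.trans hle))
    exact hK𝔮₂ (hgen 𝔮₁ h𝔮₁.1 𝔮₂ h𝔮₂min hI𝔮₁ hI𝔮₂ ⟨P, hP, hle, hdimP, hIP⟩ h𝔮₁.2)

/-- The registered field implies the weaker one (so the reshape only REMOVES an obligation from
STUB 1): a coheight-2 prime above `𝔮₁ ⊔ 𝔮₂` already gives `2 ≤ dim R/(𝔮₁ ⊔ 𝔮₂)`. -/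
theorem genericPropagationWeak_of_registered {R : Type} [CommRing R] {I K : Ideal R}
    (hgen : ∀ 𝔮₁ ∈ minimalPrimes R, ∀ 𝔮₂ ∈ minimalPrimes R, ¬ I ≤ 𝔮₁ → ¬ I ≤ 𝔮₂ →
      (2 : WithBot ℕ∞) ≤ ringKrullDim (R ⧸ (𝔮₁ ⊔ 𝔮₂)) → K ≤ 𝔮₁ → K ≤ 𝔮₂) :
    ∀ 𝔮₁ ∈ minimalPrimes R, ∀ 𝔮₂ ∈ minimalPrimes R, ¬ I ≤ 𝔮₁ → ¬ I ≤ 𝔮₂ →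
      (∃ P : Ideal R, P.IsPrime ∧ 𝔮₁ ⊔ 𝔮₂ ≤ P ∧ ringKrullDim (R ⧸ P) = 2 ∧ ¬ I ≤ P) →
      K ≤ 𝔮₁ → K ≤ 𝔮₂ := by
  intro 𝔮₁ h𝔮₁ 𝔮₂ h𝔮₂ hI₁ hI₂ ⟨P, _, hle, hdimP, _⟩ hK₁
  refine hgen 𝔮₁ h𝔮₁ 𝔮₂ h𝔮₂ hI₁ hI₂ ?_ hK₁
  rw [← hdimP]
  exact ringKrullDim_le_of_surjective (Ideal.Quotient.factor hle) (Ideal.Quotient.factor_surjective hle)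


/-! ## §4 Re-derived mutation lemmas (gens 1–2): oddness is decoration -/

/-- The route's inline `εb p` IS the Literature mod-`p` cyclotomic character `χ_p` of `Γ_ℚ`
(definitionally). -/
theorem εb_eq_modNCyclotomicCharacter (p : ℕ) [Fact p.Prime] :
    εb p = modNCyclotomicCharacter ℚ p := rfl

/-- `ε̄(c) = -1` for every complex conjugation `c ∈ Γ_ℚ` (any `p`; Literature
`modNCyclotomicCharacter_of_isComplexConjugation`: `conj` inverts roots of unity). -/
theorem εb_of_isComplexConjugation (p : ℕ) [Fact p.Prime] {φ : ℚ →+* ℝ}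
    {c : Field.absoluteGaloisGroup ℚ} (hc : IsComplexConjugation φ c) : εb p c = -1 := by
  ext
  rw [εb_eq_modNCyclotomicCharacter, Units.val_neg, Units.val_one]
  exact modNCyclotomicCharacter_of_isComplexConjugation (K := ℚ) (N := p) hc

/-- `det σ̄ = ε̄⁻¹ ⇒ σ̄ odd` (and likewise `σ̄'`): BOTH oddness hypotheses of the crux follow from
its determinant clause `DetC` — they are decoration (the planner says so; here it is checked). -/
theorem isOdd_of_detC {p : ℕ} [Fact p.Prime] {k : Type} [Field k] [CharP k p] [TopologicalSpace k]
    [DiscreteTopology k] {σ σ' : FramedGaloisRep ℚ k 2} (hdet : DetC p k σ σ') :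
    σ.IsOdd ∧ σ'.IsOdd := by
  have key : ∀ (φ : ℚ →+* ℝ) (c : Field.absoluteGaloisGroup ℚ), IsComplexConjugation φ c →
      FramedRep.det σ c = -1 := by
    intro φ c hc
    rw [(hdet c).1, εb_of_isComplexConjugation p hc]
    ext
    simp
  refine ⟨(FramedGaloisRep.isOdd_iff σ).2 key, (FramedGaloisRep.isOdd_iff σ').2 fun φ c hc => ?_⟩
  rw [(hdet c).2]
  exact key φ c hc

/-- The crux is equivalent to itself WITHOUT the two oddness hypotheses. -/
theorem iff_withoutOdd :
    Summit.Langlands.Langlands.Theses.PhantomRMYoshida.ResiduallyYoshidaLifting ↔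
    ∀ (p : ℕ) [Fact p.Prime], p ≠ 2 → ∀ (k : Type) [Field k] [CharP k p] [IsAlgClosed k]
      [TopologicalSpace k] [DiscreteTopology k] (red : Valued.integer (PadicAlgCl p) →+* k)
      (σ σ' : FramedGaloisRep ℚ k 2) (hcpt : isCompact_glFiniteIntegralLevel 4 ℚ) (ι : PadicAlgCl p ≃+* ℂ)
      (ρ₀ ρ : FramedGaloisRep ℚ (PadicAlgCl p) 4),
      σ.toGaloisRep.IsIrreducible → σ'.toGaloisRep.IsIrreducible →
      DetC p k σ σ' → (¬ ∃ g : GL (Fin 2) k, ∀ x, g * σ x * g⁻¹ = σ' x) →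
      ρ₀.toGaloisRep.IsIrreducible → Sh p k red σ σ' ρ₀ → Aut p hcpt ι ρ₀ →
      ρ.toGaloisRep.IsIrreducible → Sh p k red σ σ' ρ → Aut p hcpt ι ρ := by
  constructor
  · intro h p _ hp k _ _ _ _ _ red σ σ' hcpt ι ρ₀ ρ hσ hσ' hdet hnc h₀ hSh₀ hA₀ hρ hSh
    exact h p hp k red σ σ' hcpt ι ρ₀ ρ (isOdd_of_detC hdet).1 (isOdd_of_detC hdet).2 hσ hσ' hdet
      hnc h₀ hSh₀ hA₀ hρ hSh
  · intro h p _ hp k _ _ _ _ _ red σ σ' hcpt ι ρ₀ ρ _εb _Aut _Sh _ _ hσ hσ' hdet hnc h₀ hSh₀ hA₀ hρ hSh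
    exact h p hp k red σ σ' hcpt ι ρ₀ ρ hσ hσ' hdet hnc h₀ hSh₀ hA₀ hρ hSh

/-- Hence the target sector IS the absolute statement (oddness dropped). -/
theorem phantomRMSector_iff_absolute :
    Summit.Langlands.Langlands.Theses.PhantomRMYoshida.PhantomRMSector ↔ Absolute := by
  refine ⟨fun h => ?_, phantomRMSector_of_absolute⟩
  intro p _ hp k _ _ _ _ _ red σ σ' hcpt ι ρ hσ hσ' hdet hnc hρ hSh
  exact h p hp k red σ σ' hcpt ι ρ (isOdd_of_detC hdet).1 (isOdd_of_detC hdet).2 hσ hσ' hdet hnc hρ hSh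


/-! ## §5 TARGETS on the other two registered lines (2026-08-16T00:18Z `endoscopic-crossing-euler`,
00:45Z `cross-regular-annihilator-primes` — the ACTIVE skeleton; no `PICKED.md` yet) -/

/-! ### T5 — ONE numerical criterion for two lines: line 1's STUB 2 = line 3's Stub 1 = the forward
half of Literature's Criterion I -/

/-- Line 1's `NumericalCriterionDVR` (`stub_numericalCriterionDVR`) and line 3's
`stub_numericalCriterion` (`endoscopic-crossing-euler`, stated over Literature's `congruenceIdeal`,
`CotangentModule`, `CongruenceModule`) are the SAME statement (binder order and definitional
unfolding aside): one proof serves both lines. -/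
theorem numericalCriterionDVR_iff_line3 :
    NumericalCriterionDVR ↔
    ∀ (O : Type) [CommRing O] [IsDomain O] [IsDiscreteValuationRing O]
      [IsAdicComplete (IsLocalRing.maximalIdeal O) O]
      (R : Type) [CommRing R] [IsLocalRing R] [IsNoetherianRing R]
      [IsAdicComplete (IsLocalRing.maximalIdeal R) R] [Algebra O R]
      (T : Type) [CommRing T] [IsLocalRing T] [Algebra O T] [Module.Finite O T] [Module.Free O T]
      (φ : R →ₐ[O] T) (π : T →ₐ[O] O),
      Function.Surjective φ → Literature.RingTheory.CompleteIntersection.congruenceIdeal π ≠ ⊥ →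
        Module.length O (Literature.RingTheory.CompleteIntersection.CotangentModule (π.comp φ)) ≤
          Module.length O (Literature.RingTheory.CompleteIntersection.CongruenceModule π) →
          Function.Bijective φ := by
  constructor
  · intro h O _ _ _ _ R _ _ _ _ _ T _ _ _ _ _ φ π hφ hη hle
    exact h O R T φ π hφ hη hle
  · intro h O _ _ _ _ A _ _ _ _ _ B _ _ _ _ _ φ π hφ hη hle
    exact h O A B φ π hφ hη hle

/-- … and both follow from the ONE unproved named Literature fact `numericalCriterion_eq_iff`
(de Smit–Rubin–Schoof 1997, Criterion I, case of equality) together with the PROVED inequality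
`numericalCriterion_le_holds`, via Literature's `bijective_of_numericalCriterion`.  So STUB 2 of
line 1 / Stub 1 of line 3 is exactly the debt `numericalCriterion_eq_iff.{0,0,0}` (forward half). -/
theorem numericalCriterionDVR_of_literature
    (h : Literature.RingTheory.CompleteIntersection.numericalCriterion_eq_iff.{0, 0, 0}) :
    NumericalCriterionDVR := by
  intro O _ _ _ _ A _ _ _ _ _ B _ _ _ _ _ φ π hφ hη hle
  exact Literature.RingTheory.CompleteIntersection.bijective_of_numericalCriterion
    Literature.RingTheory.CompleteIntersection.numericalCriterion_le_holds h φ π hφ hη hle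


/-! ### T6 — line `cross-regular-annihilator-primes` (ACTIVE skeleton, 5 stubs) -/

open scoped Matrix Classical

/-! ### Verbatim copy of the currency of line `cross-regular-annihilator-primes` (`CrossRegularCurrency.lean`,
mirror block of the skeleton sha 623781a5…), under the sub-namespace `CR` -/

namespace CR

variable {p : ℕ} [Fact p.Prime] {k : Type} [Field k] [TopologicalSpace k]

/-- The route's inline mod-`p` cyclotomic character `ε̄ : Γ_ℚ → (ℤ/p)ˣ` (verbatim the crux's `let εb`;
Mathlib `modularCyclotomicCharacter` on `Γ_ℚ`). [folklore] -/
def epsBar (p : ℕ) [Fact p.Prime] : Field.absoluteGaloisGroup ℚ →* (ZMod p)ˣ :=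
  (modularCyclotomicCharacter (AlgebraicClosure ℚ)
    (HasEnoughRootsOfUnity.natCard_rootsOfUnity (AlgebraicClosure ℚ) p)).comp
    (MulSemiringAction.toRingAut (Field.absoluteGaloisGroup ℚ) (AlgebraicClosure ℚ))

/-- The crux's determinant clause `det σ̄ = ε̄⁻¹ = det σ̄'` (verbatim). [folklore] -/
def DetCond (p : ℕ) [Fact p.Prime] {k : Type} [Field k] [CharP k p] [TopologicalSpace k] [DiscreteTopology k]
    (σ σ' : Literature.NumberTheory.GaloisRepresentations.FramedGaloisRep ℚ k 2) : Prop :=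
  ∀ g, Literature.NumberTheory.GaloisRepresentations.FramedRep.det σ g = (Units.map (ZMod.castHom (dvd_refl p) k).toMonoidHom (epsBar p g))⁻¹ ∧
    Literature.NumberTheory.GaloisRepresentations.FramedRep.det σ' g = Literature.NumberTheory.GaloisRepresentations.FramedRep.det σ g

/-- The crux's shape clause `Sh r` (verbatim the route's `let Sh`): `r` symplectic with multiplier `ε⁻¹`,
Greenberg-ordinary of Hodge–Tate shape `(0,0,1,1)` and residually distinguished at `p`, and residually
`σ̄ ⊕ σ̄'` through `red` on almost all Frobenius polynomials. [cite: BoxerEtAl2021, §2 and §7.3 (conventions)] -/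
def Sh (σ σ' : Literature.NumberTheory.GaloisRepresentations.FramedGaloisRep ℚ k 2) (red : Valued.integer (PadicAlgCl p) →+* k) (r : Literature.NumberTheory.GaloisRepresentations.FramedGaloisRep ℚ (PadicAlgCl p) 4) : Prop :=
  r.IsSymplecticWithMultiplierFun (fun g => algebraMap ℚ_[p] (PadicAlgCl p)
    ((((Literature.NumberTheory.GaloisRepresentations.GaloisRep.cyclotomicCharacter ℚ p g)⁻¹ : ℤ_[p]ˣ) : ℤ_[p]) : ℚ_[p])) ∧
  (∀ v : IsDedekindDomain.HeightOneSpectrum (NumberField.RingOfIntegers ℚ), ((p : ℕ) : NumberField.RingOfIntegers ℚ) ∈ v.asIdeal →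
    r.IsGreenbergOrdinaryOfShapeAt v ![0, 0, 1, 1] ∧ r.IsResiduallyDistinguishedAt v ![0, 0, 1, 1]) ∧
  (∀ᶠ v : IsDedekindDomain.HeightOneSpectrum (NumberField.RingOfIntegers ℚ) in Filter.cofinite, r.IsUnramifiedAt v ∧ σ.IsUnramifiedAt v ∧ σ'.IsUnramifiedAt v ∧
    ∃ (P : Polynomial (Valued.integer (PadicAlgCl p))) (P₁ P₂ : Polynomial k),
      r.HasFrobCharpolyAt v (P.map (Valued.integer (PadicAlgCl p)).subtype) ∧
      σ.HasFrobCharpolyAt v P₁ ∧ σ'.HasFrobCharpolyAt v P₂ ∧ P.map red = P₁ * P₂)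

/-- The crux's automorphy clause `Aut r` (verbatim the route's `let Aut`): an L-algebraic cuspidal `π` on
`GL₄(𝔸_ℚ)` whose Satake parameters give the arithmetic-Frobenius polynomials of `r` at almost all places.
[cite: BuzzardGeeLMS2014, Conj. 3.2.1 (normalisation)] -/
def Aut (hcpt : Literature.NumberTheory.Automorphic.isCompact_glFiniteIntegralLevel 4 ℚ) (ι : PadicAlgCl p ≃+* ℂ)
    (r : Literature.NumberTheory.GaloisRepresentations.FramedGaloisRep ℚ (PadicAlgCl p) 4) : Prop :=
  ∃ π : Literature.NumberTheory.Automorphic.CuspidalAutomorphicRepData 4 ℚ hcpt, π.1.IsLAlgebraic ∧ ∀ᶠ v : IsDedekindDomain.HeightOneSpectrum (NumberField.RingOfIntegers ℚ) in Filter.cofinite, ∃ a : Multiset ℂ,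
    π.1.HasSatakeParamAt v a ∧ r.IsUnramifiedAt v ∧
      r.HasFrobCharpolyAt v (Literature.NumberTheory.Automorphic.arithFrobPolyOfSatake ι v.residueCard 1 a)

/-- Residual GENERICITY of a ×-configuration `{a, q a | b, q b}` in `k`: the four eigenvalues are pairwise
distinct and neither residual constituent has an internal ratio `q^{±1}` (`a ≠ q²b`, `b ≠ q²a`); the only
ratio-`q` pairs are the two cross pairs `(a, qa)`, `(b, qb)` (`q² = 1`, i.e. `q ≡ −1`, is allowed: triage
r1-2 sharpen (i)). [cite: Thorne2016, §5.4.4 (two distinct eigenvalues α_v, β_v with α_v/β_v = q_v)] -/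
def Gen (q a b : k) : Prop :=
  a ≠ q * a ∧ a ≠ b ∧ a ≠ q * b ∧ q * a ≠ b ∧ q * a ≠ q * b ∧ b ≠ q * b ∧ a ≠ q ^ 2 * b ∧ b ≠ q ^ 2 * a

/-- CROSS-REGULAR residual Frobenius at `v` in the fixed cross position: `σ̄(Frob_v)` has eigenvalues
`{a, q̄_v b}`, `σ̄'(Frob_v)` has `{q̄_v a, b}`, generic (`Gen`). [cite: Thorne2016, Lemma 5.18 (regularity of ρ̄(Frob_v) is what lets the Steinberg-type condition see the invisible summand)] -/
def CrossRes (σ σ' : Literature.NumberTheory.GaloisRepresentations.FramedGaloisRep ℚ k 2) (v : IsDedekindDomain.HeightOneSpectrum (NumberField.RingOfIntegers ℚ)) (a b : k) : Prop :=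
  σ.HasFrobCharpolyAt v ((Polynomial.X - Polynomial.C a) * (Polynomial.X - Polynomial.C ((v.residueCard : k) * b))) ∧
  σ'.HasFrobCharpolyAt v ((Polynomial.X - Polynomial.C ((v.residueCard : k) * a)) * (Polynomial.X - Polynomial.C b)) ∧
  Gen (v.residueCard : k) a b

/-- ×-CONGRUENCE mod `p^N` of `r(Frob_v)`: its (integral) Frobenius polynomial is congruent coefficientwise
modulo `p^N` in `ℤ̄_p` to `(X−a)(X−q_v a)(X−b)(X−q_v b)` with `q_v² a b = 1` EXACTLY — `r mod p^N` is an
unramified point of the ×-type local deformation problem at `v`. [cite: Thorne2016, Prop. 5.20 ("ρ(Frob_v) agrees modulo p^N with ρ(c)")] -/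
def CrossCongr (N : ℕ) (v : IsDedekindDomain.HeightOneSpectrum (NumberField.RingOfIntegers ℚ)) (r : Literature.NumberTheory.GaloisRepresentations.FramedGaloisRep ℚ (PadicAlgCl p) 4) (a b : Valued.integer (PadicAlgCl p)) : Prop :=
  ∃ P : Polynomial (Valued.integer (PadicAlgCl p)), r.HasFrobCharpolyAt v (P.map (Valued.integer (PadicAlgCl p)).subtype) ∧
    (v.residueCard : Valued.integer (PadicAlgCl p)) ^ 2 * a * b = 1 ∧
    ∀ j : ℕ, ((p : Valued.integer (PadicAlgCl p))) ^ N ∣ (P - (Polynomial.X - Polynomial.C a) * (Polynomial.X - Polynomial.C ((v.residueCard : Valued.integer (PadicAlgCl p)) * a)) *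
      (Polynomial.X - Polynomial.C b) * (Polynomial.X - Polynomial.C ((v.residueCard : Valued.integer (PadicAlgCl p)) * b))).coeff j

/-- ×-TYPE at `v` of a characteristic-0 representation `r` (the local type of a Klingen-new, Roberts–Schmidt
IIIa-type point): inertia at `v` acts unipotently with square-zero monodromy, `(r(τ) − 1)² = 0`, and every
arithmetic Frobenius has characteristic polynomial EXACTLY `(X−a)(X−q_v a)(X−b)(X−q_v b)` with `q_v² a b = 1`
(two mutually paired Lagrangian Jordan blocks). [cite: Thorne2016, §5.4.4 (D_v^St(α_v))] -/
def CrossType (v : IsDedekindDomain.HeightOneSpectrum (NumberField.RingOfIntegers ℚ)) (r : Literature.NumberTheory.GaloisRepresentations.FramedGaloisRep ℚ (PadicAlgCl p) 4) : Prop :=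
  (∀ 𝔓 ∈ v.primesAbove, ∀ τ ∈ 𝔓.inertia (Field.absoluteGaloisGroup ℚ), ((r τ).val - 1) * ((r τ).val - 1) = 0) ∧
  ∃ a b : PadicAlgCl p, (v.residueCard : PadicAlgCl p) ^ 2 * a * b = 1 ∧
    r.HasFrobCharpolyAt v ((Polynomial.X - Polynomial.C a) * (Polynomial.X - Polynomial.C ((v.residueCard : PadicAlgCl p) * a)) * (Polynomial.X - Polynomial.C b) *
      (Polynomial.X - Polynomial.C ((v.residueCard : PadicAlgCl p) * b)))

/-- MEMBER of a Hecke family of level `𝔫` and infinity type `T`: a cuspidal L-algebraic `π` on `GL₄(𝔸_ℚ)`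
with a non-zero `K(𝔫)`-fixed form (principal congruence level, `principalCongruenceLevel`) and infinity type
`T`, together with a Galois representation `r`, irreducible, of the crux's shape `Sh` (same residual pair
`σ̄ ⊕ σ̄'`, ordinary `(0,0,1,1)`), matching `π` at almost all places. [cite: BorelJacquet1979, 4.6 (automorphic representations, level)] -/
def Member (σ σ' : Literature.NumberTheory.GaloisRepresentations.FramedGaloisRep ℚ k 2) (red : Valued.integer (PadicAlgCl p) →+* k)
    {hcpt : Literature.NumberTheory.Automorphic.isCompact_glFiniteIntegralLevel 4 ℚ} (ι : PadicAlgCl p ≃+* ℂ)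
    (𝔫 : Ideal (NumberField.RingOfIntegers ℚ)) (T : Literature.NumberTheory.Automorphic.InfinityType ℚ 4) (π : Literature.NumberTheory.Automorphic.CuspidalAutomorphicRepData 4 ℚ hcpt) (r : Literature.NumberTheory.GaloisRepresentations.FramedGaloisRep ℚ (PadicAlgCl p) 4) : Prop :=
  π.1.IsLAlgebraic ∧ π.1.HasInfinityType T ∧
  (∃ φ ∈ π.1.W, φ ∉ π.1.W' ∧ ∀ u ∈ Literature.NumberTheory.Automorphic.principalCongruenceLevel 4 ℚ 𝔫,
    Literature.NumberTheory.Automorphic.rightTranslation (Literature.NumberTheory.Automorphic.AdelicGroupData.gl 4 ℚ) u φ = φ) ∧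
  r.toGaloisRep.IsIrreducible ∧ Sh σ σ' red r ∧
  (∀ᶠ v : IsDedekindDomain.HeightOneSpectrum (NumberField.RingOfIntegers ℚ) in Filter.cofinite, ∃ a : Multiset ℂ, π.1.HasSatakeParamAt v a ∧ r.IsUnramifiedAt v ∧
    r.HasFrobCharpolyAt v (Literature.NumberTheory.Automorphic.arithFrobPolyOfSatake ι v.residueCard 1 a))

/-- HECKE-SPAN CONGRUENCE mod `p^N` ("`ϱ mod p^N` is an `𝒪/p^N`-point of the anaemic Hecke algebra of the
family `ρf`"): away from a finite set `S`, the `ρf i` and `ϱ` are unramified with integral Frobenius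
polynomials `Pf i v`, `Pr v ∈ ℤ̄_p[X]`, and EVERY `ℤ̄_p`-polynomial relation among the coefficients
`(Pf i v)_j` (in the variables `(v, j)`, `v ∉ S`) that holds for all `i` holds for the `(Pr v)_j` modulo `p^N`.
Equivalently: `T := ℤ̄_p[(coeff tuples)] ⊆ ∏_i ℤ̄_p` admits a ring map `T → ℤ̄_p/p^N` sending each generator to
the corresponding coefficient of `ϱ`. [cite: Thorne2016, Cor. 4.15 (f(T_v) = tr ρ(Frob_v) mod λ^N)] -/
def HSC (N : ℕ) (r : ℕ) (ρf : Fin r → Literature.NumberTheory.GaloisRepresentations.FramedGaloisRep ℚ (PadicAlgCl p) 4) (ϱ : Literature.NumberTheory.GaloisRepresentations.FramedGaloisRep ℚ (PadicAlgCl p) 4) : Prop :=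
  ∃ S : Set (IsDedekindDomain.HeightOneSpectrum (NumberField.RingOfIntegers ℚ)), S.Finite ∧ ∃ (Pf : Fin r → IsDedekindDomain.HeightOneSpectrum (NumberField.RingOfIntegers ℚ) → Polynomial (Valued.integer (PadicAlgCl p))) (Pr : IsDedekindDomain.HeightOneSpectrum (NumberField.RingOfIntegers ℚ) → Polynomial (Valued.integer (PadicAlgCl p))),
    (∀ i, ∀ v ∉ S, (ρf i).IsUnramifiedAt v ∧ (ρf i).HasFrobCharpolyAt v ((Pf i v).map (Valued.integer (PadicAlgCl p)).subtype)) ∧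
    (∀ v ∉ S, ϱ.IsUnramifiedAt v ∧ ϱ.HasFrobCharpolyAt v ((Pr v).map (Valued.integer (PadicAlgCl p)).subtype)) ∧
    ∀ F : MvPolynomial ((IsDedekindDomain.HeightOneSpectrum (NumberField.RingOfIntegers ℚ)) × ℕ) (Valued.integer (PadicAlgCl p)), (∀ m ∈ F.support, ∀ x ∈ m.support, x.1 ∉ S) →
      (∀ i, MvPolynomial.eval (fun x => (Pf i x.1).coeff x.2) F = 0) →
        ((p : Valued.integer (PadicAlgCl p))) ^ N ∣ MvPolynomial.eval (fun x => (Pr x.1).coeff x.2) F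

/-- EXACT CROSS-REGULAR ELEMENT of `im ρ` (the line's coverage hypothesis): some `γ ∈ Γ_ℚ` with
`charpoly ρ(γ) = (X−a)(X−ea)(X−b)(X−eb)`, `e = ε_p(γ)`, `e²ab = 1` in `ℤ̄_p`, in cross position residually
(`σ̄(γ) ∼ {ā, ē b̄}`, `σ̄'(γ) ∼ {ē ā, b̄}`) and residually generic. [cite: Thorne2016, Prop. 5.20 (σ_× replaces complex conjugation c)] -/
def ExactCross (σ σ' : Literature.NumberTheory.GaloisRepresentations.FramedGaloisRep ℚ k 2) (red : Valued.integer (PadicAlgCl p) →+* k) (ρ : Literature.NumberTheory.GaloisRepresentations.FramedGaloisRep ℚ (PadicAlgCl p) 4) : Prop :=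
  ∃ (γ : Field.absoluteGaloisGroup ℚ) (a b e : Valued.integer (PadicAlgCl p)),
    (e : PadicAlgCl p) = algebraMap ℚ_[p] (PadicAlgCl p)
      (((Literature.NumberTheory.GaloisRepresentations.GaloisRep.cyclotomicCharacter ℚ p γ : ℤ_[p]ˣ) : ℤ_[p]) : ℚ_[p]) ∧
    e ^ 2 * a * b = 1 ∧
    (ρ γ).val.charpoly = (Polynomial.X - Polynomial.C (a : PadicAlgCl p)) * (Polynomial.X - Polynomial.C ((e : PadicAlgCl p) * (a : PadicAlgCl p))) *
      (Polynomial.X - Polynomial.C (b : PadicAlgCl p)) * (Polynomial.X - Polynomial.C ((e : PadicAlgCl p) * (b : PadicAlgCl p))) ∧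
    (σ γ).val.charpoly = (Polynomial.X - Polynomial.C (red a)) * (Polynomial.X - Polynomial.C (red e * red b)) ∧
    (σ' γ).val.charpoly = (Polynomial.X - Polynomial.C (red e * red a)) * (Polynomial.X - Polynomial.C (red b)) ∧
    Gen (red e) (red a) (red b)

/-- ADMISSIBLE AUXILIARY PLACE of depth `N` for `ρ` relative to the level `𝔫`: `v ∤ p𝔫`; `ρ`, `σ̄`, `σ̄'`
unramified at `v`; `ρ(Frob_v)` ×-congruent mod `p^N` (`CrossCongr`) with residually cross-regular generic
reduction in the fixed cross position (`CrossRes`). [cite: Thorne2016, Prop. 5.20 and Lemma 5.23] -/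
def QGood (σ σ' : Literature.NumberTheory.GaloisRepresentations.FramedGaloisRep ℚ k 2) (red : Valued.integer (PadicAlgCl p) →+* k) (𝔫 : Ideal (NumberField.RingOfIntegers ℚ))
    (ρ : Literature.NumberTheory.GaloisRepresentations.FramedGaloisRep ℚ (PadicAlgCl p) 4) (N : ℕ) (v : IsDedekindDomain.HeightOneSpectrum (NumberField.RingOfIntegers ℚ)) : Prop :=
  ¬ (v.asIdeal ∣ 𝔫) ∧ ((p : ℕ) : NumberField.RingOfIntegers ℚ) ∉ v.asIdeal ∧ ρ.IsUnramifiedAt v ∧ σ.IsUnramifiedAt v ∧ σ'.IsUnramifiedAt v ∧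
    ∃ a b : Valued.integer (PadicAlgCl p), CrossCongr N v ρ a b ∧ CrossRes σ σ' v (red a) (red b)

/-- RESIDUALLY ADMISSIBLE PLACE for the seed relative to `𝔫₀` and `ρ₀`: `v ∤ p𝔫₀`; `ρ₀`, `σ̄`, `σ̄'` unramified
at `v`; `σ̄ ⊕ σ̄'` cross-regular generic at `v` (`CrossRes`) — the residual level-raising position.
[cite: Sorensen2006, Thm. A (level-raising congruence for GSp₄)] -/
def QGoodRes (σ σ' : Literature.NumberTheory.GaloisRepresentations.FramedGaloisRep ℚ k 2) (𝔫₀ : Ideal (NumberField.RingOfIntegers ℚ)) (ρ₀ : Literature.NumberTheory.GaloisRepresentations.FramedGaloisRep ℚ (PadicAlgCl p) 4) (v : IsDedekindDomain.HeightOneSpectrum (NumberField.RingOfIntegers ℚ)) : Prop :=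
  ¬ (v.asIdeal ∣ 𝔫₀) ∧ ((p : ℕ) : NumberField.RingOfIntegers ℚ) ∉ v.asIdeal ∧ ρ₀.IsUnramifiedAt v ∧ σ.IsUnramifiedAt v ∧ σ'.IsUnramifiedAt v ∧
    ∃ a b : k, CrossRes σ σ' v a b

/-- ×-TYPE HECKE FAMILY of level `𝔫·∏_Q v²` and infinity type `T` at the auxiliary set `Q`, to which `ρ` is
Hecke-span congruent mod `p^N`: finitely many members (`Member`), each of ×-type at every `v ∈ Q`
(`CrossType`), and `HSC N`. [cite: Thorne2016, Thm. 4.14 (the datum (Q, f : T_Q → O/λ^N))] -/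
def CrossFamily (σ σ' : Literature.NumberTheory.GaloisRepresentations.FramedGaloisRep ℚ k 2) (red : Valued.integer (PadicAlgCl p) →+* k)
    (hcpt : Literature.NumberTheory.Automorphic.isCompact_glFiniteIntegralLevel 4 ℚ) (ι : PadicAlgCl p ≃+* ℂ)
    (𝔫 : Ideal (NumberField.RingOfIntegers ℚ)) (T : Literature.NumberTheory.Automorphic.InfinityType ℚ 4) (Q : Finset (IsDedekindDomain.HeightOneSpectrum (NumberField.RingOfIntegers ℚ))) (N : ℕ) (ρ : Literature.NumberTheory.GaloisRepresentations.FramedGaloisRep ℚ (PadicAlgCl p) 4) : Prop :=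
  ∃ (r : ℕ) (πf : Fin r → Literature.NumberTheory.Automorphic.CuspidalAutomorphicRepData 4 ℚ hcpt) (ρf : Fin r → Literature.NumberTheory.GaloisRepresentations.FramedGaloisRep ℚ (PadicAlgCl p) 4),
    (∀ i, Member σ σ' red ι (𝔫 * Q.prod (fun v => v.asIdeal ^ 2)) T (πf i) (ρf i) ∧ ∀ v ∈ Q, CrossType v (ρf i)) ∧
    HSC N r ρf ρ


end CR

/-- (T6a) **S1 (`stub_exactCrossElement`) FAILS on the `p = 3` Frobenius-twist sub-sector — the
algebraic core, certified.**  If `σ̄' = σ̄^(3)` (the phantom-RM pairs: `σ̄' = Frob ∘ σ̄`, so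
`charpoly σ̄'(γ) = Frob(charpoly σ̄(γ))` for every `γ`), then an exact cross-regular element would give
`e, a, b` in `k` of characteristic `3` with `e ∈ 𝔽₃` (`e = ε̄(γ)`, so `e³ = e`), `e²ab = 1`,
`Gen e a b`, and `(X − ea)(X − b) = Frob((X − a)(X − eb)) = (X − a³)(X − e³b³)` — which is
contradictory (below: `e = −1`, then `a⁴ = 1` or `b⁴ = 1` against genericity).  This is the planner's
flagged coverage gap (triage r1-1 `cross_regular.py`, exhaustive over `GL₂(𝔽₉)`) as a THEOREM for all
fields of characteristic `3`; the registered S1 is therefore false as soon as one phantom-RM pair at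
`p = 3` with an irreducible `Sh`-lift exists (in nature: yes; in the tree: no such object, so no formal
`¬ S1`).  For `p ≥ 5` the same computation has solutions (triage: `p = 5`, ratio classes `{2,3,4}`). -/
theorem CR.no_exactCross_frobTwist_char3 {k : Type} [Field k] [CharP k 3] {e a b : k}
    (he : e ^ 3 = e) (hab : e ^ 2 * a * b = 1) (hgen : CR.Gen e a b)
    (hcross : (Polynomial.X - Polynomial.C (e * a)) * (Polynomial.X - Polynomial.C b) =
      ((Polynomial.X - Polynomial.C a) * (Polynomial.X - Polynomial.C (e * b))).map (frobenius k 3)) :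
    False := by
  obtain ⟨h1, h2, h3, h4, -, -, -, -⟩ := hgen
  have ha : a ≠ 0 := by
    rintro rfl
    exact h1 (by ring)
  have he0 : e ≠ 0 := by
    rintro rfl
    simp at hab
  have he1 : e ≠ 1 := by
    rintro rfl
    exact h1 (by ring)
  -- `e³ = e`, `e ≠ 0, 1` ⇒ `e = -1`
  have he' : e = -1 := by
    have h0 : e * (e - 1) * (e + 1) = 0 := by linear_combination he
    rcases mul_eq_zero.mp h0 with h | h
    · rcases mul_eq_zero.mp h with h | h
      · exact absurd h he0
      · exact absurd (sub_eq_zero.mp h) he1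
    · linear_combination h
  subst he'
  have hab' : a * b = 1 := by linear_combination hab
  have hb : b ≠ 0 := by
    rintro rfl
    simp at hab'
  -- the Frobenius-twisted quadratic, explicitly
  simp only [Polynomial.map_mul, Polynomial.map_sub, Polynomial.map_X, Polynomial.map_C,
    frobenius_def] at hcross
  have hev1 := congrArg (Polynomial.eval (-1 * a)) hcross
  have hev2 := congrArg (Polynomial.eval b) hcross
  simp only [Polynomial.eval_mul, Polynomial.eval_sub, Polynomial.eval_X, Polynomial.eval_C,
    sub_self, zero_mul, mul_zero] at hev1 hev2
  have hA : a ^ 3 = -a ∨ a = b ^ 3 := by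
    rcases mul_eq_zero.mp hev1.symm with h | h
    · left; linear_combination -h
    · right; linear_combination -h
  have hB : b = a ^ 3 ∨ b ^ 3 = -b := by
    rcases mul_eq_zero.mp hev2.symm with h | h
    · left; linear_combination h
    · right; linear_combination h
  rcases hA with hA | hA <;> rcases hB with hB | hB
  · -- `a³ = -a`, `b = a³` ⇒ `b = -a`
    exact h4 (by linear_combination -hA - hB)
  · -- `a³ = -a` (so `a² = -1`), `b³ = -b`; with `ab = 1`: `b = -a`
    have ha2 : a ^ 2 = -1 := by
      apply mul_left_cancel₀ ha
      linear_combination hA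
    exact h4 (by
      apply mul_left_cancel₀ ha
      linear_combination -hab' - ha2)
  · -- `a = b³`, `b = a³` ⇒ `b⁴ = ab = 1` ⇒ `b² = ±1` ⇒ `a = b` or `a = -b`
    have hb4 : b ^ 4 = 1 := by linear_combination -b * hA + hab'
    have hsq : (b ^ 2 - 1) * (b ^ 2 + 1) = 0 := by linear_combination hb4
    rcases mul_eq_zero.mp hsq with h | h
    · exact h2 (by linear_combination hA + b * h)
    · exact h3 (by linear_combination hA + b * h)
  · -- `a = b³`, `b³ = -b` ⇒ `a = -b`
    exact h3 (by linear_combination hA + hB)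


/-- (T6b) The five registered stub STATEMENTS of line `cross-regular-annihilator-primes`, verbatim
over the `CR` copy of the currency (S1 … S5). -/
def CR.S1 : Prop :=
  ∀ (p : ℕ) [Fact p.Prime], p ≠ 2 → ∀ (k : Type) [Field k] [CharP k p] [IsAlgClosed k] [TopologicalSpace k] [DiscreteTopology k] (red : Valued.integer (PadicAlgCl p) →+* k) (σ σ' : Literature.NumberTheory.GaloisRepresentations.FramedGaloisRep ℚ k 2) (hcpt : Literature.NumberTheory.Automorphic.isCompact_glFiniteIntegralLevel 4 ℚ) (ι : PadicAlgCl p ≃+* ℂ) (ρ : Literature.NumberTheory.GaloisRepresentations.FramedGaloisRep ℚ (PadicAlgCl p) 4), σ.toGaloisRep.IsIrreducible → σ'.toGaloisRep.IsIrreducible → CR.DetCond p σ σ' → (¬ ∃ g : GL (Fin 2) k, ∀ x, g * σ x * g⁻¹ = σ' x) → ρ.toGaloisRep.IsIrreducible → CR.Sh σ σ' red ρ → CR.ExactCross σ σ' red ρ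

/-- S2, verbatim. -/
def CR.S2 : Prop :=
  ∀ (p : ℕ) [Fact p.Prime], p ≠ 2 → ∀ (k : Type) [Field k] [CharP k p] [IsAlgClosed k] [TopologicalSpace k] [DiscreteTopology k] (red : Valued.integer (PadicAlgCl p) →+* k) (σ σ' : Literature.NumberTheory.GaloisRepresentations.FramedGaloisRep ℚ k 2) (hcpt : Literature.NumberTheory.Automorphic.isCompact_glFiniteIntegralLevel 4 ℚ) (ι : PadicAlgCl p ≃+* ℂ) (ρ₀ ρ : Literature.NumberTheory.GaloisRepresentations.FramedGaloisRep ℚ (PadicAlgCl p) 4), CR.Sh σ σ' red ρ₀ → CR.Sh σ σ' red ρ → CR.ExactCross σ σ' red ρ → ∀ (𝔫 : Ideal (NumberField.RingOfIntegers ℚ)), 𝔫 ≠ 0 → ∀ (m N : ℕ), ∃ Q : Finset (IsDedekindDomain.HeightOneSpectrum (NumberField.RingOfIntegers ℚ)), m ≤ Q.card ∧ ∀ v ∈ Q, ρ₀.IsUnramifiedAt v ∧ CR.QGood σ σ' red 𝔫 ρ N v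

/-- S3, verbatim. -/
def CR.S3 : Prop :=
  ∀ (p : ℕ) [Fact p.Prime], p ≠ 2 → ∀ (k : Type) [Field k] [CharP k p] [IsAlgClosed k] [TopologicalSpace k] [DiscreteTopology k] (red : Valued.integer (PadicAlgCl p) →+* k) (σ σ' : Literature.NumberTheory.GaloisRepresentations.FramedGaloisRep ℚ k 2) (hcpt : Literature.NumberTheory.Automorphic.isCompact_glFiniteIntegralLevel 4 ℚ) (ι : PadicAlgCl p ≃+* ℂ) (ρ₀ : Literature.NumberTheory.GaloisRepresentations.FramedGaloisRep ℚ (PadicAlgCl p) 4), σ.toGaloisRep.IsIrreducible → σ'.toGaloisRep.IsIrreducible → CR.DetCond p σ σ' → (¬ ∃ g : GL (Fin 2) k, ∀ x, g * σ x * g⁻¹ = σ' x) → ρ₀.toGaloisRep.IsIrreducible → CR.Sh σ σ' red ρ₀ → CR.Aut hcpt ι ρ₀ → ∃ (𝔫₀ : Ideal (NumberField.RingOfIntegers ℚ)) (T₀ : Literature.NumberTheory.Automorphic.InfinityType ℚ 4), 𝔫₀ ≠ 0 ∧ ∀ Q : Finset (IsDedekindDomain.HeightOneSpectrum (NumberField.RingOfIntegers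 ℚ)), (∀ v ∈ Q, CR.QGoodRes σ σ' 𝔫₀ ρ₀ v) → ∃ (π₁ : Literature.NumberTheory.Automorphic.CuspidalAutomorphicRepData 4 ℚ hcpt) (ρ₁ : Literature.NumberTheory.GaloisRepresentations.FramedGaloisRep ℚ (PadicAlgCl p) 4), CR.Member σ σ' red ι (𝔫₀ * Q.prod (fun v => v.asIdeal ^ 2)) T₀ π₁ ρ₁ ∧ ∀ v ∈ Q, CR.CrossType v ρ₁

/-- S4 AS REGISTERED (`stub_crossTypePatching`), verbatim: NOTE the quantifier order
`∃ 𝔫₁ T₁, ∀ N Q, … → (∃ 𝔫₀ T₀ π₁ ρ₁, seed of level 𝔫₀·∏v² …) → CrossFamily at level 𝔫₁·∏v²` — the level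
`𝔫₁` of the ×-family is fixed BEFORE the seed's level `𝔫₀` is known, so S4 must absorb seeds of
ARBITRARY level prime to `Q`: a level-LOWERING from `𝔫₀` to `𝔫₁` (mod `p^N`, at a residually Yoshida
`𝔪`) is silently included — the same open automorphic input S5 already names. -/
def CR.S4 : Prop :=
  ∀ (p : ℕ) [Fact p.Prime], p ≠ 2 → ∀ (k : Type) [Field k] [CharP k p] [IsAlgClosed k] [TopologicalSpace k] [DiscreteTopology k] (red : Valued.integer (PadicAlgCl p) →+* k) (σ σ' : Literature.NumberTheory.GaloisRepresentations.FramedGaloisRep ℚ k 2) (hcpt : Literature.NumberTheory.Automorphic.isCompact_glFiniteIntegralLevel 4 ℚ) (ι : PadicAlgCl p ≃+* ℂ) (ρ : Literature.NumberTheory.GaloisRepresentations.FramedGaloisRep ℚ (PadicAlgCl p) 4), σ.toGaloisRep.IsIrreducible → σ'.toGaloisRep.IsIrreducible → CR.DetCond p σ σ' → (¬ ∃ g : GL (Fin 2) k, ∀ x, g * σ x * g⁻¹ = σ' x) → ρ.toGaloisRep.IsIrreducible → CR.Sh σ σ' red ρ → ∃ (𝔫₁ : Ideal (NumberField.RingOfIntegers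 ℚ)) (T₁ : Literature.NumberTheory.Automorphic.InfinityType ℚ 4), 𝔫₁ ≠ 0 ∧ ∀ (N : ℕ) (Q : Finset (IsDedekindDomain.HeightOneSpectrum (NumberField.RingOfIntegers ℚ))), (∀ v ∈ Q, CR.QGood σ σ' red 𝔫₁ ρ N v) → 2 ≤ Q.card → (∃ (𝔫₀ : Ideal (NumberField.RingOfIntegers ℚ)) (T₀ : Literature.NumberTheory.Automorphic.InfinityType ℚ 4) (π₁ : Literature.NumberTheory.Automorphic.CuspidalAutomorphicRepData 4 ℚ hcpt) (ρ₁ : Literature.NumberTheory.GaloisRepresentations.FramedGaloisRep ℚ (PadicAlgCl p) 4), 𝔫₀ ≠ 0 ∧ (∀ v ∈ Q, ¬ (v.asIdeal ∣ 𝔫₀)) ∧ CR.Member σ σ' red ι (𝔫₀ * Q.prod (fun v => v.asIdeal ^ 2)) T₀ π₁ ρ₁ ∧ ∀ v ∈ Q, CR.CrossType v ρ₁) → CR.CrossFamily σ σ' red hcpt ι 𝔫₁ T₁ Q N ρ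

/-- S5, verbatim. -/
def CR.S5 : Prop :=
  ∀ (p : ℕ) [Fact p.Prime], p ≠ 2 → ∀ (k : Type) [Field k] [CharP k p] [IsAlgClosed k] [TopologicalSpace k] [DiscreteTopology k] (red : Valued.integer (PadicAlgCl p) →+* k) (σ σ' : Literature.NumberTheory.GaloisRepresentations.FramedGaloisRep ℚ k 2) (hcpt : Literature.NumberTheory.Automorphic.isCompact_glFiniteIntegralLevel 4 ℚ) (ι : PadicAlgCl p ≃+* ℂ) (ρ : Literature.NumberTheory.GaloisRepresentations.FramedGaloisRep ℚ (PadicAlgCl p) 4), σ.toGaloisRep.IsIrreducible → σ'.toGaloisRep.IsIrreducible → CR.DetCond p σ σ' → (¬ ∃ g : GL (Fin 2) k, ∀ x, g * σ x * g⁻¹ = σ' x) → ρ.toGaloisRep.IsIrreducible → CR.Sh σ σ' red ρ → ∀ (𝔫₁ : Ideal (NumberField.RingOfIntegers ℚ)) (T₁ : Literature.NumberTheory.Automorphic.InfinityType ℚ 4), 𝔫₁ ≠ 0 → (∀ N : ℕ, ∃ Q : Finset (IsDedekindDomain.HeightOneSpectrum (NumberField.RingOfIntegers ℚ)), (∀ v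 ∈ Q, CR.QGood σ σ' red 𝔫₁ ρ N v) ∧ CR.CrossFamily σ σ' red hcpt ι 𝔫₁ T₁ Q N ρ) → CR.Aut hcpt ι ρ

/-- RESHAPED S4 (proposal): the seed's base level `𝔫₀` and infinity type `T₀` are INPUTS, fixed before
the ×-family level `𝔫₁` is chosen (so `𝔫₁` may be taken divisible by `𝔫₀`, and the family may live at
the seed's own level: no level-lowering inside S4).  Verbatim otherwise. -/
def CR.S4Seeded : Prop :=
  ∀ (p : ℕ) [Fact p.Prime], p ≠ 2 → ∀ (k : Type) [Field k] [CharP k p] [IsAlgClosed k] [TopologicalSpace k] [DiscreteTopology k] (red : Valued.integer (PadicAlgCl p) →+* k) (σ σ' : Literature.NumberTheory.GaloisRepresentations.FramedGaloisRep ℚ k 2) (hcpt : Literature.NumberTheory.Automorphic.isCompact_glFiniteIntegralLevel 4 ℚ) (ι : PadicAlgCl p ≃+* ℂ) (ρ : Literature.NumberTheory.GaloisRepresentations.FramedGaloisRep ℚ (PadicAlgCl p) 4), σ.toGaloisRep.IsIrreducible → σ'.toGaloisRep.IsIrreducible → CR.DetCond p σ σ' → (¬ ∃ g : GL (Fin 2)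 k, ∀ x, g * σ x * g⁻¹ = σ' x) → ρ.toGaloisRep.IsIrreducible → CR.Sh σ σ' red ρ → ∀ (𝔫₀ : Ideal (NumberField.RingOfIntegers ℚ)) (T₀ : Literature.NumberTheory.Automorphic.InfinityType ℚ 4), 𝔫₀ ≠ 0 → ∃ (𝔫₁ : Ideal (NumberField.RingOfIntegers ℚ)) (T₁ : Literature.NumberTheory.Automorphic.InfinityType ℚ 4), 𝔫₁ ≠ 0 ∧ ∀ (N : ℕ) (Q : Finset (IsDedekindDomain.HeightOneSpectrum (NumberField.RingOfIntegers ℚ))), (∀ v ∈ Q, CR.QGood σ σ' red 𝔫₁ ρ N v) → 2 ≤ Q.card → (∃ (π₁ : Literature.NumberTheory.Automorphic.CuspidalAutomorphicRepData 4 ℚ hcpt) (ρ₁ : Literature.NumberTheory.GaloisRepresentations.FramedGaloisRep ℚ (PadicAlgCl p) 4), (∀ v ∈ Q, ¬ (v.asIdeal ∣ 𝔫₀)) ∧ CR.Member σ σ' red ι (𝔫₀ * Q.prod (fun v => v.asIdeal ^ 2)) T₀ π₁ ρ₁ ∧ ∀ v ∈ Q, CR.CrossType v ρ₁) → CR.CrossFamily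 σ σ' red hcpt ι 𝔫₁ T₁ Q N ρ

/-- The registered S4 implies the reshaped one: the reshape only REMOVES an obligation. -/
theorem CR.s4Seeded_of_s4 (h : CR.S4) : CR.S4Seeded := by
  intro p _ hp k _ _ _ _ _ red σ σ' hcpt ι ρ hirr hirr' hdet hnc hirrρ hShρ 𝔫₀ T₀ h𝔫₀
  obtain ⟨𝔫₁, T₁, h𝔫₁, hpatch⟩ := h p hp k red σ σ' hcpt ι ρ hirr hirr' hdet hnc hirrρ hShρ
  refine ⟨𝔫₁, T₁, h𝔫₁, fun N Q hQ hcard hseed => hpatch N Q hQ hcard ?_⟩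
  obtain ⟨π₁, ρ₁, hQ₀, hmem, hx⟩ := hseed
  exact ⟨𝔫₀, T₀, π₁, ρ₁, h𝔫₀, hQ₀, hmem, hx⟩

/-- The crux from S1, S2, S3, the RESHAPED S4 and S5 — the lead's composition goes through unchanged
in order (S3 produces `𝔫₀, T₀` before S4 is invoked), so the quantifier swap is free for the line. -/
theorem CR.crux_of_stubs_seeded (h1 : CR.S1) (h2 : CR.S2) (h3 : CR.S3) (h4 : CR.S4Seeded)
    (h5 : CR.S5) : Summit.Langlands.Langlands.Theses.PhantomRMYoshida.ResiduallyYoshidaLifting := by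
  intro p _ hp k _ _ _ _ _ red σ σ' hcpt ι ρ₀ ρ εb Aut Sh hodd hodd' hirr hirr' hdet hnc hirr₀ hSh₀ hAut₀ hirrρ hShρ
  -- S1: an exact cross-regular element in `im ρ`
  have hX := h1 p hp k red σ σ' hcpt ι ρ hirr hirr' hdet hnc hirrρ hShρ
  -- S3: base level / infinity type of the seed and ×-type level raising of `ρ₀`
  obtain ⟨𝔫₀, T₀, h𝔫₀, hseed⟩ := h3 p hp k red σ σ' hcpt ι ρ₀ hirr hirr' hdet hnc hirr₀ hSh₀ hAut₀
  -- S4 (reshaped): level / infinity type of the ×-families GIVEN the seed level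
  obtain ⟨𝔫₁, T₁, h𝔫₁, hpatch⟩ := h4 p hp k red σ σ' hcpt ι ρ hirr hirr' hdet hnc hirrρ hShρ 𝔫₀ T₀ h𝔫₀
  -- S5: successive approximation at level `𝔫₁`
  refine h5 p hp k red σ σ' hcpt ι ρ hirr hirr' hdet hnc hirrρ hShρ 𝔫₁ T₁ h𝔫₁ ?_
  intro N
  -- S2: auxiliary primes of depth `N`, prime to `𝔫₀ 𝔫₁`, at least two of them
  obtain ⟨Q, hcard, hQ⟩ := h2 p hp k red σ σ' hcpt ι ρ₀ ρ hSh₀ hShρ hX (𝔫₀ * 𝔫₁)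
    (mul_ne_zero h𝔫₀ h𝔫₁) 2 N
  refine ⟨Q, fun v hv => ?_, ?_⟩
  · obtain ⟨hρ₀v, hdvd, hvp, hρv, hσv, hσ'v, a, b, hcongr, hres⟩ := hQ v hv
    exact ⟨fun h1 => hdvd (dvd_mul_of_dvd_right h1 𝔫₀), hvp, hρv, hσv, hσ'v, a, b, hcongr, hres⟩
  · obtain ⟨π₁, ρ₁, hmem, hx₁⟩ := hseed Q (fun v hv => by
      obtain ⟨hρ₀v, hdvd, hvp, hρv, hσv, hσ'v, a, b, hcongr, hres⟩ := hQ v hv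
      exact ⟨fun h0 => hdvd (dvd_mul_of_dvd_left h0 𝔫₁), hvp, hρ₀v, hσv, hσ'v, red a, red b, hres⟩)
    exact hpatch N Q (fun v hv => by
      obtain ⟨hρ₀v, hdvd, hvp, hρv, hσv, hσ'v, a, b, hcongr, hres⟩ := hQ v hv
      exact ⟨fun h1 => hdvd (dvd_mul_of_dvd_right h1 𝔫₀), hvp, hρv, hσv, hσ'v, a, b, hcongr, hres⟩) hcard
      ⟨π₁, ρ₁, fun v hv => fun h0 => (hQ v hv).2.1 (dvd_mul_of_dvd_left h0 𝔫₁), hmem, hx₁⟩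

/-- Sanity: the registered five stubs give the crux (the lead's composition, re-derived here). NOTE the
line is genuinely RELATIVE: `Aut ρ₀` is consumed (by S3, the level-raising seed), unlike line 1. -/
theorem CR.crux_of_stubs (h1 : CR.S1) (h2 : CR.S2) (h3 : CR.S3) (h4 : CR.S4) (h5 : CR.S5) :
    Summit.Langlands.Langlands.Theses.PhantomRMYoshida.ResiduallyYoshidaLifting :=
  CR.crux_of_stubs_seeded h1 h2 h3 (CR.s4Seeded_of_s4 h4) h5


/-- `ℤ_p → ℤ̄_p = Valued.integer (PadicAlgCl p)` (the inclusion, integral since `‖u‖ ≤ 1`). -/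
def CR.ofPadicInt (p : ℕ) [Fact p.Prime] : ℤ_[p] →+* Valued.integer (PadicAlgCl p) :=
  RingHom.codRestrict ((algebraMap ℚ_[p] (PadicAlgCl p)).comp PadicInt.Coe.ringHom)
    (Valued.v (R := PadicAlgCl p)).integer fun u => by
      rw [Valuation.mem_integer_iff, PadicAlgCl.valuation_def, ← NNReal.coe_le_coe, coe_nnnorm]
      change ‖((u : ℚ_[p]) : PadicAlgCl p)‖ ≤ 1
      rw [PadicAlgCl.norm_extends]
      exact PadicInt.norm_le_one u

theorem CR.coe_ofPadicInt (p : ℕ) [Fact p.Prime] (u : ℤ_[p]) :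
    ((CR.ofPadicInt p u : Valued.integer (PadicAlgCl p)) : PadicAlgCl p) =
      algebraMap ℚ_[p] (PadicAlgCl p) (u : ℚ_[p]) := rfl

/-- Any ring map `ℤ_p → k` into characteristic `p` takes Frobenius-fixed values (`u = n + p·w`,
`n = zmodRepr u`): its image is the prime field. -/
theorem CR.frobenius_apply_padicInt {p : ℕ} [Fact p.Prime] {k : Type} [CommRing k] [CharP k p]
    (f : ℤ_[p] →+* k) (u : ℤ_[p]) : f u ^ p = f u := by
  have hmem : u - (u.zmodRepr : ℤ_[p]) ∈ Ideal.span {(p : ℤ_[p])} := by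
    rw [← PadicInt.maximalIdeal_eq_span_p]; exact PadicInt.sub_zmodRepr_mem u
  obtain ⟨w, hw⟩ := Ideal.mem_span_singleton'.mp hmem
  have hu : u = (u.zmodRepr : ℤ_[p]) + w * p := by linear_combination -hw
  have hfu : f u = (u.zmodRepr : k) := by
    have h := congrArg f hu
    rwa [map_add, map_natCast, map_mul, map_natCast, CharP.cast_eq_zero k p, mul_zero, add_zero] at h
  rw [hfu]
  have h := map_natCast (frobenius k p) u.zmodRepr
  rwa [frobenius_def] at h

/-- (T6a, interface form) **`ExactCross` is UNSATISFIABLE on the `p = 3` Frobenius-twist sub-sector.**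
If `charpoly σ̄'(γ) = Frob(charpoly σ̄(γ))` for every `γ` (e.g. `σ̄' = σ̄^(3)`: the phantom-RM pairs of
the route's own source), then `CR.ExactCross σ σ' red ρ` fails for EVERY `ρ` and every `red` in
characteristic `3` — so the registered S1 (`stub_exactCrossElement`, conclusion `ExactCross σ σ' red ρ`)
is false at every such admissible input (none is constructible in the tree, whence no formal `¬ S1`).
`red(ε(γ)) ∈ 𝔽₃` by `CR.frobenius_apply_padicInt`; the rest is `CR.no_exactCross_frobTwist_char3`. -/
theorem CR.not_exactCross_of_frobTwist_three {k : Type} [Field k] [CharP k 3] [TopologicalSpace k]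
    (red : Valued.integer (PadicAlgCl 3) →+* k)
    (σ σ' : FramedGaloisRep ℚ k 2) (ρ : FramedGaloisRep ℚ (PadicAlgCl 3) 4)
    (hFrob : ∀ γ, (σ' γ).val.charpoly = ((σ γ).val.charpoly).map (frobenius k 3)) :
    ¬ CR.ExactCross σ σ' red ρ := by
  rintro ⟨γ, a, b, e, he, hab, -, hσ, hσ', hgen⟩
  have he' : e = CR.ofPadicInt 3 ((GaloisRep.cyclotomicCharacter ℚ 3 γ : ℤ_[3]ˣ) : ℤ_[3]) :=
    Subtype.ext he
  have hred3 : red e ^ 3 = red e := by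
    rw [he']
    exact CR.frobenius_apply_padicInt (red.comp (CR.ofPadicInt 3)) _
  have hab' : red e ^ 2 * red a * red b = 1 := by
    simpa using congrArg red hab
  refine CR.no_exactCross_frobTwist_char3 hred3 hab' hgen ?_
  rw [← hσ', hFrob γ, hσ]

/-- Hence S1 restricted to `p = 3` and Frobenius-twisted pairs is equivalent to the VACUITY of its own
hypotheses there (it holds iff no irreducible `Sh`-representation with such a residual pair exists). -/
theorem CR.s1_frobTwist_three_iff_vacuous (h1 : CR.S1) {k : Type} [Field k] [CharP k 3] [IsAlgClosed k]
    [TopologicalSpace k] [DiscreteTopology k] (red : Valued.integer (PadicAlgCl 3) →+* k)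
    (σ σ' : FramedGaloisRep ℚ k 2) (hcpt : isCompact_glFiniteIntegralLevel 4 ℚ) (ι : PadicAlgCl 3 ≃+* ℂ)
    (ρ : FramedGaloisRep ℚ (PadicAlgCl 3) 4)
    (hFrob : ∀ γ, (σ' γ).val.charpoly = ((σ γ).val.charpoly).map (frobenius k 3))
    (hirr : σ.toGaloisRep.IsIrreducible) (hirr' : σ'.toGaloisRep.IsIrreducible)
    (hdet : CR.DetCond 3 σ σ') (hnc : ¬ ∃ g : GL (Fin 2) k, ∀ x, g * σ x * g⁻¹ = σ' x)
    (hρ : ρ.toGaloisRep.IsIrreducible) (hSh : CR.Sh σ σ' red ρ) : False :=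
  CR.not_exactCross_of_frobTwist_three red σ σ' ρ hFrob
    (h1 3 (by decide) k red σ σ' hcpt ι ρ hirr hirr' hdet hnc hρ hSh)


/-! ## §6 (cdisprove gen 4, 2026-08-16) — the line's exact excess over the crux; char-`p` crossing
primes of the Yoshida divisor are load-bearing -/

/-! ### T8 — STUB 4 carries no risk beyond the route TARGET; the excess of the line over the crux is
exactly `EveryShIsLimit` (all of it inside STUB 1) -/

/-- STUB 4 (as registered since sha edead940: WITH the residual hypotheses) follows from `Absolute` —
the limit hypothesis is simply dropped.  Hence (next theorem) it follows from the route target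
`PhantomRMSector`: `stub_ordinaryLimitClassicality` is (B)-true whenever the route is, and is NOT a
place where the line over-reaches. -/
theorem ordinaryLimitClassicality_of_absolute (h : Absolute) : OrdinaryLimitClassicality := by
  intro p _ hp k _ _ _ _ _ red σ σ' hcpt ι r hσ hσ' hdet hnc hr hSh _hlim
  exact h p hp k red σ σ' hcpt ι r hσ hσ' hdet hnc hr hSh

/-- Route target ⇒ STUB 4. -/
theorem ordinaryLimitClassicality_of_phantomRMSector
    (h : Summit.Langlands.Langlands.Theses.PhantomRMYoshida.PhantomRMSector) :
    OrdinaryLimitClassicality :=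
  ordinaryLimitClassicality_of_absolute (phantomRMSector_iff_absolute.1 h)

/-- THE LINE'S CONTENT, EXACTLY.  Modulo the commutative-algebra STUB 2 (dSRS Criterion I, true in
print; STUB 3 is proved, `stableComponentsModular_holds`), the two open stubs `1 ∧ 4` are EQUIVALENT to
`Absolute ∧ EveryShIsLimit`: the line proves the `ρ₀`-free crux AND, on top of it, that every
irreducible `Sh`-point of every admissible fibre is an ordinary classical limit (pro-automorphy in
regular weight of the whole irreducible `Sh`-locus — an `R^{ord} ↪ 𝕋`-type density statement that the
target does NOT imply).  All excess of the line over the crux sits in STUB 1 and IS `EveryShIsLimit`.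
(In nature `EveryShIsLimit` follows from (B) PLUS Hida's control theory for `GSp₄`: ordinary `p`-adic
forms of all weights form one `Λ₂`-cofree module containing the classical holomorphic weight-(2,2)
cusp forms, so the eigensystem of the `π` attached to `ρ` lies on a DOMINANT (3-dimensional,
`Λ₂`-torsion-free) component of `𝕋^{ord}`, on which regular classical GL₄-cuspidal points accumulate
at `x_ρ` — the reducible locus being closed and missing `x_ρ`; without (B) it is exactly the
pro-automorphy of every irreducible `Sh`-point, i.e. the open heart of the crux.) -/
theorem stubs14_iff_absolute_and_everyShIsLimit (h₂ : NumericalCriterionDVR) :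
    (YoshidaFamilyExists ∧ OrdinaryLimitClassicality) ↔ (Absolute ∧ EveryShIsLimit) :=
  ⟨fun h => ⟨absolute_of_stubs h.1 h₂ stableComponentsModular_holds h.2,
      everyShIsLimit_of_yoshidaFamilyExists h₂ stableComponentsModular_holds h.1⟩,
    fun h => ⟨yoshidaFamilyExists_of_everyShIsLimit h.2, ordinaryLimitClassicality_of_absolute h.1⟩⟩

/-- Hence, GIVEN the route target (e.g. in any world where (B) holds), the line's two open stubs are
jointly equivalent to `EveryShIsLimit` alone (mod STUB 2): that statement is the line's net claim. -/
theorem stubs14_iff_everyShIsLimit_of_target (h₂ : NumericalCriterionDVR)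
    (hT : Summit.Langlands.Langlands.Theses.PhantomRMYoshida.PhantomRMSector) :
    (YoshidaFamilyExists ∧ OrdinaryLimitClassicality) ↔ EveryShIsLimit := by
  rw [stubs14_iff_absolute_and_everyShIsLimit h₂]
  exact ⟨fun h => h.2, fun h => ⟨phantomRMSector_iff_absolute.1 hT, h⟩⟩

/-! ### T9 — the height-one criterion at primes of residue characteristic `p` is LOAD-BEARING in
STUB 3 / the datum (a fibre-product model) -/

/-- STUB 3 with its height-one hypothesis RESTRICTED to primes avoiding a regular non-unit `t ∈ R`
(intended `t = p · 1_R`: "Wiles–Lenstra data only at height-one primes of `Y` whose residue field has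
characteristic `0`", i.e. off the `μ`-part).  This is FALSE: `not_stableComponentsModularOffElt`. -/
def StableComponentsModularOffElt : Prop :=
  ∀ (R : Type) [CommRing R] [IsNoetherianRing R] [IsLocalRing R] (t : R) (I K : Ideal R),
    t ∈ nonZeroDivisors R → ¬ IsUnit t → K ≤ I →
    (∃ 𝔮 ∈ minimalPrimes R, I ≤ 𝔮) → IsConnectedInDimTwo R →
    (∀ 𝔮₁ ∈ minimalPrimes R, ∀ 𝔮₂ ∈ minimalPrimes R, ¬ I ≤ 𝔮₁ → ¬ I ≤ 𝔮₂ →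
      (2 : WithBot ℕ∞) ≤ ringKrullDim (R ⧸ (𝔮₁ ⊔ 𝔮₂)) → K ≤ 𝔮₁ → K ≤ 𝔮₂) →
    (∀ P : Ideal R, P.IsPrime → I ≤ P → ringKrullDim (R ⧸ P) = 2 → t ∉ P →
      ∀ 𝔮 ∈ minimalPrimes R, 𝔮 ≤ P → K ≤ 𝔮) →
    ∀ 𝔮 ∈ minimalPrimes R, K ≤ 𝔮

/-- The restricted statement is implied by nothing weaker than the registered one: STUB 3 itself
(all height-one primes) of course gives it when the off-`t` hypothesis happens to be the full one. -/
theorem stableComponentsModularOffElt_of_vacuous {R : Type} [CommRing R] [IsNoetherianRing R]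
    [IsLocalRing R] (I K : Ideal R) (hKI : K ≤ I) (hY : ∃ 𝔮 ∈ minimalPrimes R, I ≤ 𝔮)
    (hconn : IsConnectedInDimTwo R)
    (hgen : ∀ 𝔮₁ ∈ minimalPrimes R, ∀ 𝔮₂ ∈ minimalPrimes R, ¬ I ≤ 𝔮₁ → ¬ I ≤ 𝔮₂ →
      (2 : WithBot ℕ∞) ≤ ringKrullDim (R ⧸ (𝔮₁ ⊔ 𝔮₂)) → K ≤ 𝔮₁ → K ≤ 𝔮₂)
    (h1 : ∀ P : Ideal R, P.IsPrime → I ≤ P → ringKrullDim (R ⧸ P) = 2 →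
      ∀ 𝔮 ∈ minimalPrimes R, 𝔮 ≤ P → K ≤ 𝔮) :
    ∀ 𝔮 ∈ minimalPrimes R, K ≤ 𝔮 :=
  stableComponentsModular_holds R I K hKI hY hconn hgen h1

namespace CharPCrossing

/-! The model.  `A = F⟦X⟧⟦Y⟧⟦Z⟧` (a Noetherian local domain, `dim ≥ 3`), `ϖ = Z`,
`R = A ×_{A/ϖ} A ⊆ A × A` = two copies of `Spec A` ("Yoshida" `Y = V(𝔮₁)` and "stable" `C = V(𝔮₂)`,
both of full dimension) glued along `V(ϖ)`; they meet ONLY at the prime `P₀ = 𝔮₁ + 𝔮₂ = ker(R → A/ϖ)`,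
of coheight `≥ 2`, which contains `t = (ϖ, ϖ)`.  With `I = K = 𝔮₁` (the Yoshida component is the
modular one) every hypothesis of the restricted STUB 3 holds and its conclusion `K ≤ 𝔮₂` fails. -/

variable (F : Type) [Field F]

/-- `A₂ = F⟦X⟧⟦Y⟧` (`dim ≥ 2`). -/
abbrev A₂ : Type := PowerSeries (PowerSeries F)

/-- `A = A₂⟦Z⟧`; `ϖ = Z = PowerSeries.X`. -/
abbrev A : Type := PowerSeries (A₂ F)

/-- reduction modulo `ϖ`. -/
abbrev θ : A F →+* A₂ F := PowerSeries.constantCoeff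

/-- `R = A ×_{A/ϖ} A`. -/
def R : Subring (A F × A F) :=
  RingHom.eqLocus ((θ F).comp (RingHom.fst (A F) (A F))) ((θ F).comp (RingHom.snd (A F) (A F)))

variable {F}

theorem mem_R {x : A F × A F} : x ∈ R F ↔ θ F x.1 = θ F x.2 := Iff.rfl

theorem R.prop (x : R F) : θ F x.1.1 = θ F x.1.2 := x.2

variable (F)

/-- the diagonal `A → R`. -/
def diag : A F →+* R F :=
  ((RingHom.id (A F)).prod (RingHom.id (A F))).codRestrict (R F) fun _ => rfl

@[simp] theorem diag_val (a : A F) : (diag F a).1 = (a, a) := rfl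

/-- the two projections `R → A` (both surjective: `R/𝔮ᵢ ≅ A`). -/
def pr₁ : R F →+* A F := (RingHom.fst (A F) (A F)).comp (R F).subtype
/-- see `pr₁`. -/
def pr₂ : R F →+* A F := (RingHom.snd (A F) (A F)).comp (R F).subtype

@[simp] theorem pr₁_apply (x : R F) : pr₁ F x = x.1.1 := rfl
@[simp] theorem pr₂_apply (x : R F) : pr₂ F x = x.1.2 := rfl

theorem pr₁_surjective : Function.Surjective (pr₁ F) := fun a => ⟨diag F a, rfl⟩
theorem pr₂_surjective : Function.Surjective (pr₂ F) := fun a => ⟨diag F a, rfl⟩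

/-- `𝔮₁ = ker pr₁` ("Yoshida" component `V(𝔮₁) ≅ Spec A`). -/
def 𝔮₁ : Ideal (R F) := RingHom.ker (pr₁ F)
/-- `𝔮₂ = ker pr₂` ("stable" component). -/
def 𝔮₂ : Ideal (R F) := RingHom.ker (pr₂ F)

theorem mem_𝔮₁ {x : R F} : x ∈ 𝔮₁ F ↔ x.1.1 = 0 := RingHom.mem_ker
theorem mem_𝔮₂ {x : R F} : x ∈ 𝔮₂ F ↔ x.1.2 = 0 := RingHom.mem_ker

instance : (𝔮₁ F).IsPrime := RingHom.ker_isPrime _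
instance : (𝔮₂ F).IsPrime := RingHom.ker_isPrime _

/-- `e₁ = (ϖ, 0)`, `e₂ = (0, ϖ)`, `t = (ϖ, ϖ) = e₁ + e₂`. -/
def e₁ : R F := ⟨(PowerSeries.X, 0), by simp [mem_R]⟩
/-- see `e₁`. -/
def e₂ : R F := ⟨(0, PowerSeries.X), by simp [mem_R]⟩
/-- see `e₁`. -/
def t : R F := ⟨(PowerSeries.X, PowerSeries.X), rfl⟩

theorem t_eq : t F = e₁ F + e₂ F := Subtype.ext (by simp [e₁, e₂, t])

theorem e₁_mem : e₁ F ∈ 𝔮₂ F := by simp [mem_𝔮₂, e₁]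
theorem e₂_mem : e₂ F ∈ 𝔮₁ F := by simp [mem_𝔮₁, e₂]
theorem e₁_not_mem : e₁ F ∉ 𝔮₁ F := by simp [mem_𝔮₁, e₁, PowerSeries.X_ne_zero]
theorem e₂_not_mem : e₂ F ∉ 𝔮₂ F := by simp [mem_𝔮₂, e₂, PowerSeries.X_ne_zero]

theorem not_𝔮₁_le : ¬ 𝔮₁ F ≤ 𝔮₂ F := fun h => e₂_not_mem F (h (e₂_mem F))
theorem not_𝔮₂_le : ¬ 𝔮₂ F ≤ 𝔮₁ F := fun h => e₁_not_mem F (h (e₁_mem F))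

theorem inf_eq_bot : 𝔮₁ F ⊓ 𝔮₂ F = ⊥ := by
  refine le_bot_iff.mp fun x hx => ?_
  rw [Ideal.mem_bot]
  exact Subtype.ext (Prod.ext ((mem_𝔮₁ F).1 hx.1) ((mem_𝔮₂ F).1 hx.2))

theorem le_or_le {P : Ideal (R F)} (hP : P.IsPrime) : 𝔮₁ F ≤ P ∨ 𝔮₂ F ≤ P :=
  hP.mul_le.mp (le_trans Ideal.mul_le_inf ((inf_eq_bot F).le.trans bot_le))

/-- `R` is reduced with exactly two minimal primes. -/
theorem minimalPrimes_eq : minimalPrimes (R F) = {𝔮₁ F, 𝔮₂ F} := by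
  ext q
  constructor
  · intro hq
    have hqP : q.IsPrime := hq.1.1
    rcases le_or_le F hqP with h | h
    · exact Or.inl (le_antisymm (hq.2 ⟨inferInstance, bot_le⟩ h) h)
    · exact Or.inr (le_antisymm (hq.2 ⟨inferInstance, bot_le⟩ h) h)
  · rintro (rfl | rfl)
    · refine ⟨⟨inferInstance, bot_le⟩, fun y hy hle => ?_⟩
      rcases le_or_le F hy.1 with h | h
      · exact h
      · exact absurd (h.trans hle) (not_𝔮₂_le F)
    · refine ⟨⟨inferInstance, bot_le⟩, fun y hy hle => ?_⟩
      rcases le_or_le F hy.1 with h | h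
      · exact absurd (h.trans hle) (not_𝔮₁_le F)
      · exact h

theorem 𝔮₁_mem_minimalPrimes : 𝔮₁ F ∈ minimalPrimes (R F) := by
  rw [minimalPrimes_eq]; exact Or.inl rfl
theorem 𝔮₂_mem_minimalPrimes : 𝔮₂ F ∈ minimalPrimes (R F) := by
  rw [minimalPrimes_eq]; exact Or.inr rfl

/-- `ψ : R → A/ϖ = A₂`. -/
def ψ : R F →+* A₂ F := (θ F).comp (pr₁ F)

theorem ψ_surjective : Function.Surjective (ψ F) := fun a =>
  ⟨diag F (PowerSeries.C a), by simp [ψ]⟩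

theorem sup_le_ker : 𝔮₁ F ⊔ 𝔮₂ F ≤ RingHom.ker (ψ F) := by
  refine sup_le (fun x hx => ?_) (fun x hx => ?_)
  · rw [RingHom.mem_ker, ψ, RingHom.comp_apply, pr₁_apply, (mem_𝔮₁ F).1 hx, map_zero]
  · rw [RingHom.mem_ker, ψ, RingHom.comp_apply, pr₁_apply, R.prop x, (mem_𝔮₂ F).1 hx, map_zero]

theorem ker_le_sup : RingHom.ker (ψ F) ≤ 𝔮₁ F ⊔ 𝔮₂ F := by
  intro x hx
  have h1 : θ F x.1.1 = 0 := hx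
  have h2 : θ F x.1.2 = 0 := (R.prop x) ▸ h1
  let a : R F := ⟨(0, x.1.2), by rw [mem_R]; simp [h2]⟩
  let b : R F := ⟨(x.1.1, 0), by rw [mem_R]; simp [h1]⟩
  have hx' : x = a + b := Subtype.ext (Prod.ext (by simp [a, b]) (by simp [a, b]))
  rw [hx']
  exact Submodule.add_mem_sup ((mem_𝔮₁ F).2 rfl) ((mem_𝔮₂ F).2 rfl)

/-- The crossing prime `P₀ = 𝔮₁ + 𝔮₂ = ker(R → A/ϖ)`. -/
theorem sup_eq_ker : 𝔮₁ F ⊔ 𝔮₂ F = RingHom.ker (ψ F) :=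
  le_antisymm (sup_le_ker F) (ker_le_sup F)

/-- `P₀` is prime (`R/P₀ ≅ A/ϖ = F⟦X⟧⟦Y⟧`, a domain). -/
instance : (𝔮₁ F ⊔ 𝔮₂ F).IsPrime := by
  rw [sup_eq_ker]; exact RingHom.ker_isPrime _

theorem two_le_ringKrullDim_A₂ : (2 : WithBot ℕ∞) ≤ ringKrullDim (A₂ F) := by
  have h0 : ringKrullDim F = 0 := ringKrullDim_eq_zero_of_field F
  have h1 : ringKrullDim F + 1 ≤ ringKrullDim (PowerSeries F) :=
    ringKrullDim_succ_le_ringKrullDim_powerseries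
  have h2 : ringKrullDim (PowerSeries F) + 1 ≤ ringKrullDim (A₂ F) :=
    ringKrullDim_succ_le_ringKrullDim_powerseries
  rw [h0] at h1
  calc (2 : WithBot ℕ∞) = 0 + 1 + 1 := by norm_num
    _ ≤ ringKrullDim (PowerSeries F) + 1 := by gcongr
    _ ≤ ringKrullDim (A₂ F) := h2

/-- `dim R/P₀ ≥ 2`: the two components meet in dimension (at least) two — inside `V(t)`. -/
theorem two_le_ringKrullDim_quotient :
    (2 : WithBot ℕ∞) ≤ ringKrullDim (R F ⧸ (𝔮₁ F ⊔ 𝔮₂ F)) := by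
  have hs : Function.Surjective (Ideal.Quotient.lift (𝔮₁ F ⊔ 𝔮₂ F) (ψ F)
      fun x hx => sup_le_ker F hx) := by
    intro a
    obtain ⟨x, rfl⟩ := ψ_surjective F a
    exact ⟨Ideal.Quotient.mk _ x, by simp⟩
  exact (two_le_ringKrullDim_A₂ F).trans (ringKrullDim_le_of_surjective _ hs)

/-! `R` is local and Noetherian -/

theorem isUnit_of_isUnit_fst {x : R F} (ha : IsUnit x.1.1) : IsUnit x := by
  have hb : IsUnit x.1.2 := by
    rw [PowerSeries.isUnit_iff_constantCoeff] at ha ⊢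
    exact (R.prop x) ▸ ha
  obtain ⟨ua, hua⟩ := ha
  obtain ⟨ub, hub⟩ := hb
  have hθ : Units.map (θ F : A F →* A₂ F) ua = Units.map (θ F : A F →* A₂ F) ub := by
    refine Units.ext ?_
    rw [Units.coe_map, Units.coe_map, MonoidHom.coe_coe, hua, hub]
    exact R.prop x
  let y : R F := ⟨((↑ua⁻¹ : A F), (↑ub⁻¹ : A F)), by
    rw [mem_R]
    change ((Units.map (θ F : A F →* A₂ F) ua)⁻¹ : (A₂ F)ˣ).val =
      ((Units.map (θ F : A F →* A₂ F) ub)⁻¹ : (A₂ F)ˣ).val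
    rw [hθ]⟩
  refine IsUnit.of_mul_eq_one y (Subtype.ext (Prod.ext ?_ ?_))
  · change x.1.1 * ↑ua⁻¹ = 1
    rw [← hua, Units.mul_inv]
  · change x.1.2 * ↑ub⁻¹ = 1
    rw [← hub, Units.mul_inv]

instance : IsLocalRing (R F) :=
  IsLocalRing.of_isUnit_or_isUnit_one_sub_self fun x => by
    rcases IsLocalRing.isUnit_or_isUnit_one_sub_self x.1.1 with h | h
    · exact Or.inl (isUnit_of_isUnit_fst F h)
    · exact Or.inr (isUnit_of_isUnit_fst F h)

instance : Algebra (A F) (R F) := (diag F).toAlgebra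

theorem algebraMap_eq (a : A F) : algebraMap (A F) (R F) a = diag F a := rfl

/-- the inclusion `R ⊆ A × A`, `A`-linear for the diagonal action (so `R` is module-finite over the
Noetherian `A`, hence a Noetherian ring). -/
def incl : R F →ₗ[A F] (A F × A F) where
  toFun := Subtype.val
  map_add' _ _ := rfl
  map_smul' a x := by
    rw [Algebra.smul_def, algebraMap_eq, RingHom.id_apply]
    change (diag F a).1 * x.1 = a • x.1
    rw [diag_val]
    ext <;> simp

instance : Module.Finite (A F) (R F) :=
  Module.Finite.of_injective (incl F) Subtype.val_injective

instance : IsNoetherianRing (R F) := isNoetherian_of_tower (A F) inferInstance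

/-! `t = (ϖ, ϖ)` is a regular non-unit lying on the crossing prime -/

theorem t_mem_nonZeroDivisors : t F ∈ nonZeroDivisors (R F) := by
  refine mem_nonZeroDivisors_iff.2 ⟨fun y hy => ?_, fun y hy => ?_⟩ <;>
  · have h1 := congrArg (fun z : R F => z.1.1) hy
    have h2 := congrArg (fun z : R F => z.1.2) hy
    simp only [t, Subring.coe_mul, Prod.fst_mul, Prod.snd_mul, ZeroMemClass.coe_zero,
      Prod.fst_zero, Prod.snd_zero, mul_eq_zero, PowerSeries.X_ne_zero, or_false, false_or] at h1 h2
    exact Subtype.ext (Prod.ext h1 h2)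

theorem t_not_isUnit : ¬ IsUnit (t F) := by
  intro h
  have h1 : IsUnit (PowerSeries.X : A F) := h.map (pr₁ F)
  rw [PowerSeries.isUnit_iff_constantCoeff, PowerSeries.constantCoeff_X] at h1
  exact not_isUnit_zero h1

theorem t_mem_of_le {P : Ideal (R F)} (h₁ : 𝔮₁ F ≤ P) (h₂ : 𝔮₂ F ≤ P) : t F ∈ P := by
  rw [t_eq]
  exact P.add_mem (h₂ (e₁_mem F)) (h₁ (e₂_mem F))

theorem t_mem_sup : t F ∈ 𝔮₁ F ⊔ 𝔮₂ F := t_mem_of_le F le_sup_left le_sup_right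

/-- `Spec R` is connected in dimension two (the only partition is `{Y} ⊔ {C}`, crossing at `P₀`). -/
theorem isConnectedInDimTwo : IsConnectedInDimTwo (R F) := by
  intro 𝒜 h𝒜 ⟨q, hq⟩ ⟨q', hq'₁, hq'₂⟩
  have hqm : q ∈ minimalPrimes (R F) := h𝒜 hq
  have hne : q ≠ q' := fun h => hq'₂ (h ▸ hq)
  refine ⟨q, hq, q', ⟨hq'₁, hq'₂⟩, ?_⟩
  rw [minimalPrimes_eq] at hqm hq'₁
  rcases hqm with rfl | rfl <;> rcases hq'₁ with rfl | rfl
  · exact absurd rfl hne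
  · exact two_le_ringKrullDim_quotient F
  · rw [sup_comm]; exact two_le_ringKrullDim_quotient F
  · exact absurd rfl hne

/-- `ker(constantCoeff) = (X)` in any power series ring. -/
theorem ker_constantCoeff_eq_span (B : Type) [CommRing B] :
    RingHom.ker (PowerSeries.constantCoeff (R := B)) = Ideal.span {PowerSeries.X} := by
  ext f
  rw [RingHom.mem_ker, Ideal.mem_span_singleton, PowerSeries.X_dvd_iff]

/-- `dim B⟦X⟧ = dim B + 1` for a Noetherian local domain `B` (`X` is regular in the maximal ideal and
`B⟦X⟧/(X) ≅ B`; Mathlib `ringKrullDim_quotient_span_singleton_succ_eq_ringKrullDim_of_mem_nonZeroDivisors`). -/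
theorem ringKrullDim_powerSeries (B : Type) [CommRing B] [IsNoetherianRing B] [IsLocalRing B]
    [IsDomain B] : ringKrullDim (PowerSeries B) = ringKrullDim B + 1 := by
  have hX : (PowerSeries.X : PowerSeries B) ∈ IsLocalRing.maximalIdeal (PowerSeries B) := by
    rw [IsLocalRing.mem_maximalIdeal, mem_nonunits_iff, PowerSeries.isUnit_iff_constantCoeff,
      PowerSeries.constantCoeff_X]
    exact not_isUnit_zero
  have h := ringKrullDim_quotient_span_singleton_succ_eq_ringKrullDim_of_mem_nonZeroDivisors
    (R := PowerSeries B) MvPowerSeries.X_mem_nonzeroDivisors hX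
  have h' : ringKrullDim (PowerSeries B ⧸ Ideal.span {(PowerSeries.X : PowerSeries B)}) + 1 =
      ringKrullDim (PowerSeries B) := h
  have e : (PowerSeries B ⧸ Ideal.span {(PowerSeries.X : PowerSeries B)}) ≃+* B :=
    (Ideal.quotEquivOfEq (ker_constantCoeff_eq_span B).symm).trans
      (RingHom.quotientKerEquivOfSurjective PowerSeries.constantCoeff_surj)
  rw [← h', ringKrullDim_eq_of_ringEquiv e]

/-- `dim F⟦X⟧ = 1`. -/
theorem ringKrullDim_A₁ : ringKrullDim (PowerSeries F) = 1 := by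
  rw [ringKrullDim_powerSeries F, ringKrullDim_eq_zero_of_field]
  norm_num

/-- `dim F⟦X⟧⟦Y⟧ = 2`. -/
theorem ringKrullDim_A₂ : ringKrullDim (A₂ F) = 2 := by
  show ringKrullDim (PowerSeries (PowerSeries F)) = 2
  rw [ringKrullDim_powerSeries (PowerSeries F), ringKrullDim_A₁]
  norm_num

/-- `dim A = 3` (so both components `V(𝔮ᵢ) ≅ Spec A` have full dimension `3`, as `Y` and `C` do). -/
theorem ringKrullDim_A : ringKrullDim (A F) = 3 := by
  show ringKrullDim (PowerSeries (A₂ F)) = 3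
  rw [ringKrullDim_powerSeries (A₂ F), ringKrullDim_A₂]
  norm_num

/-- The crossing prime has coheight EXACTLY `2`: `P₀` is one of the primes the datum's
`heightOne_criterion` ranges over (prime, `⊇ I = 𝔮₁`, `dim R/P₀ = 2`), and it contains `t`. -/
theorem ringKrullDim_quotient_crossing : ringKrullDim (R F ⧸ (𝔮₁ F ⊔ 𝔮₂ F)) = 2 := by
  have e : (R F ⧸ (𝔮₁ F ⊔ 𝔮₂ F)) ≃+* A₂ F :=
    (Ideal.quotEquivOfEq (sup_eq_ker F)).trans (RingHom.quotientKerEquivOfSurjective (ψ_surjective F))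
  rw [ringKrullDim_eq_of_ringEquiv e, ringKrullDim_A₂]

end CharPCrossing

open CharPCrossing in
/-- **T9. The char-`p` crossing primes are load-bearing.**  STUB 3 with the height-one criterion
restricted to primes avoiding a regular non-unit `t` is FALSE: witness `R = A ×_{A/ϖ} A`
(`A = ℚ⟦X⟧⟦Y⟧⟦Z⟧`, `ϖ = Z`), `t = (ϖ, ϖ)`, `I = K = 𝔮₁`.  All hypotheses hold — `yoshida_minimal`
(`𝔮₁`), `connected₂` (`isConnectedInDimTwo`), `generic_propagation` (vacuous: one stable component),
the off-`t` height-one criterion (vacuous: the only coheight-2 prime above `I` containing a second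
minimal prime is `P₀ ∋ t`) — and the conclusion fails at `𝔮₂`.

MEANING FOR THE LINE.  In `R^{ps,ord}` a stable component `C ∋ x_ρ` may meet the Yoshida divisor `Y`
in dimension `2` only inside `V(p)` (a `μ`-type congruence: the family on `C` is reducible modulo a
height-one prime of `C` above `p`, never modulo a prime of residue characteristic `0`).  Then the
line's only access to `C` is the datum's `heightOne_criterion` at `P₀ ∋ p`, i.e. Wiles–Lenstra over
the characteristic-`p` DVR `O = ((R/I)_{P₀})^∧~` with `Φ_{P₀} ≤ Ψ_{P₀}` an inequality of
`μ`-INVARIANTS (of the Beilinson–Flach Selmer bound against the Yoshida congruence ideal).  Every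
printed Euler-system / main-conjecture divisibility the line cites (KLZ17, HsiehPalvannan2025, the
announced Hsieh–Liu `θ ∣ 𝒞`) is stated after inverting `p` or up to `μ`; so STUB 1 silently contains
a `μ = 0`-type input at the Yoshida divisor (or an input excluding `μ`-type crossings), and this
theorem shows the propagation architecture cannot be re-cut to avoid it. -/
theorem not_stableComponentsModularOffElt : ¬ StableComponentsModularOffElt := by
  intro h
  have key := h (R ℚ) (t ℚ) (𝔮₁ ℚ) (𝔮₁ ℚ) (t_mem_nonZeroDivisors ℚ) (t_not_isUnit ℚ) le_rfl
    ⟨𝔮₁ ℚ, 𝔮₁_mem_minimalPrimes ℚ, le_rfl⟩ (isConnectedInDimTwo ℚ)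
    (fun 𝔮a _ 𝔮b _ hIa _ _ hKa => absurd hKa hIa)
    (fun P _ hIP _ htP 𝔮 h𝔮 h𝔮P => by
      rw [minimalPrimes_eq] at h𝔮
      rcases h𝔮 with rfl | rfl
      · exact le_rfl
      · exact absurd (t_mem_of_le ℚ hIP h𝔮P) htP)
    (𝔮₂ ℚ) (𝔮₂_mem_minimalPrimes ℚ)
  exact not_𝔮₁_le ℚ key



/-! ### T10 — rigidity of `red` (gen-2 lemma re-derived for the tree copy) and constancy of the
residual type along `IsOrdinaryClassicalLimit` congruences -/

section RedRigidity

variable {p : ℕ} [Fact p.Prime] {k : Type} [Field k] [CharP k p]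

/-- RIGIDITY OF `red`: every ring map `red : 𝒪_{ℚ̄_p} → k` to a field of characteristic `p` kills
the maximal ideal `{‖x‖ < 1}` — `‖x‖^N ≤ ‖p‖` for some `N`, so `x^N ∈ p𝒪` and `red(x)^N = 0`.  Hence
`red` factors through `𝔽̄_p = 𝒪/𝔪` followed by an embedding `𝔽̄_p ↪ k`: the pair `(k, red)` of the
crux carries no information beyond "reduce mod `𝔪`" (what a prover needs to plug Serre / Khare–
Wintenberger-type residual inputs stated over `𝔽̄_p`). -/
theorem red_eq_zero_of_norm_lt_one (red : Valued.integer (PadicAlgCl p) →+* k)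
    (x : Valued.integer (PadicAlgCl p)) (hx : ‖(x : PadicAlgCl p)‖ < 1) : red x = 0 := by
  have hp0 : 0 < ‖((p : ℕ) : PadicAlgCl p)‖ :=
    norm_pos_iff.2 (Nat.cast_ne_zero.2 (Fact.out : p.Prime).ne_zero)
  obtain ⟨N, hN⟩ := exists_pow_lt_of_lt_one hp0 hx
  have hz : ‖(x : PadicAlgCl p) ^ N / (p : PadicAlgCl p)‖ ≤ 1 := by
    rw [norm_div, norm_pow]
    exact (div_le_one hp0).2 hN.le
  let z : Valued.integer (PadicAlgCl p) := ⟨_, PadicAlgCl.mem_integer_of_norm_le_one hz⟩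
  have hxN : x ^ N = (p : Valued.integer (PadicAlgCl p)) * z := by
    apply Subtype.ext
    change ((x ^ N : Valued.integer (PadicAlgCl p)) : PadicAlgCl p) =
      ((p : Valued.integer (PadicAlgCl p)) : PadicAlgCl p) * ((x : PadicAlgCl p) ^ N / (p : PadicAlgCl p))
    have hp0' : (p : PadicAlgCl p) ≠ 0 := norm_pos_iff.1 hp0
    push_cast
    field_simp
  have h0 : red x ^ N = 0 := by
    rw [← map_pow, hxN, map_mul, map_natCast, CharP.cast_eq_zero, zero_mul]
  exact eq_zero_of_pow_eq_zero h0

/-- Two integers of `ℚ̄_p` congruent modulo `𝔪` have the same image under `red`. -/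
theorem red_eq_of_norm_sub_lt_one (red : Valued.integer (PadicAlgCl p) →+* k)
    {x y : Valued.integer (PadicAlgCl p)} (h : ‖(x : PadicAlgCl p) - y‖ < 1) : red x = red y := by
  have := red_eq_zero_of_norm_lt_one red (x - y) (by simpa using h)
  rwa [map_sub, sub_eq_zero] at this

/-- Coefficientwise congruent integral polynomials have the same image under `red`. -/
theorem map_red_eq_of_coeff (red : Valued.integer (PadicAlgCl p) →+* k)
    {P P' : Polynomial (Valued.integer (PadicAlgCl p))}
    (h : ∀ i, ‖((P.coeff i : Valued.integer (PadicAlgCl p)) : PadicAlgCl p) - P'.coeff i‖ < 1) :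
    P.map red = P'.map red := by
  ext i
  simp only [Polynomial.coeff_map]
  exact red_eq_of_norm_sub_lt_one red (h i)

/-- `‖p‖^n < 1` in `ℚ̄_p` for `n ≥ 1`. -/
theorem norm_natCast_pow_lt_one {n : ℕ} (hn : 1 ≤ n) : ‖(p : PadicAlgCl p)‖ ^ n < 1 := by
  have hp : ‖(p : PadicAlgCl p)‖ < 1 := by
    rw [show (p : PadicAlgCl p) = algebraMap ℚ_[p] (PadicAlgCl p) (p : ℚ_[p]) from
      (map_natCast _ p).symm, norm_algebraMap', Padic.norm_p]
    exact inv_lt_one_of_one_lt₀ (by exact_mod_cast (Fact.out : p.Prime).one_lt)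
  exact pow_lt_one₀ (norm_nonneg _) hp (by omega)

/-- THE RESIDUAL TYPE IS CONSTANT ALONG THE LINE'S CONGRUENCES.  Under the coefficientwise congruence of
`IsOrdinaryClassicalLimit` with `n ≥ 1` (`‖P_i − P'_i‖ ≤ ‖p‖^n`), `P.map red = P'.map red`; so if the
limit `r` has the residual-Yoshida factorisation `P.map red = P₁ * P₂` at `v`, so does every approximant
`r'` (same `σ̄, σ̄'`, same `red`): the approximating classical points never leave the residual fibre.
Information for STUBS 1/4 (the clause need not be restated for `r'`, and cannot be varied). -/
theorem map_red_eq_of_congruent (red : Valued.integer (PadicAlgCl p) →+* k)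
    {P P' : Polynomial (Valued.integer (PadicAlgCl p))} {n : ℕ} (hn : 1 ≤ n)
    (h : ∀ i, ‖((P.coeff i : Valued.integer (PadicAlgCl p)) : PadicAlgCl p) - P'.coeff i‖ ≤
      ‖(p : PadicAlgCl p)‖ ^ n) :
    P.map red = P'.map red :=
  map_red_eq_of_coeff red fun i => (h i).trans_lt (norm_natCast_pow_lt_one hn)

/-- … in the form used by `Sh`'s third conjunct. -/
theorem residualFactorisation_of_congruent (red : Valued.integer (PadicAlgCl p) →+* k)
    {P P' : Polynomial (Valued.integer (PadicAlgCl p))} {P₁ P₂ : Polynomial k} {n : ℕ} (hn : 1 ≤ n)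
    (h : ∀ i, ‖((P.coeff i : Valued.integer (PadicAlgCl p)) : PadicAlgCl p) - P'.coeff i‖ ≤
      ‖(p : PadicAlgCl p)‖ ^ n) (hP : P.map red = P₁ * P₂) :
    P'.map red = P₁ * P₂ := by
  rw [← map_red_eq_of_congruent red hn h, hP]

end RedRigidity


/-! ### T11 — kernel-checked algebraic core of regime (c): the `p = 3`, `D₄` admissible residual
datum `L = ℚ(√(2+√6), √−2)`, `σ̄` = signed permutations of `{θ, θ'}` -/

namespace D4Datum

set_option maxRecDepth 8192 in
/-- ABSOLUTE IRREDUCIBILITY mod 3 of the `D₄` datum, certified on two of its elements: complex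
conjugation `s = diag(1, −1)` and a swap have no common eigenvector over `𝔽₃`; since `s` has the two
distinct RATIONAL eigenvalues `±1`, its only eigenlines over `𝔽̄₃` are the two coordinate axes, which the
swap exchanges — so no common eigenline over `𝔽̄₃` either. -/
theorem no_common_eigenvector :
    ∀ v : Fin 2 → ZMod 3, v ≠ 0 →
      ¬ ((∃ a : ZMod 3, !![1, 0; 0, -1].mulVec v = a • v) ∧
         (∃ b : ZMod 3, !![0, 1; 1, 0].mulVec v = b • v)) := by
  decide

/-- The rotation `r` (a signed swap of determinant `1`) has order 4 and `r² = −1`: the determinant-one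
signed permutations are `{±1, ±r} = ⟨r⟩`, a cyclic group — the image of `G_{ℚ(ζ₃)} = G_{ℚ(√−3)}` under
`σ̄` is ABELIAN (Taylor–Wiles adequacy fails on this fibre). -/
theorem rotation_facts :
    (!![0, 1; -1, 0] : Matrix (Fin 2) (Fin 2) (ZMod 3)) ^ 2 = -1 ∧
    (!![0, 1; -1, 0] : Matrix (Fin 2) (Fin 2) (ZMod 3)) ^ 4 = 1 ∧
    (!![0, 1; -1, 0] : Matrix (Fin 2) (Fin 2) (ZMod 3)).det = 1 ∧
    (!![1, 0; 0, -1] : Matrix (Fin 2) (Fin 2) (ZMod 3)).det = -1 := by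
  refine ⟨?_, ?_, ?_, ?_⟩
  · ext i j; fin_cases i <;> fin_cases j <;> simp [pow_two, Matrix.mul_apply, Fin.sum_univ_two]
  · ext i j; fin_cases i <;> fin_cases j <;>
      simp [pow_succ, Matrix.mul_apply, Fin.sum_univ_two]
  · simp [Matrix.det_fin_two]
  · simp [Matrix.det_fin_two]

/-- `√−3 ∈ L = ℚ(θ, θ')`: with `θ⁴ = 4θ² + 2` and `w² = −2` (`w = θθ'`), `x = (θ² − 2)·w` has `x² = −12`,
so `(x/2)² = −3`. -/
theorem sq_eq_neg_twelve {K : Type*} [CommRing K] (θ w : K) (hθ : θ ^ 4 = 4 * θ ^ 2 + 2)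
    (hw : w ^ 2 = -2) : ((θ ^ 2 - 2) * w) ^ 2 = -12 := by
  linear_combination (θ ^ 2 - 2) ^ 2 * hw - 2 * hθ

/-- Vieta for `x⁴ − 4x² − 2 = (x² − θ²)(x² − θ'²)`: `θ'² = 4 − θ²`, so a swap `θ ↦ ±θ'` sends
`θ² − 2 ↦ −(θ² − 2)`; with `w ↦ s₁s₂·w` the element `x = (θ² − 2)w` picks up the factor `−s₁s₂`, which is
the determinant of the signed swap — `g(√−3) = det σ̄(g) · √−3`, i.e. `det σ̄ = χ_{ℚ(√−3)} = ε̄₃`. -/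
theorem swap_factor {K : Type*} [CommRing K] (θ θ' : K) (h : θ ^ 2 + θ' ^ 2 = 4) :
    θ' ^ 2 - 2 = -(θ ^ 2 - 2) := by
  linear_combination h

/-- the signed swap `θ ↦ s₁θ'`, `θ' ↦ s₂θ` has matrix `!![0, s₂; s₁, 0]` of determinant `−s₁s₂`. -/
theorem det_signed_swap {K : Type*} [CommRing K] (s₁ s₂ : K) :
    (!![0, s₂; s₁, 0] : Matrix (Fin 2) (Fin 2) K).det = -(s₁ * s₂) := by
  simp [Matrix.det_fin_two]; ring

end D4Datum


/-! ## §7 (cdisprove gen 5, 2026-08-16) — two structural lemmas hidden in `Sh`, and their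
consequences for the reducible (Yoshida) locus and for the admissible residual pairs

Both are kernel-checked abstract linear algebra; the translation to the crux (which needs a
`Γ_ℚ`-stable lattice of `ρ`, its reduction and Brauer–Nesbitt — not in the tree) is in the
docstrings.  T12 is stated at crux level for the CHARACTERISTIC-0 representation `ρ` itself. -/

section SymplecticPlane

open Module Submodule Matrix

variable {k V : Type*} [Field k] [AddCommGroup V] [Module k V]

/-! ### T12 — SYMPLECTIC PLANE DICHOTOMY: an invariant plane of a symplectic `Sh`-representation is
Lagrangian or splits off; on the crux's residual type "reducible = split" -/

/-- Two vectors pairing non-trivially under an alternating form are linearly independent. -/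
theorem linearIndependent_pair_of_isAlt {B : LinearMap.BilinForm k V} (hB : B.IsAlt) {x y : V}
    (h : B x y ≠ 0) : LinearIndependent k ![x, y] := by
  rw [LinearIndependent.pair_iff]
  intro s t hst
  have h1 : s • B x y + t • B y y = 0 := by
    simpa only [map_add, map_smul, LinearMap.add_apply, LinearMap.smul_apply, map_zero,
      LinearMap.zero_apply] using congrArg (fun v => B v y) hst
  have h2 : s • B x x + t • B x y = 0 := by
    simpa only [map_add, map_smul, map_zero] using congrArg (fun v => B x v) hst
  rw [hB y, smul_zero, add_zero, smul_eq_mul] at h1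
  rw [hB x, smul_zero, zero_add, smul_eq_mul] at h2
  exact ⟨(mul_eq_zero.1 h1).resolve_right h, (mul_eq_zero.1 h2).resolve_right h⟩

/-- **Plane dichotomy.**  A plane `W` in an alternating space is either totally ISOTROPIC
(`B|_W = 0`) or NON-DEGENERATE (`B|_W` has trivial radical): `B|_W` is alternating on a
2-dimensional space, hence determined by one value `B(x₀, y₀)`. -/
theorem isotropic_or_nondegenerate_of_finrank_two {B : LinearMap.BilinForm k V} (hB : B.IsAlt)
    (W : Submodule k V) [FiniteDimensional k W] (hW : finrank k W = 2) :
    (∀ x ∈ W, ∀ y ∈ W, B x y = 0) ∨ (∀ x ∈ W, (∀ y ∈ W, B x y = 0) → x = 0) := by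
  classical
  by_cases h : ∀ x ∈ W, ∀ y ∈ W, B x y = 0
  · exact Or.inl h
  refine Or.inr fun x hx hx0 => ?_
  push Not at h
  obtain ⟨x₀, hx₀, y₀, hy₀, hc⟩ := h
  have hli := linearIndependent_pair_of_isAlt hB hc
  have hrange : Set.range ![x₀, y₀] = {x₀, y₀} := by
    simp only [Matrix.range_cons, Matrix.range_empty, Set.union_empty, Set.singleton_union]
  have hspan : span k ({x₀, y₀} : Set V) = W := by
    apply eq_of_le_of_finrank_eq
    · rw [span_le]
      rintro z hz
      rcases hz with rfl | rfl
      · exact hx₀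
      · exact hy₀
    · rw [← hrange, finrank_span_eq_card hli, hW]
      simp
  have hxmem : x ∈ span k ({x₀, y₀} : Set V) := hspan ▸ hx
  obtain ⟨a, b, rfl⟩ := mem_span_pair.1 hxmem
  have e1 : a * B x₀ y₀ = 0 := by
    have := hx0 y₀ hy₀
    simpa only [map_add, map_smul, LinearMap.add_apply, LinearMap.smul_apply, smul_eq_mul, hB y₀,
      mul_zero, add_zero] using this
  have e2 : b * B y₀ x₀ = 0 := by
    have := hx0 x₀ hx₀
    simpa only [map_add, map_smul, LinearMap.add_apply, LinearMap.smul_apply, smul_eq_mul, hB x₀,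
      mul_zero, zero_add] using this
  have hc' : B y₀ x₀ ≠ 0 := by
    rw [← hB.neg_eq]
    exact neg_ne_zero.2 hc
  rw [(mul_eq_zero.1 e1).resolve_right hc, (mul_eq_zero.1 e2).resolve_right hc', zero_smul,
    zero_smul, add_zero]

/-- ISOTROPIC planes of a non-degenerate alternating 4-space are LAGRANGIAN: `W^⊥ = W`. -/
theorem orthogonal_eq_self_of_isotropic [FiniteDimensional k V] {B : LinearMap.BilinForm k V}
    (hBnd : B.Nondegenerate) (h4 : finrank k V = 4) {W : Submodule k V} (hW : finrank k W = 2)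
    (hiso : ∀ x ∈ W, ∀ y ∈ W, B x y = 0) : B.orthogonal W = W := by
  symm
  apply eq_of_le_of_finrank_eq
  · intro m hm
    rw [LinearMap.BilinForm.mem_orthogonal_iff]
    exact fun n hn => hiso n hn m hm
  · rw [LinearMap.BilinForm.finrank_orthogonal hBnd, h4, hW]

/-- NON-DEGENERATE planes split off: `V = W ⊕ W^⊥`. -/
theorem isCompl_orthogonal_of_nondegenerate_plane [FiniteDimensional k V]
    {B : LinearMap.BilinForm k V} (hB : B.IsAlt) {W : Submodule k V}
    (hnd : ∀ x ∈ W, (∀ y ∈ W, B x y = 0) → x = 0) : IsCompl W (B.orthogonal W) := by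
  apply LinearMap.BilinForm.isCompl_orthogonal_of_restrict_nondegenerate hB.isRefl
  constructor
  · rintro ⟨x, hx⟩ h
    exact Subtype.ext (hnd x hx fun y hy => by simpa using h ⟨y, hy⟩)
  · rintro ⟨y, hy⟩ h
    refine Subtype.ext (hnd y hy fun x hx => ?_)
    have hxy : B x y = 0 := by simpa using h ⟨x, hx⟩
    exact hB.eq_iff.1 hxy

/-- A SIMILITUDE of `B` stabilising `W` stabilises `W^⊥`. -/
theorem map_orthogonal_of_similitude {B : LinearMap.BilinForm k V} (T : V ≃ₗ[k] V) (ν : k)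
    (hT : ∀ x y, B (T x) (T y) = ν * B x y) {W : Submodule k V} [FiniteDimensional k W]
    (hW : ∀ w ∈ W, T w ∈ W) : ∀ z ∈ B.orthogonal W, T z ∈ B.orthogonal W := by
  have hmap : W.map (T : V →ₗ[k] V) = W := by
    apply eq_of_le_of_finrank_eq
    · rintro _ ⟨w, hw, rfl⟩
      exact hW w hw
    · exact LinearEquiv.finrank_map_eq T W
  intro z hz
  rw [LinearMap.BilinForm.mem_orthogonal_iff] at hz ⊢
  intro n hn
  rw [← hmap] at hn
  obtain ⟨n', hn', rfl⟩ := hn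
  rw [LinearEquiv.coe_coe, hT, hz n' hn', mul_zero]

variable {n : ℕ}

/-- The matrix form `B_J(x, y) = xᵀ J y` of the crux's symplectic clause: `Jᵀ = -J` in
characteristic `≠ 2` (e.g. `ℚ̄_p`, or `𝔽̄_p` with `p` odd) gives an ALTERNATING form. -/
theorem isAlt_toBilin'_of_transpose_eq_neg {K : Type*} [Field K] [NeZero (2 : K)]
    {J : Matrix (Fin n) (Fin n) K} (hJ : Jᵀ = -J) : (Matrix.toBilin' J).IsAlt := by
  intro x
  have h : x ⬝ᵥ J *ᵥ x = -(x ⬝ᵥ J *ᵥ x) := by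
    conv_lhs => rw [dotProduct_mulVec, dotProduct_comm, ← mulVec_transpose, hJ, neg_mulVec,
      dotProduct_neg]
  rw [Matrix.toBilin'_apply']
  have h2 : (2 : K) * (x ⬝ᵥ J *ᵥ x) = 0 := by linear_combination h
  exact (mul_eq_zero.1 h2).resolve_left (NeZero.ne 2)

/-- `gᵀ J g = ν J` makes `v ↦ g v` a similitude of `B_J` with multiplier `ν`. -/
theorem toBilin'_mulVec_mulVec {K : Type*} [Field K] {J g : Matrix (Fin n) (Fin n) K} {ν : K}
    (hg : gᵀ * J * g = ν • J) (x y : Fin n → K) :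
    Matrix.toBilin' J (g *ᵥ x) (g *ᵥ y) = ν * Matrix.toBilin' J x y := by
  simp only [Matrix.toBilin'_apply']
  rw [mulVec_mulVec, dotProduct_mulVec, ← vecMul_transpose, vecMul_vecMul, ← Matrix.mul_assoc, hg,
    vecMul_smul, smul_dotProduct, smul_eq_mul, dotProduct_mulVec]

/-- **T12. INVARIANT PLANES OF A SYMPLECTIC `Sh`-REPRESENTATION: LAGRANGIAN OR SPLIT.**  Let
`r : Γ_ℚ → GL₄(K)` (`K` a field with `2 ≠ 0`, e.g. `ℚ̄_p`; or `𝔽̄_p`, `p` odd, for the reduction of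
a UNIMODULAR stable lattice) be symplectic with multiplier `ν` in the crux's sense
(`IsSymplecticWithMultiplierFun`: `∃ J, Jᵀ = -J, det J ∈ Kˣ, r(g)ᵀ J r(g) = ν(g) J`), and let
`W ⊆ K⁴` be an `r`-invariant PLANE.  Then for `B = B_J`: EITHER `W` is Lagrangian (`W^⊥ = W`; then
`B_J` is a perfect `r`-equivariant pairing `W × K⁴/W → K(ν)`, so `K⁴/W ≅ W^∨ ⊗ ν` and
`det(r|_W) · det(r|_{K⁴/W}) = ν²`), OR `K⁴ = W ⊕ W^⊥` with `W^⊥` ALSO `r`-invariant: `r` SPLITS as an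
orthogonal sum of two symplectic planes, each with multiplier `ν` (so `det = ν` on each).

CONSEQUENCES FOR THE CRUX (residual pair `σ̄ ≇ σ̄'`, `det σ̄ = det σ̄' = ε̄⁻¹ = ν̄`):
(i) "REDUCIBLE = SPLIT": a reducible symplectic deformation `ρ_A` of the Yoshida type over any
`A` (take `K = Frac` of a quotient domain) with an invariant plane lifting `σ̄` cannot be Lagrangian
— that would give `σ̄' ≅ σ̄^∨ ⊗ ε̄⁻¹ ≅ σ̄ ⊗ (det σ̄)⁻¹ ε̄⁻¹ = σ̄` — so it is `σ ⊕ σ'`: the reducible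
locus `Y = V(I)` of every line is EXACTLY the image of the two `GL₂` ordinary problems with
matched determinant, with NO extension (`Ext¹(σ', σ)`) directions inside it; the off-diagonal
classes `H¹(ℚ, σ̄ ⊗ σ̄' ⊗ ε̄)` are transverse to `Y` (first-order deformations towards irreducible
points), which is why `I/I²`, not a reducible sub-family, carries the Selmer information (line 1),
and why `R/I ≅ (R_σ̄ ⊗̂ R_σ̄')^{det}` needs integral big `R^{ord} = T^{ord}` for BOTH constituents to
give the datum's `K ≤ I` (known under Taylor–Wiles adequacy of `σ̄|_{ℚ(ζ_p)}`; in regime (c) of §6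
only pointwise modularity à la Skinner–Wiles 2001 is available).
(ii) UNIMODULAR LATTICES REDUCE SPLIT: for a self-dual stable lattice `Λ` of an irreducible
`Sh`-`ρ`, `ρ̄_Λ` is symplectic non-degenerate over `𝔽̄_p`; any `Γ_ℚ`-stable plane (one exists, `ρ̄^ss`
having two 2-dimensional constituents) is Lagrangian or split, and Lagrangian is excluded as in
(i) — so `ρ̄_Λ ≅ σ̄ ⊕ σ̄'` SPLIT (line 2's `stub_residualYoshidaSplitting`; the non-split reductions
supplied by Ribet's lemma live on NON-unimodular lattices, where the reduced pairing degenerates).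
(iii) Hence the residual object every symplectic deformation argument starts from is the SPLIT
`σ̄ ⊕ σ̄'`: `End_{k[Γ]}(σ̄ ⊕ σ̄') = k × k` (Mazur's `GL₄`-condition fails —
`Literature.Barriers.Langlands.ResiduallyReducibleBarrier`, `not_centralizerIsScalars`), but its
intersection with `𝔤𝔰𝔭(J)` is the scalars (`diag(x,x,y,y) ∈ 𝔤𝔰𝔭(J₂ ⊕ J₂) ⇔ x = y`): the
`GSp₄`-valued problem is Schur (`H⁰(Γ, ad⁰_{𝔰𝔭}) = 0`) EXACTLY BECAUSE `σ̄ ≇ σ̄'` — for `σ̄' = σ̄`,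
`I₂ ⊗ A` with `A ∈ 𝔰𝔬₂` is a non-scalar trace-zero `𝔰𝔭`-equivariant endomorphism.  So the crux's
non-conjugacy hypothesis `hnc` is decoration for TRUTH ((B) covers `σ̄ ⊕ σ̄`) but load-bearing for
every ENGINE (representability / Schur-ness of the symplectic deformation problem). -/
theorem invariantPlane_lagrangian_or_split {K : Type} [Field K] [TopologicalSpace K]
    [IsTopologicalRing K] [NeZero (2 : K)] (r : FramedGaloisRep ℚ K 4)
    {ν : Field.absoluteGaloisGroup ℚ → K} (hr : r.IsSymplecticWithMultiplierFun ν)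
    (W : Submodule K (Fin 4 → K)) (hW : finrank K W = 2)
    (hinv : ∀ g, ∀ w ∈ W, r.toGaloisRep g w ∈ W) :
    ∃ J : Matrix (Fin 4) (Fin 4) K, Jᵀ = -J ∧ J.det ≠ 0 ∧
      (∀ g, (r g).valᵀ * J * (r g).val = ν g • J) ∧
      (((Matrix.toBilin' J).orthogonal W = W) ∨
        (IsCompl W ((Matrix.toBilin' J).orthogonal W) ∧
          ∀ g, ∀ z ∈ (Matrix.toBilin' J).orthogonal W,
            r.toGaloisRep g z ∈ (Matrix.toBilin' J).orthogonal W)) := by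
  obtain ⟨J, hJt, hJu, hJ⟩ := hr
  have hdet : J.det ≠ 0 := hJu.ne_zero
  refine ⟨J, hJt, hdet, hJ, ?_⟩
  have hAlt := isAlt_toBilin'_of_transpose_eq_neg hJt
  have hNd : (Matrix.toBilin' J).Nondegenerate :=
    LinearMap.BilinForm.nondegenerate_toBilin'_of_det_ne_zero' J hdet
  have h4 : finrank K (Fin 4 → K) = 4 := by simp
  rcases isotropic_or_nondegenerate_of_finrank_two hAlt W hW with hiso | hnd
  · exact Or.inl (orthogonal_eq_self_of_isotropic hNd h4 hW hiso)
  · refine Or.inr ⟨isCompl_orthogonal_of_nondegenerate_plane hAlt hnd, fun g => ?_⟩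
    let T : (Fin 4 → K) ≃ₗ[K] (Fin 4 → K) :=
      LinearMap.GeneralLinearGroup.toLinearEquiv (Matrix.GeneralLinearGroup.toLin (r g))
    have hTapp : ∀ v, T v = (r g).val *ᵥ v := fun v => by
      simp [T, Matrix.GeneralLinearGroup.coe_toLin]
    have hsim : ∀ x y, Matrix.toBilin' J (T x) (T y) = ν g * Matrix.toBilin' J x y := fun x y => by
      rw [hTapp, hTapp]; exact toBilin'_mulVec_mulVec (hJ g) x y
    have hTW : ∀ w ∈ W, T w ∈ W := fun w hw => by rw [hTapp]; exact hinv g w hw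
    intro z hz
    have := map_orthogonal_of_similitude T (ν g) hsim hTW z hz
    rwa [hTapp] at this

/-- T12 for the crux's `Sh ρ` verbatim (`ℚ̄_p` has characteristic `0`). -/
theorem sh_invariantPlane_lagrangian_or_split {p : ℕ} [Fact p.Prime] {k' : Type} [Field k']
    [TopologicalSpace k'] {red : Valued.integer (PadicAlgCl p) →+* k'} {σ σ' : FramedGaloisRep ℚ k' 2}
    {ρ : FramedGaloisRep ℚ (PadicAlgCl p) 4} (hSh : Sh p k' red σ σ' ρ)
    (W : Submodule (PadicAlgCl p) (Fin 4 → PadicAlgCl p)) (hW : finrank (PadicAlgCl p) W = 2)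
    (hinv : ∀ g, ∀ w ∈ W, ρ.toGaloisRep g w ∈ W) :
    ∃ J : Matrix (Fin 4) (Fin 4) (PadicAlgCl p), Jᵀ = -J ∧ J.det ≠ 0 ∧
      (∀ g, (ρ g).valᵀ * J * (ρ g).val =
        (algebraMap ℚ_[p] (PadicAlgCl p)
          ((((GaloisRep.cyclotomicCharacter ℚ p g)⁻¹ : ℤ_[p]ˣ) : ℤ_[p]) : ℚ_[p])) • J) ∧
      (((Matrix.toBilin' J).orthogonal W = W) ∨
        (IsCompl W ((Matrix.toBilin' J).orthogonal W) ∧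
          ∀ g, ∀ z ∈ (Matrix.toBilin' J).orthogonal W,
            ρ.toGaloisRep g z ∈ (Matrix.toBilin' J).orthogonal W)) :=
  haveI : NeZero (2 : PadicAlgCl p) := ⟨two_ne_zero⟩
  invariantPlane_lagrangian_or_split ρ hSh.1 W hW hinv

end SymplecticPlane


/-! #### T12⁺ — the Lagrangian case in full: `K⁴/W ≅ W^∨ ⊗ ν`, and `σ ≅ σ^∨ ⊗ det σ` on `GL₂` -/

section LagrangianDuality

open Module Submodule Matrix

/-- `J₂ A J₂⁻¹ = adj(A)ᵀ = det(A) · A⁻ᵀ`: the standard representation of `GL₂` satisfies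
`σ ≅ σ^∨ ⊗ det σ` (for the crux's constituents: `σ̄^∨ ⊗ ε̄⁻¹ ≅ σ̄`). -/
theorem J₂_mul_mul_J₂inv_eq_adjugate_transpose {R : Type*} [CommRing R] (A : Matrix (Fin 2) (Fin 2) R) :
    !![(0 : R), 1; -1, 0] * A * !![(0 : R), -1; 1, 0] = A.adjugateᵀ := by
  rw [adjugate_fin_two]
  ext i j
  fin_cases i <;> fin_cases j <;> simp [Matrix.mul_apply, Fin.sum_univ_two, Matrix.vecMul, dotProduct]

theorem J₂_mul_J₂' {R : Type*} [CommRing R] :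
    !![(0 : R), 1; -1, 0] * !![(0 : R), -1; 1, 0] = 1 := by
  ext i j; fin_cases i <;> fin_cases j <;> simp

/-- For invertible `A`: `J₂ A J₂⁻¹ = det(A) · (A⁻¹)ᵀ`. -/
theorem J₂_conj_eq_det_smul_inv_transpose {K : Type*} [Field K] (A : Matrix (Fin 2) (Fin 2) K)
    (hA : A.det ≠ 0) :
    !![(0 : K), 1; -1, 0] * A * !![(0 : K), -1; 1, 0] = A.det • A⁻¹ᵀ := by
  rw [J₂_mul_mul_J₂inv_eq_adjugate_transpose, Matrix.inv_def, transpose_smul, smul_smul,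
    mul_comm, Ring.inverse_mul_cancel _ (isUnit_iff_ne_zero.2 hA), one_smul]


variable {k V : Type*} [Field k] [AddCommGroup V] [Module k V] [FiniteDimensional k V]

/-- **Lagrangian duality.**  For a non-degenerate form `B` on a 4-space and a LAGRANGIAN plane `W`
(`W^⊥ = W`), `w ↦ B(w, ·)` is a linear ISOMORPHISM `W ≃ (V/W)^∨`; if moreover `T` is a similitude
(`B(Tx, Ty) = ν B(x, y)`) stabilising `W`, the isomorphism intertwines `T|_W` with `ν · (T̄⁻¹)^∨` —
`V/W ≅ W^∨ ⊗ ν` equivariantly.  (The second half is the displayed formula `hequiv`.) -/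
theorem lagrangian_dual {B : LinearMap.BilinForm k V} (hBnd : B.Nondegenerate) (h4 : finrank k V = 4)
    {W : Submodule k V} (hW : finrank k W = 2) (hlag : B.orthogonal W = W) :
    ∃ φ : W ≃ₗ[k] Module.Dual k (V ⧸ W),
      (∀ (w : W) (v : V), φ w (W.mkQ v) = B w v) ∧
      ∀ (T : V →ₗ[k] V) (ν : k), (∀ x y, B (T x) (T y) = ν * B x y) →
        ∀ (w : W) (v : V), (T w : V) ∈ W → φ w (W.mkQ v) * ν = B (T w) (T v) := by
  have hvan : ∀ w ∈ W, ∀ v ∈ W, B w v = 0 := fun w hw v hv => by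
    have hv' : v ∈ B.orthogonal W := hlag.symm ▸ hv
    exact (LinearMap.BilinForm.mem_orthogonal_iff.1 hv') w hw
  -- `w ↦ B w` lands in the annihilator of `W`
  let ψ : W →ₗ[k] W.dualAnnihilator :=
    (B.domRestrict W).codRestrict W.dualAnnihilator fun w =>
      (Submodule.mem_dualAnnihilator _).2 fun v hv => hvan w w.2 v hv
  have hψ : ∀ (w : W) (v : V), (ψ w : Module.Dual k V) v = B w v := fun w v => rfl
  have hinj : Function.Injective ψ := by
    intro w₁ w₂ h
    apply Subtype.ext
    have h' : ∀ v, B (w₁ : V) v = B (w₂ : V) v := fun v => by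
      have := congrArg (fun f : W.dualAnnihilator => (f : Module.Dual k V) v) h
      simpa [hψ] using this
    have h0 : ∀ v, B ((w₁ : V) - w₂) v = 0 := fun v => by simp [h' v]
    exact sub_eq_zero.1 (hBnd.1 _ h0)
  have hrank : finrank k W = finrank k W.dualAnnihilator := by
    have := Subspace.finrank_add_finrank_dualAnnihilator_eq W
    omega
  let e₁ := LinearEquiv.ofInjectiveOfFinrankEq (V := ↥W) (V' := ↥W.dualAnnihilator) ψ hinj hrank
  let e₂ := (dualQuotEquivDualAnnihilator W).symm
  let φ := e₁.trans e₂
  have hφ : ∀ (w : W) (v : V), φ w (W.mkQ v) = B w v := fun w v => by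
    simp only [φ, e₁, e₂, LinearEquiv.trans_apply, Submodule.mkQ_apply]
    rw [Submodule.dualQuotEquivDualAnnihilator_symm_apply_mk]
    rfl
  refine ⟨φ, hφ, fun T ν hT w v _ => ?_⟩
  rw [hφ, mul_comm, ← hT]


end LagrangianDuality

/-! ### T13 — THE GREENBERG PLANE FORCES AN UNRAMIFIED LINE IN EACH RESIDUAL CONSTITUENT -/

section GreenbergPlane

open Module Submodule

variable {k V : Type*} [Field k] [AddCommGroup V] [Module k V] [FiniteDimensional k V]

/-- **T13 (abstract core).**  `V` 4-dimensional; `U` a plane fixed pointwise by every `f i`; `X`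
an `f`-stable plane on which some `f i` acts non-trivially and such that some `f i` acts
non-trivially on `V/X`.  Then `U ∩ X` is a LINE (neither `0` — else `V = U ⊕ X` and `V/X ≅ U`
would be `f`-trivial — nor `U` — else `X = U` would be `f`-trivial).

APPLICATION (paper: needs a stable lattice, its reduction and Brauer–Nesbitt).  Let `ρ` be ANY
`Sh`-representation of the crux (irreducible or not, e.g. `ρ₀`, `ρ`, or the reducible point of
`StableYoshidaCongruence`), `Λ` a stable lattice, `V = Λ ⊗ 𝔽̄_p`.  The Greenberg clause
`IsGreenbergOrdinaryOfShapeAt v (0,0,1,1)` gives a `G_{ℚ_p}`-stable plane `Fil ⊆ ℚ̄_p⁴` on which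
INERTIA ACTS TRIVIALLY; `U := (Fil ∩ Λ) ⊗ 𝔽̄_p` is a `G_{ℚ_p}`-stable plane of `V` fixed by `I_p`
(take `f i = ρ̄(i)`, `i ∈ I_p`).  By Čebotarev + Brauer–Nesbitt `V^ss ≅ σ̄ ⊕ σ̄'`, so `V` has a
`Γ_ℚ`-stable plane `X ≅ σ̄` or `σ̄'` with `V/X ≅` the other; `det σ̄ = det σ̄' = ε̄⁻¹` is RAMIFIED at
`p` (here `p ≠ 2` is used: `ε̄` mod `2` is trivial), so `I_p` acts non-trivially on `X` and on
`V/X`.  Conclusion: BOTH `σ̄|_{G_{ℚ_p}}` AND `σ̄'|_{G_{ℚ_p}}` CONTAIN A `G_{ℚ_p}`-STABLE LINE WITH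
TRIVIAL INERTIA ACTION (the lines `U ∩ X ⊆ X` and `(U + X)/X ⊆ V/X`, see the next two lemmas) —
each constituent is "`p`-ordinary in the cohomological normalisation" (unramified SUB-line,
`ε̄⁻¹ ⊗ unramified` quotient), for free.

WHAT THIS BUYS / COSTS.  (a) Free input for every line: the ordinary deformation problems of the
constituents (`R^{ord}_σ̄`, `R^{ord}_σ̄'`, the Hida families `F, G` of line 1) are well-posed on
every fibre carrying a single `Sh`-point — no hypothesis on `σ̄|_{G_{ℚ_p}}` need be added to the
crux, and a prover may USE the unramified lines.  (b) A VACUOUS SUB-LOCUS OF THE CRUX: on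
admissible pairs where `σ̄|_{G_{ℚ_p}}` (or `σ̄'|`) is a NON-SPLIT extension with the RAMIFIED
character `ε̄⁻¹γ̄` as its unique stable line ("wrong-way" ordinary: the local condition is one
non-zero class in the 1-dimensional `H¹(ℚ_p, 𝔽̄_p(ε̄⁻¹γ̄ᾱ⁻¹))`; such `σ̄` are odd, irreducible, of
determinant `ε̄⁻¹` and modular by Serre's conjecture, but are NOT reductions of the cohomological
`ρ_g^∨` of any `p`-ordinary weight-2 newform `g` of level prime to `p`, whose reduction always
contains the reduction of the unramified sub-line), NO `Sh`-representation exists at all: the crux, the target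
`PhantomRMSector` and the hypothesis `∃ ρ, Sh ρ` of `StableYoshidaCongruence` are all vacuous
there.  (c) Combined with `IsResiduallyDistinguishedAt`: the four residual characters of
`ρ̄|_{G_{ℚ_p}}` are `ᾱ, β̄` (on `U`, `ᾱ ≠ β̄`) and `ε̄⁻¹γ̄, ε̄⁻¹δ̄`; the constituents take one from
each pair (`σ̄| ∼ (ᾱ, ε̄⁻¹γ̄)`, `σ̄'| ∼ (β̄, ε̄⁻¹δ̄)` say), so `Hom(σ̄', σ̄)|_{G_{ℚ_p}}` has the four
characters `ᾱβ̄⁻¹ ≠ 1`, `ᾱδ̄⁻¹ε̄`, `γ̄β̄⁻¹ε̄⁻¹`, `γ̄δ̄⁻¹` — the local-at-`p` invariants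
`H⁰(ℚ_p, Hom(σ̄', σ̄))` vanish unless `γ̄ = δ̄`, which distinguishedness on the `ε̄⁻¹`-plane forbids:
`H⁰(ℚ_p, Hom(σ̄', σ̄)) = H⁰(ℚ_p, Hom(σ̄, σ̄')) = 0` on every `Sh`-fibre (the local input of the
Greenberg–Wiles / Bloch–Kato Selmer counts used by lines 1 and 2). -/
theorem finrank_inf_eq_one_of_fixedPlane {ι : Type*} (f : ι → V →ₗ[k] V)
    (h4 : finrank k V = 4) (U X : Submodule k V)
    (hU : finrank k U = 2) (hX : finrank k X = 2)
    (hUfix : ∀ i, ∀ u ∈ U, f i u = u)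
    (hXinv : ∀ i, ∀ x ∈ X, f i x ∈ X)
    (hXmoves : ∃ i, ∃ x ∈ X, f i x ≠ x)
    (hQmoves : ∃ i v, f i v - v ∉ X) :
    finrank k ↥(U ⊓ X) = 1 := by
  have hle2 : finrank k ↥(U ⊓ X) ≤ 2 := hU ▸ Submodule.finrank_mono inf_le_left
  have hne2 : finrank k ↥(U ⊓ X) ≠ 2 := by
    intro h2
    have hUX : U ⊓ X = U := eq_of_le_of_finrank_eq inf_le_left (h2.trans hU.symm)
    have hUleX : U ≤ X := by rw [← hUX]; exact inf_le_right
    have hUeqX : U = X := eq_of_le_of_finrank_eq hUleX (hU.trans hX.symm)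
    obtain ⟨i, x, hx, hne⟩ := hXmoves
    exact hne (hUfix i x (by rw [hUeqX]; exact hx))
  have hne0 : finrank k ↥(U ⊓ X) ≠ 0 := by
    intro h0
    have hsup : finrank k ↥(U ⊔ X) = 4 := by
      have := Submodule.finrank_sup_add_finrank_inf_eq U X
      omega
    have htop : U ⊔ X = ⊤ := eq_top_of_finrank_eq (hsup.trans h4.symm)
    obtain ⟨i, v, hv⟩ := hQmoves
    have hvmem : v ∈ U ⊔ X := htop ▸ mem_top
    obtain ⟨u, hu, x, hx, rfl⟩ := mem_sup.1 hvmem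
    apply hv
    have : f i (u + x) - (u + x) = f i x - x := by
      rw [map_add, hUfix i u hu]; abel
    rw [this]
    exact X.sub_mem (hXinv i x hx) hx
  omega

/-- … so `U + X` is 3-dimensional: the image of `U` in `V/X` is a LINE … -/
theorem finrank_sup_eq_three_of_fixedPlane {ι : Type*} (f : ι → V →ₗ[k] V)
    (h4 : finrank k V = 4) (U X : Submodule k V)
    (hU : finrank k U = 2) (hX : finrank k X = 2)
    (hUfix : ∀ i, ∀ u ∈ U, f i u = u)
    (hXinv : ∀ i, ∀ x ∈ X, f i x ∈ X)
    (hXmoves : ∃ i, ∃ x ∈ X, f i x ≠ x)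
    (hQmoves : ∃ i v, f i v - v ∉ X) :
    finrank k ↥(U ⊔ X) = 3 := by
  have h1 := finrank_inf_eq_one_of_fixedPlane f h4 U X hU hX hUfix hXinv hXmoves hQmoves
  have := Submodule.finrank_sup_add_finrank_inf_eq U X
  omega

omit [FiniteDimensional k V] in
/-- … on which every `f i` acts trivially modulo `X` … -/
theorem sub_mem_of_mem_sup_fixedPlane {ι : Type*} (f : ι → V →ₗ[k] V) (U X : Submodule k V)
    (hUfix : ∀ i, ∀ u ∈ U, f i u = u) (hXinv : ∀ i, ∀ x ∈ X, f i x ∈ X)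
    (i : ι) {v : V} (hv : v ∈ U ⊔ X) : f i v - v ∈ X := by
  obtain ⟨u, hu, x, hx, rfl⟩ := mem_sup.1 hv
  have : f i (u + x) - (u + x) = f i x - x := by
    rw [map_add, hUfix i u hu]; abel
  rw [this]
  exact X.sub_mem (hXinv i x hx) hx

omit [FiniteDimensional k V] in
/-- … while the line `U ∩ X ⊆ X` is fixed by every `f i` and stable under every map stabilising `U`
and `X` (e.g. all of `ρ̄(G_{ℚ_p})`). -/
theorem inf_fixed_and_stable {ι : Type*} (f : ι → V →ₗ[k] V) (U X : Submodule k V)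
    (hUfix : ∀ i, ∀ u ∈ U, f i u = u) :
    (∀ i, ∀ v ∈ U ⊓ X, f i v = v) ∧
      ∀ T : V →ₗ[k] V, (∀ u ∈ U, T u ∈ U) → (∀ x ∈ X, T x ∈ X) → ∀ v ∈ U ⊓ X, T v ∈ U ⊓ X :=
  ⟨fun i v hv => hUfix i v hv.1, fun _ hTU hTX v hv => ⟨hTU v hv.1, hTX v hv.2⟩⟩

end GreenbergPlane


/-! #### T13 typed: the Greenberg plane of the crux's `IsGreenbergOrdinaryOfShapeAt v (0,0,1,1)` as a
submodule, and the line it cuts on any stable plane moved by inertia -/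

section GreenbergPlaneTyped

open Module Submodule Matrix

variable {K : Type} [Field K] [ValuativeRel K] [TopologicalSpace K] [IsNonarchimedeanLocalField K]
  {p : ℕ} [Fact p.Prime]

/-- **The Greenberg plane.**  A shape-`(0,0,1,1)` Greenberg-ordinary `ρ : Γ_K → GL₄(ℚ̄_p)` has a
`Γ_K`-stable PLANE on which inertia acts TRIVIALLY (`U = g⁻¹⟨e₀, e₁⟩` for the frame `g`). -/
theorem exists_greenbergPlane (ρ : FramedRep (Field.absoluteGaloisGroup K) (PadicAlgCl p) 4)
    (h : ρ.IsGreenbergOrdinaryOfShape ![0, 0, 1, 1]) :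
    ∃ U : Submodule (PadicAlgCl p) (Fin 4 → PadicAlgCl p), finrank (PadicAlgCl p) U = 2 ∧
      (∀ τ, ∀ u ∈ U, (ρ τ).val *ᵥ u ∈ U) ∧
      (∀ τ ∈ absInertia K, ∀ u ∈ U, (ρ τ).val *ᵥ u = u) := by
  obtain ⟨g, hup, hdiag, hoff⟩ := h
  set L : (Fin 4 → PadicAlgCl p) →ₗ[PadicAlgCl p] (Fin 2 → PadicAlgCl p) :=
    (LinearMap.funLeft (PadicAlgCl p) (PadicAlgCl p) (Fin.natAdd 2 : Fin 2 → Fin 4)) ∘ₗ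
      Matrix.mulVecLin (g.val) with hL
  have hLapp : ∀ u i, L u i = (g.val *ᵥ u) (Fin.natAdd 2 i) := fun u i => rfl
  have hmem : ∀ u, u ∈ LinearMap.ker L ↔ (g.val *ᵥ u) 2 = 0 ∧ (g.val *ᵥ u) 3 = 0 := by
    intro u
    rw [LinearMap.mem_ker]
    constructor
    · intro h0
      exact ⟨by simpa [hLapp] using congrFun h0 0, by simpa [hLapp] using congrFun h0 1⟩
    · rintro ⟨h2, h3⟩
      funext i
      fin_cases i
      · simpa [hLapp] using h2
      · simpa [hLapp] using h3
  -- `g *ᵥ (g⁻¹ *ᵥ x) = x` and `g⁻¹ *ᵥ (g *ᵥ x) = x`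
  have hgg : ∀ x, g.val *ᵥ ((g⁻¹).val *ᵥ x) = x := fun x => by
    rw [mulVec_mulVec, ← Units.val_mul, mul_inv_cancel, Units.val_one, one_mulVec]
  have hgg' : ∀ x, (g⁻¹).val *ᵥ (g.val *ᵥ x) = x := fun x => by
    rw [mulVec_mulVec, ← Units.val_mul, inv_mul_cancel, Units.val_one, one_mulVec]
  have hsurj : Function.Surjective L := by
    intro z
    refine ⟨(g⁻¹).val *ᵥ ![0, 0, z 0, z 1], ?_⟩
    funext i
    rw [hLapp, hgg]
    fin_cases i <;> rfl
  -- conjugation bookkeeping: `M(τ) g = g ρ(τ)` for `M(τ) = g ρ(τ) g⁻¹`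
  have hMg : ∀ τ, ((g * ρ τ * g⁻¹ : GL (Fin 4) (PadicAlgCl p)) : Matrix (Fin 4) (Fin 4) (PadicAlgCl p)) *
      g.val = g.val * (ρ τ).val := fun τ => by
    rw [← Units.val_mul, inv_mul_cancel_right, Units.val_mul]
  have hgx : ∀ τ u, g.val *ᵥ ((ρ τ).val *ᵥ u) =
      ((g * ρ τ * g⁻¹ : GL (Fin 4) (PadicAlgCl p)) : Matrix (Fin 4) (Fin 4) (PadicAlgCl p)) *ᵥ
        (g.val *ᵥ u) := fun τ u => by
    rw [mulVec_mulVec, ← hMg, ← mulVec_mulVec]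
  refine ⟨LinearMap.ker L, ?_, ?_, ?_⟩
  · have h := LinearMap.finrank_range_add_finrank_ker L
    rw [LinearMap.range_eq_top.2 hsurj, finrank_top] at h
    simp only [Module.finrank_fin_fun] at h
    omega
  · intro τ u hu
    rw [hmem] at hu ⊢
    rw [hgx]
    set M : Matrix (Fin 4) (Fin 4) (PadicAlgCl p) :=
      ((g * ρ τ * g⁻¹ : GL (Fin 4) (PadicAlgCl p)) : Matrix (Fin 4) (Fin 4) (PadicAlgCl p)) with hM
    have h20 : M 2 0 = 0 := hup τ 2 0 (by decide)
    have h21 : M 2 1 = 0 := hup τ 2 1 (by decide)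
    have h30 : M 3 0 = 0 := hup τ 3 0 (by decide)
    have h31 : M 3 1 = 0 := hup τ 3 1 (by decide)
    have h32 : M 3 2 = 0 := hup τ 3 2 (by decide)
    generalize g.val *ᵥ u = x at hu ⊢
    constructor
    · simp [Matrix.mulVec, dotProduct, Fin.sum_univ_four, h20, h21, hu.1, hu.2]
    · simp [Matrix.mulVec, dotProduct, Fin.sum_univ_four, h30, h31, h32, hu.1, hu.2]
  · intro τ hτ u hu
    rw [hmem] at hu
    suffices hs : g.val *ᵥ ((ρ τ).val *ᵥ u) = g.val *ᵥ u by
      have := congrArg (fun x => (g⁻¹).val *ᵥ x) hs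
      simpa only [hgg'] using this
    rw [hgx]
    set M : Matrix (Fin 4) (Fin 4) (PadicAlgCl p) :=
      ((g * ρ τ * g⁻¹ : GL (Fin 4) (PadicAlgCl p)) : Matrix (Fin 4) (Fin 4) (PadicAlgCl p)) with hM
    have h00 : M 0 0 = 1 := by
      rw [hM, hdiag τ hτ 0]; simp
    have h11 : M 1 1 = 1 := by
      rw [hM, hdiag τ hτ 1]; simp
    have h01 : M 0 1 = 0 := hoff τ hτ 0 1 (by decide) (by simp)
    have h10 : M 1 0 = 0 := hup τ 1 0 (by decide)
    have h20 : M 2 0 = 0 := hup τ 2 0 (by decide)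
    have h21 : M 2 1 = 0 := hup τ 2 1 (by decide)
    have h30 : M 3 0 = 0 := hup τ 3 0 (by decide)
    have h31 : M 3 1 = 0 := hup τ 3 1 (by decide)
    have h32 : M 3 2 = 0 := hup τ 3 2 (by decide)
    generalize g.val *ᵥ u = x at hu ⊢
    funext i
    fin_cases i <;>
      simp [Matrix.mulVec, dotProduct, Fin.sum_univ_four, h00, h11, h01, h10, h20, h21, h30, h31,
        h32, hu.1, hu.2]

/-- **T13 typed.**  For a shape-`(0,0,1,1)` Greenberg-ordinary `ρ : Γ_K → GL₄(ℚ̄_p)` and a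
`ρ`-stable plane `X` moved by inertia with moved quotient, the Greenberg plane `U` meets `X` in a
LINE (so `X` has a `Γ_K`-stable inertia-trivial line `U ∩ X`, and `(U + X)/X` is another one in `ℚ̄_p⁴/X`). -/
theorem greenbergPlane_inf_line (ρ : FramedRep (Field.absoluteGaloisGroup K) (PadicAlgCl p) 4)
    (h : ρ.IsGreenbergOrdinaryOfShape ![0, 0, 1, 1])
    (X : Submodule (PadicAlgCl p) (Fin 4 → PadicAlgCl p)) (hX : finrank (PadicAlgCl p) X = 2)
    (hXinv : ∀ τ, ∀ x ∈ X, (ρ τ).val *ᵥ x ∈ X)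
    (hXmoves : ∃ τ ∈ absInertia K, ∃ x ∈ X, (ρ τ).val *ᵥ x ≠ x)
    (hQmoves : ∃ τ ∈ absInertia K, ∃ v, (ρ τ).val *ᵥ v - v ∉ X) :
    ∃ U : Submodule (PadicAlgCl p) (Fin 4 → PadicAlgCl p), finrank (PadicAlgCl p) U = 2 ∧
      (∀ τ, ∀ u ∈ U, (ρ τ).val *ᵥ u ∈ U) ∧
      (∀ τ ∈ absInertia K, ∀ u ∈ U, (ρ τ).val *ᵥ u = u) ∧
      finrank (PadicAlgCl p) ↥(U ⊓ X) = 1 ∧ finrank (PadicAlgCl p) ↥(U ⊔ X) = 3 := by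
  obtain ⟨U, hU, hstab, hfix⟩ := exists_greenbergPlane ρ h
  refine ⟨U, hU, hstab, hfix, ?_⟩
  let f : absInertia K → (Fin 4 → PadicAlgCl p) →ₗ[PadicAlgCl p] (Fin 4 → PadicAlgCl p) :=
    fun τ => Matrix.mulVecLin (ρ τ.1).val
  have hf : ∀ τ v, f τ v = (ρ τ.1).val *ᵥ v := fun τ v => rfl
  have h4 : finrank (PadicAlgCl p) (Fin 4 → PadicAlgCl p) = 4 := by simp
  have h1 : finrank (PadicAlgCl p) ↥(U ⊓ X) = 1 := by
    refine finrank_inf_eq_one_of_fixedPlane f h4 U X hU hX ?_ ?_ ?_ ?_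
    · intro τ u hu; rw [hf]; exact hfix τ.1 τ.2 u hu
    · intro τ x hx; rw [hf]; exact hXinv τ.1 x hx
    · obtain ⟨τ, hτ, x, hx, hne⟩ := hXmoves
      exact ⟨⟨τ, hτ⟩, x, hx, by rw [hf]; exact hne⟩
    · obtain ⟨τ, hτ, v, hv⟩ := hQmoves
      exact ⟨⟨τ, hτ⟩, v, by rw [hf]; exact hv⟩
  refine ⟨h1, ?_⟩
  have := Submodule.finrank_sup_add_finrank_inf_eq U X
  omega

end GreenbergPlaneTyped

section GreenbergPlaneAt

open Module Submodule Matrix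

/-- At-`v` form for a global `ρ : Γ_ℚ → GL₄(ℚ̄_p)` with the crux's Greenberg clause at `v`. -/
theorem greenbergPlaneAt_inf_line {p : ℕ} [Fact p.Prime] (ρ : FramedGaloisRep ℚ (PadicAlgCl p) 4)
    (v : HeightOneSpectrum (NumberField.RingOfIntegers ℚ))
    (h : ρ.IsGreenbergOrdinaryOfShapeAt v ![0, 0, 1, 1])
    (X : Submodule (PadicAlgCl p) (Fin 4 → PadicAlgCl p)) (hX : finrank (PadicAlgCl p) X = 2)
    (hXinv : ∀ g, ∀ x ∈ X, (ρ g).val *ᵥ x ∈ X)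
    (hXmoves : ∃ τ ∈ absInertia (v.adicCompletion ℚ), ∃ x ∈ X, (ρ.toLocal v τ).val *ᵥ x ≠ x)
    (hQmoves : ∃ τ ∈ absInertia (v.adicCompletion ℚ), ∃ w, (ρ.toLocal v τ).val *ᵥ w - w ∉ X) :
    ∃ U : Submodule (PadicAlgCl p) (Fin 4 → PadicAlgCl p), finrank (PadicAlgCl p) U = 2 ∧
      (∀ τ, ∀ u ∈ U, (ρ.toLocal v τ).val *ᵥ u ∈ U) ∧
      (∀ τ ∈ absInertia (v.adicCompletion ℚ), ∀ u ∈ U, (ρ.toLocal v τ).val *ᵥ u = u) ∧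
      finrank (PadicAlgCl p) ↥(U ⊓ X) = 1 ∧ finrank (PadicAlgCl p) ↥(U ⊔ X) = 3 :=
  greenbergPlane_inf_line (ρ.toLocal v) h X hX (fun _ x hx => hXinv _ x hx) hXmoves hQmoves


/-- **T13 for the crux's `Sh ρ` verbatim.**  For any `Sh`-representation `ρ` (irreducible or not),
any place `v ∋ p`, and any `Γ_ℚ`-stable plane `X ⊆ ℚ̄_p⁴` which inertia at `v` moves, with moved
quotient (e.g. `det = ε⁻¹` on `X` and on `ℚ̄_p⁴/X`): the Greenberg plane `U` at `v` (Γ_{ℚ_v}-stable,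
inertia-trivial) meets `X` in a LINE and `U + X` is a hyperplane — `X` contains an inertia-trivial
`Γ_{ℚ_v}`-stable line and so does `ℚ̄_p⁴/X`.  In characteristic `0` this applies to the REDUCIBLE
`Sh`-points (`ρ = σ ⊕ σ'`, e.g. the witness of `StableYoshidaCongruence`'s hypothesis `∃ ρ, Sh ρ`):
both `σ|_{Γ_{ℚ_p}}` and `σ'|_{Γ_{ℚ_p}}` are `p`-ordinary with an UNRAMIFIED sub-line; for irreducible `ρ`
the same statement holds for the reduction of a stable lattice (docstring of
`finrank_inf_eq_one_of_fixedPlane`). -/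
theorem sh_greenbergPlaneAt_inf_line {p : ℕ} [Fact p.Prime] {k' : Type} [Field k']
    [TopologicalSpace k'] {red : Valued.integer (PadicAlgCl p) →+* k'} {σ σ' : FramedGaloisRep ℚ k' 2}
    {ρ : FramedGaloisRep ℚ (PadicAlgCl p) 4} (hSh : Sh p k' red σ σ' ρ)
    (v : HeightOneSpectrum (NumberField.RingOfIntegers ℚ))
    (hv : ((p : ℕ) : NumberField.RingOfIntegers ℚ) ∈ v.asIdeal)
    (X : Submodule (PadicAlgCl p) (Fin 4 → PadicAlgCl p)) (hX : finrank (PadicAlgCl p) X = 2)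
    (hXinv : ∀ g, ∀ x ∈ X, (ρ g).val *ᵥ x ∈ X)
    (hXmoves : ∃ τ ∈ absInertia (v.adicCompletion ℚ), ∃ x ∈ X, (ρ.toLocal v τ).val *ᵥ x ≠ x)
    (hQmoves : ∃ τ ∈ absInertia (v.adicCompletion ℚ), ∃ w, (ρ.toLocal v τ).val *ᵥ w - w ∉ X) :
    ∃ U : Submodule (PadicAlgCl p) (Fin 4 → PadicAlgCl p), finrank (PadicAlgCl p) U = 2 ∧
      (∀ τ, ∀ u ∈ U, (ρ.toLocal v τ).val *ᵥ u ∈ U) ∧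
      (∀ τ ∈ absInertia (v.adicCompletion ℚ), ∀ u ∈ U, (ρ.toLocal v τ).val *ᵥ u = u) ∧
      finrank (PadicAlgCl p) ↥(U ⊓ X) = 1 ∧ finrank (PadicAlgCl p) ↥(U ⊔ X) = 3 :=
  greenbergPlaneAt_inf_line ρ v (hSh.2.1 v hv).1 X hX hXinv hXmoves hQmoves

end GreenbergPlaneAt

section SymplecticShape

open Module Submodule Matrix

/-! ### T16 — `det(r)² = ν⁴` for a symplectic `r` of rank 4 -/

theorem det_sq_eq_of_symplectic {R : Type*} [CommRing R] [IsDomain R] {n : ℕ}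
    {J g : Matrix (Fin n) (Fin n) R} {ν : R} (hJ : J.det ≠ 0) (hg : gᵀ * J * g = ν • J) :
    g.det ^ 2 = ν ^ n := by
  have h := congrArg Matrix.det hg
  rw [det_mul, det_mul, det_transpose, det_smul, Fintype.card_fin] at h
  have h' : (g.det ^ 2 - ν ^ n) * J.det = 0 := by linear_combination h
  exact sub_eq_zero.1 ((mul_eq_zero.1 h').resolve_right hJ)

/-- For the crux: `det ρ(g)² = ε(g)⁻⁴`, i.e. `det ρ = ± ε⁻²` pointwise (the sign is `+`: `GSp₄` is
connected / Pfaffian, not formalised). -/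
theorem det_sq_eq_of_isSymplecticWithMultiplierFun {K' : Type} [Field K'] [TopologicalSpace K']
    (r : FramedGaloisRep ℚ K' 4) {ν : Field.absoluteGaloisGroup ℚ → K'}
    (hr : r.IsSymplecticWithMultiplierFun ν) (g : Field.absoluteGaloisGroup ℚ) :
    (r g).val.det ^ 2 = ν g ^ 4 := by
  obtain ⟨J, -, hJu, hJ⟩ := hr
  exact det_sq_eq_of_symplectic hJu.ne_zero (hJ g)

/-! ### T15 — the non-conjugacy hypothesis is the Schur condition of the `GSp₄` problem (matrix half) -/

/-- The standard alternating `2 × 2` matrix. -/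
def J₂ (R : Type*) [CommRing R] : Matrix (Fin 2) (Fin 2) R := !![0, 1; -1, 0]

/-- The Yoshida-type form: orthogonal sum of two symplectic planes. -/
def J₄ (R : Type*) [CommRing R] : Matrix (Fin 2 ⊕ Fin 2) (Fin 2 ⊕ Fin 2) R :=
  Matrix.fromBlocks (J₂ R) 0 0 (J₂ R)

/-- Block-scalar endomorphism `diag(x, x, y, y)` — the general element of `End_{k[Γ]}(σ̄ ⊕ σ̄')`
(`= k × k`) for non-conjugate absolutely irreducible `σ̄, σ̄'`. -/
def blockScalar {R : Type*} [CommRing R] (x y : R) : Matrix (Fin 2 ⊕ Fin 2) (Fin 2 ⊕ Fin 2) R :=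
  Matrix.fromBlocks (x • (1 : Matrix (Fin 2) (Fin 2) R)) 0 0 (y • 1)

/-- (a) `diag(x, x, y, y) ∈ 𝔤𝔰𝔭(J₄)` (`Xᵀ J + J X = μ J`) iff `x = y` (and `μ = 2x`): the
`𝔤𝔰𝔭`-commutant of `σ̄ ⊕ σ̄'` is the scalars, `H⁰(ad⁰_{𝔰𝔭}) = 0` — the `GSp₄` deformation problem at
the crux's residual type is Schur BECAUSE `σ̄ ≇ σ̄'`. -/
theorem blockScalar_mem_gsp_iff {R : Type*} [CommRing R] [IsDomain R] [NeZero (2 : R)] (x y μ : R) :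
    (blockScalar x y)ᵀ * J₄ R + J₄ R * blockScalar x y = μ • J₄ R ↔ (μ = 2 * x ∧ x = y) := by
  constructor
  · intro h
    have e1 := congrFun (congrFun h (Sum.inl 0)) (Sum.inl 1)
    have e2 := congrFun (congrFun h (Sum.inr 0)) (Sum.inr 1)
    simp [blockScalar, J₄, J₂, Matrix.fromBlocks_transpose, Matrix.fromBlocks_multiply] at e1 e2
    constructor
    · linear_combination -e1
    · have : (2 : R) * (x - y) = 0 := by linear_combination e1 - e2
      exact sub_eq_zero.1 ((mul_eq_zero.1 this).resolve_left (NeZero.ne 2))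
  · rintro ⟨rfl, rfl⟩
    ext i j
    rcases i with i | i <;> rcases j with j | j <;> fin_cases i <;> fin_cases j <;>
      simp [blockScalar, J₄, J₂, Matrix.fromBlocks_transpose, Matrix.fromBlocks_multiply] <;> ring

/-- The multiplicity-space rotation `[[0, aI], [-aI, 0]]`. -/
def offDiagRotation {R : Type*} [CommRing R] (a : R) : Matrix (Fin 2 ⊕ Fin 2) (Fin 2 ⊕ Fin 2) R :=
  Matrix.fromBlocks 0 (a • (1 : Matrix (Fin 2) (Fin 2) R)) (-(a • 1)) 0

/-- (b) WITHOUT non-conjugacy (`σ̄' = σ̄`, image inside `{diag(A, A)}`): `offDiagRotation a` commutes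
with every `diag(A, A)`, lies in `𝔰𝔭(J₄)` (`Xᵀ J + J X = 0`), has trace `0`, and is not scalar for
`a ≠ 0` — `H⁰(Γ, ad⁰_{𝔰𝔭}(σ̄ ⊕ σ̄)) ≠ 0`: the `GSp₄` problem is NOT Schur. -/
theorem offDiagRotation_facts {R : Type*} [CommRing R] (a : R) (A : Matrix (Fin 2) (Fin 2) R) :
    offDiagRotation a * Matrix.fromBlocks A 0 0 A = Matrix.fromBlocks A 0 0 A * offDiagRotation a ∧
      (offDiagRotation a)ᵀ * J₄ R + J₄ R * offDiagRotation a = 0 ∧ (offDiagRotation a).trace = 0 ∧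
      (a ≠ 0 → ∀ c : R, offDiagRotation a ≠ c • (1 : Matrix (Fin 2 ⊕ Fin 2) (Fin 2 ⊕ Fin 2) R)) := by
  refine ⟨?_, ?_, ?_, ?_⟩
  · simp [offDiagRotation, Matrix.fromBlocks_multiply]
  · simp [offDiagRotation, J₄, Matrix.fromBlocks_transpose, Matrix.fromBlocks_multiply,
      Matrix.fromBlocks_add, Matrix.transpose_neg]
  · simp [offDiagRotation, Matrix.trace, Matrix.fromBlocks]
  · intro ha c h
    have e := congrFun (congrFun h (Sum.inl 0)) (Sum.inr 0)
    simp [offDiagRotation, Matrix.smul_apply] at e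
    exact ha e



/-! ### T14 — the Greenberg plane of an `Sh`-representation is LAGRANGIAN -/

section Lagrangian

/-- A similitude with multiplier `ν ≠ 1` fixing `u` and `u'` forces `B_J(u, u') = 0`. -/
theorem toBilin'_eq_zero_of_fixed {K' : Type*} [Field K'] {n : ℕ} {J g : Matrix (Fin n) (Fin n) K'}
    {ν : K'} (hg : gᵀ * J * g = ν • J) (hν : ν ≠ 1) {u u' : Fin n → K'} (hu : g *ᵥ u = u)
    (hu' : g *ᵥ u' = u') : Matrix.toBilin' J u u' = 0 := by
  have h := toBilin'_mulVec_mulVec hg u u'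
  rw [hu, hu'] at h
  have h' : (ν - 1) * Matrix.toBilin' J u u' = 0 := by linear_combination -h
  exact (mul_eq_zero.1 h').resolve_left (sub_ne_zero.2 hν)

open IsDedekindDomain in
/-- **T14. The Greenberg plane is Lagrangian.**  For the crux's `Sh ρ` (symplectic with multiplier
`ε⁻¹`, Greenberg-ordinary of shape `(0,0,1,1)` at `v ∋ p`), assuming `ε` is non-trivial on SOME
inertia element at `v` (true at `v = p`: `ε|_{I_p}` surjects onto `ℤ_p^×`; stated as a hypothesis since
the tree has no theorem producing a ramified inertia element), the Greenberg plane `U` (Γ_{ℚ_v}-stable,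
inertia-trivial — `exists_greenbergPlane`) is ISOTROPIC for `B_J`, hence LAGRANGIAN (`U^⊥ = U`):
`ℚ̄_p⁴/U ≅ U^∨ ⊗ ε⁻¹` as `Γ_{ℚ_v}`-modules.  So the unit-root characters on the quotient are FORCED:
`(α, β | ε⁻¹β⁻¹, ε⁻¹α⁻¹)` (Boxer–Calegari–Gee–Pilloni's shape), and residual distinguishedness on the
`ε⁻¹`-block is the same condition `ᾱ ≠ β̄` as on the unit-root block — `IsResiduallyDistinguishedAt`'s
second pair of characters carries no extra constraint. -/
theorem sh_greenbergPlane_lagrangian {p : ℕ} [Fact p.Prime] {k' : Type} [Field k']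
    [TopologicalSpace k'] {red : Valued.integer (PadicAlgCl p) →+* k'} {σ σ' : FramedGaloisRep ℚ k' 2}
    {ρ : FramedGaloisRep ℚ (PadicAlgCl p) 4}
    (hSh : Sh p k' red σ σ' ρ)
    (v : HeightOneSpectrum (NumberField.RingOfIntegers ℚ))
    (hv : ((p : ℕ) : NumberField.RingOfIntegers ℚ) ∈ v.asIdeal)
    (hε : ∃ τ ∈ absInertia (v.adicCompletion ℚ),
      algebraMap ℚ_[p] (PadicAlgCl p)
        ((((GaloisRep.cyclotomicCharacter ℚ p (absGaloisRestrict ℚ (v.adicCompletion ℚ) τ))⁻¹ :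
          ℤ_[p]ˣ) : ℤ_[p]) : ℚ_[p]) ≠ 1) :
    ∃ (J : Matrix (Fin 4) (Fin 4) (PadicAlgCl p)) (U : Submodule (PadicAlgCl p) (Fin 4 → PadicAlgCl p)),
      Jᵀ = -J ∧ J.det ≠ 0 ∧
      (∀ g, (ρ g).valᵀ * J * (ρ g).val =
        (algebraMap ℚ_[p] (PadicAlgCl p)
          ((((GaloisRep.cyclotomicCharacter ℚ p g)⁻¹ : ℤ_[p]ˣ) : ℤ_[p]) : ℚ_[p])) • J) ∧
      finrank (PadicAlgCl p) U = 2 ∧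
      (∀ τ, ∀ u ∈ U, (ρ.toLocal v τ).val *ᵥ u ∈ U) ∧
      (∀ τ ∈ absInertia (v.adicCompletion ℚ), ∀ u ∈ U, (ρ.toLocal v τ).val *ᵥ u = u) ∧
      (∀ u ∈ U, ∀ u' ∈ U, Matrix.toBilin' J u u' = 0) ∧
      (Matrix.toBilin' J).orthogonal U = U := by
  obtain ⟨J, hJt, hJu, hJ⟩ := hSh.1
  obtain ⟨U, hU, hstab, hfix⟩ := exists_greenbergPlane (ρ.toLocal v) (hSh.2.1 v hv).1
  obtain ⟨τ, hτ, hne⟩ := hε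
  have hdet : J.det ≠ 0 := hJu.ne_zero
  have hiso : ∀ u ∈ U, ∀ u' ∈ U, Matrix.toBilin' J u u' = 0 := fun u hu u' hu' =>
    toBilin'_eq_zero_of_fixed (hJ (absGaloisRestrict ℚ (v.adicCompletion ℚ) τ)) hne
      (hfix τ hτ u hu) (hfix τ hτ u' hu')
  haveI : NeZero (2 : PadicAlgCl p) := ⟨two_ne_zero⟩
  have hNd : (Matrix.toBilin' J).Nondegenerate :=
    LinearMap.BilinForm.nondegenerate_toBilin'_of_det_ne_zero' J hdet
  have h4 : finrank (PadicAlgCl p) (Fin 4 → PadicAlgCl p) = 4 := by simp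
  exact ⟨J, U, hJt, hdet, hJ, hU, hstab, hfix, hiso, orthogonal_eq_self_of_isotropic hNd h4 hU hiso⟩

end Lagrangian

end SymplecticShape

/-! ### T17 (gen 5, paper) — four more regimes, recorded for the lines

(a) LEVEL.  Nothing ties the ramification of `ρ` to that of `ρ₀`: `ρ` has ARBITRARY conductor prime to `p`, `ρ₀` is
fixed on the same fibre.  Every proof is therefore non-minimal in level (Taylor's Ihara avoidance inside
Calegari–Geraghty patching in defect `ℓ₀ = 1`, as in BCGP; for line A, `R^{ps,ord}_{Λ₂,N}` and `T^{ord}_N` at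
`N = N(ρ)`, the Yoshida family being `v`-OLD at the level-raising primes `v ∣ N(ρ)`, `v ∤ N(σ̄)N(σ̄')`).
(b) `K ≤ I` INTEGRALLY.  By T12, `R/I ≅ (R^{ord}_σ̄ ⊗̂ R^{ord}_σ̄')^{det}`; the datum's `modular_le_reducible` is the
INTEGRAL statement big `R^{ord}_σ̄ = T^{ord}_F`, `R^{ord}_σ̄' = T^{ord}_G` (nilpotents included, non-minimal level):
known under Taylor–Wiles adequacy of `σ̄|_{ℚ(ζ_p)}` (`p`-distinguishedness of the constituents is free, T13); in
regime (c) of §6 and for `σ̄` induced from the quadratic subfield of `ℚ(ζ_p)` only pointwise modularity of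
`p`-distinguished ordinary lifts (Skinner–Wiles type) is in print — `K ≤ I` after passing to reduced quotients at
best.  STUB 1 is unaffected in truth (T1'); its INTENDED instance must carry adequacy or re-cut `R` inside
`T × (R/I)^{red}`.
(c) ODD-TWIST FIBRES `σ̄' ≅ σ̄ ⊗ η` (`η` quadratic cutting out `K`; admissible iff `σ̄ ≇ σ̄ ⊗ η`; inside the crux).
`Hom(σ̄', σ̄) = ad(σ̄) ⊗ η = η ⊕ ad⁰(σ̄) ⊗ η` CONTAINS THE ARTIN CHARACTER `η`, and `H¹(G_{ℚ,S}, 𝒪(η))` has rank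
`≥ 1` iff `η` is odd (the anticyclotomic direction of `G_K^{ab} ⊗ ℤ_p`).  Deformation-theoretically: the INDUCED
LOCUS `{tr Ind_K^ℚ(ρ_F|_{G_K} ⊗ ψ)}` (`F` in the Hida family of `σ̄`, Krull dimension `2`; `ψ` a `p`-adic character of
`G_K` deforming `1`) has, for `p = 𝔭𝔭̄` SPLIT in `K`, Krull dimension `2 + 1 = 3 = dim R^{ps,ord}_{Λ₂}` — the Greenberg
shape forces `ψ` unramified at one of `𝔭, 𝔭̄` (a one-parameter family, the `𝔭̄`-ramified `ℤ_p`-extension; weights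
`(κ, m+2)`, `ψ|_{I_𝔭̄} = ε^{-m}`): the imprimitive points fill whole IRREDUCIBLE COMPONENTS `C_ind` of `Spec R`,
generically irreducible ("stable" for STUB 3), meeting `Y` exactly where `ψ = χ|_{G_K}` is unramified at `p` — the
diagonal surfaces `{(F ⊗ χ, F ⊗ χη)}`, height-one primes of `Y` and of `C_ind`.  `C_ind` IS automorphic (quadratic base
change + automorphic induction, Arthur–Clozel; descent of the `η`-self-twist `Π` to a stable cuspidal Siegel form of
general type, Arthur / Gee–Taïbi), so — granted `T^{ord}` is the FULL ordinary cuspidal Hecke algebra — nothing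
breaks; but the height-one input `Φ_P ≤ Ψ_P` at a diagonal prime measures anticyclotomic `η`-classes against the
`C_ind`-crossing part of the Yoshida congruence ideal, a CM-type congruence (`L_p(ad⁰F ⊗ η)·L_p(η)`-shaped), not the
Beilinson–Flach bound cited for primitive crossings; for `p` INERT in `K` the induced locus has dimension `2` only and
lies on larger components.  With the drefute seat's B(iii) (`ρ = H¹(Res_{F/ℚ} E)`, `F` imaginary quadratic, `p` split)
these fibres are the cheapest TEST SUB-FAMILY for STUB 1: three kinds of components (`Y`, `C_ind`, primitive).
(`p` RAMIFIED in `K` is inertially impossible — `σ̄ ⊗ η|_{I_p} = η_I·{1, ε̄⁻¹} ≠ {1, ε̄⁻¹}` — EXCEPT `p = 3`, `η = ω = ε̄`: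
`(σ̄, σ̄ ⊗ ω)` is then admissible on inertia and, by T13, carries `Sh`-points only if `σ̄|_{G_{ℚ_3}}` is SPLIT.)
(d) `ρ₀` IS IDLE in every registered artefact except line 3's seed S3 (T0; `CR.crux_of_stubs_seeded`; §5 T7 for
line 2's Stub 3): a proof of the crux never using `Aut ρ₀` proves the TARGET (`phantomRMSector_iff_absolute`). -/


/-! ### T18 — THE TWO WALLS, formally: any refutation of the crux exhibits BOTH an automorphic
`Sh`-point `ρ₀` (a genuine `CuspidalAutomorphicRepData 4 ℚ` with prescribed Satake data) AND a
non-automorphic irreducible `Sh`-point `ρ` on the same fibre (a counterexample to the target sector,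
i.e. to conjunct (B)) -/

/-- `¬ crux` unpacks to: an admissible fibre carrying an automorphic irreducible `Sh`-point `ρ₀` and a
NON-automorphic irreducible `Sh`-point `ρ`.  Neither half is constructible in the tree (no irreducible
`Γ_ℚ`-representation of dimension `≥ 2`; no theorem bounding the Satake parameters of all cuspidal `π`),
and the second half alone already refutes the route target. -/
theorem not_crux_iff_two_walls :
    ¬ Summit.Langlands.Langlands.Theses.PhantomRMYoshida.ResiduallyYoshidaLifting ↔
    ∃ (p : ℕ) (_ : Fact p.Prime) (_ : p ≠ 2) (k : Type) (_ : Field k) (_ : CharP k p) (_ : IsAlgClosed k)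
      (_ : TopologicalSpace k) (_ : DiscreteTopology k) (red : Valued.integer (PadicAlgCl p) →+* k)
      (σ σ' : FramedGaloisRep ℚ k 2) (hcpt : isCompact_glFiniteIntegralLevel 4 ℚ) (ι : PadicAlgCl p ≃+* ℂ),
      σ.IsOdd ∧ σ'.IsOdd ∧ σ.toGaloisRep.IsIrreducible ∧ σ'.toGaloisRep.IsIrreducible ∧
      DetC p k σ σ' ∧ (¬ ∃ g : GL (Fin 2) k, ∀ x, g * σ x * g⁻¹ = σ' x) ∧
      (∃ ρ₀ : FramedGaloisRep ℚ (PadicAlgCl p) 4,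
        ρ₀.toGaloisRep.IsIrreducible ∧ Sh p k red σ σ' ρ₀ ∧ Aut p hcpt ι ρ₀) ∧
      (∃ ρ : FramedGaloisRep ℚ (PadicAlgCl p) 4,
        ρ.toGaloisRep.IsIrreducible ∧ Sh p k red σ σ' ρ ∧ ¬ Aut p hcpt ι ρ) := by
  rw [iff_absoluteOnFibres]
  constructor
  · intro h
    by_contra hne
    apply h
    intro p _ hp k _ _ _ _ _ red σ σ' hcpt ι hodd hodd' hσ hσ' hdet hnc hρ₀ ρ hρ hSh
    by_contra hA
    exact hne ⟨p, inferInstance, hp, k, inferInstance, inferInstance, inferInstance, inferInstance,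
      inferInstance, red, σ, σ', hcpt, ι, hodd, hodd', hσ, hσ', hdet, hnc, hρ₀, ρ, hρ, hSh, hA⟩
  · rintro ⟨p, _, hp, k, _, _, _, _, _, red, σ, σ', hcpt, ι, hodd, hodd', hσ, hσ', hdet, hnc, hρ₀,
      ρ, hρ, hSh, hA⟩ h
    exact hA (h p hp k red σ σ' hcpt ι hodd hodd' hσ hσ' hdet hnc hρ₀ ρ hρ hSh)

/-- … and the second wall alone refutes the route TARGET (contrapositive of `of_phantomRMSector`). -/
theorem not_phantomRMSector_of_not_crux
    (h : ¬ Summit.Langlands.Langlands.Theses.PhantomRMYoshida.ResiduallyYoshidaLifting) :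
    ¬ Summit.Langlands.Langlands.Theses.PhantomRMYoshida.PhantomRMSector :=
  fun hT => h (of_phantomRMSector hT)


/-! ## §8 (gen 5, 04:40Z) — TARGETS of the SECOND lead (prover-line-stmt-Langlands-13639-b-0, line
`endoscopic-crossing-euler`, skeleton of 04:15Z; 7 stubs by `stub-add`: `stub_numericalCriterion`, 2a
`stub_residualCharpoly`, 2b `stub_residualTriangular`, 2c `stub_blockSumConj`, 2d `stub_splitFrame`, 3
`stub_yoshidaCrossingRT`, 4 `stub_weightTwoClassicality` v2)

STATE CHANGE: line A's STUB 2 is LANDED (p78501, wrapper of the PROVED Literature Criterion I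
`bijective_of_length_cotangentModule_le`); by T5 line b's `stub_numericalCriterion` is the same statement — CLOSED for
both.  Line A is down to STUBS 1, 4 (⟺ `Absolute ∧ EveryShIsLimit` outright, T8 with `h₂` discharged).
VERDICTS (cheap attacks, no `_false` theorem): 2a TRUE (`rint = P⁻¹rP` is continuous though typed `→*`;
`g ↦ red(charpoly rint g)` is locally constant since `red` kills `{‖x‖ < 1}`, T10; Frobenii are dense — tree
`absoluteGaloisGroup.frobenius_dense`; no irreducibility / `p ≠ 2` / closedness of `k` needed, as registered).
2b, 2c TRUE over ANY field and group (Brauer–Nesbitt in charpoly form, the tree's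
`Representation.nonempty_equiv_of_charpoly_eq`; classical proof: over `k̄`, cancel common simple factors — legitimate
since `charpoly_V(g) = ∏ charpoly_{S_i}(g)^{n_i}` pointwise and `k[X]` is a domain — then linear independence of
characters gives all multiplicities `≡ 0 mod p`, extract `p`-th roots in `k̄[X]`, induct; descend by Noether–Deuring;
ranks `(1,3)/(3,1)` and reducible blocks die by Jordan–Hölder against `{σ, σ'}`).  2d TRUE and TIGHT IN THE VALUE GROUP: the
proof must use density of `|ℚ̄_p^×| = p^ℚ` (`λ = sup ‖c(g)‖ < 1` by compactness; `λ ≤ ‖ϖ‖² < 1`); the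
discrete-valuation shadow is FALSE — `splitFrame_discreteShadow_false` below.  3 = the lever: by the lead's
`LeadStub3Inert.lean` its numerical-criterion conjuncts are inert and its content is `ProAut` (Λ-adic pro-automorphy at
the Yoshida `𝔪` — line A's `EveryShIsLimit` in another dress), crux-sized, promote-stub grade; consumes `Aut ρ₀`; not
refutable (T18).  4 (v2) `≤ PhantomRMSector` (lead); `Endo` approximants weaker than intended (T7), harmless.
From §7 line b may take: T12 (symplectic residual frame for a UNIMODULAR lattice — not needed by 2a–2d, needed
once the lever wants `GSp₄`-valued residual data), T13/T14 (ordinary lines, Lagrangian Greenberg plane). -/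

/-- STUB 2 is LANDED: `NumericalCriterionDVR` (this file's verbatim copy) holds, by the first lead's
`stub_numericalCriterionDVR` (p78501, wrapping the proved Literature Criterion I). -/
theorem numericalCriterionDVR_holds : NumericalCriterionDVR :=
  fun O _ _ _ _ A _ _ _ _ _ B _ _ _ _ _ φ π hφ hη hle =>
    YoshidaDivisorSelmerCount.stub_numericalCriterionDVR O A B φ π hφ hη hle

/-- Hence line A's two open stubs are now UNCONDITIONALLY equivalent to `Absolute ∧ EveryShIsLimit` (T8 with
`h₂` discharged) … -/
theorem stubs14_iff_absolute_and_everyShIsLimit' :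
    (YoshidaFamilyExists ∧ OrdinaryLimitClassicality) ↔ (Absolute ∧ EveryShIsLimit) :=
  stubs14_iff_absolute_and_everyShIsLimit numericalCriterionDVR_holds

/-- … and the crux follows from STUBS 1 and 4 alone. -/
theorem crux_of_stubs14 (h₁ : YoshidaFamilyExists) (h₄ : OrdinaryLimitClassicality) :
    Summit.Langlands.Langlands.Theses.PhantomRMYoshida.ResiduallyYoshidaLifting :=
  crux_of_stubs124 h₁ numericalCriterionDVR_holds h₄

section SplitFrameShadow

open Matrix

/-- **2d is tight in the value group.** The DISCRETE-VALUATION SHADOW of `stub_splitFrame` is FALSE.  Over `ℚ_p` take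
`N = [[0, I₂], [p·I₂, 0]]` and the integral `M = 1 + N ∈ GL₄(ℤ_p)` (`det = (1 - p)²`), whose reduction
`[[I, I], [0, I]]` is block upper triangular with diagonal blocks `a = d = I₂`; an integral `ℚ_p`-conjugate of
`M` with block DIAGONAL reduction `[[I, 0], [0, I]] = 1` would be `1 + X` with `X = g⁻¹ N g ∈ p·M₄(ℤ_p)`, but
`X² = g⁻¹ N² g = p·1` has `(0,0)`-entry of norm `p⁻¹ > p⁻² ≥ ‖(X²)₀₀‖`.  So `stub_splitFrame` is TRUE only
because the value group of `ℚ̄_p` is dense (`|ϖ| = p^{-1/2}` is available): the proof must use `p^{1/N} ∈ ℚ̄_p`. -/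
theorem splitFrame_discreteShadow_false (p : ℕ) [Fact p.Prime] (g : GL (Fin 4) ℚ_[p]) :
    let N : Matrix (Fin 4) (Fin 4) ℚ_[p] :=
      !![0, 0, 1, 0; 0, 0, 0, 1; (p : ℚ_[p]), 0, 0, 0; 0, (p : ℚ_[p]), 0, 0]
    ¬ ∀ i j, ‖((g⁻¹).val * N * g.val) i j‖ ≤ ((p : ℝ))⁻¹ := by
  intro N h
  have hN2 : N * N = (p : ℚ_[p]) • (1 : Matrix (Fin 4) (Fin 4) ℚ_[p]) := by
    ext i j
    fin_cases i <;> fin_cases j <;>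
      simp [N, Matrix.mul_apply, Fin.sum_univ_four, Matrix.smul_apply]
  set X : Matrix (Fin 4) (Fin 4) ℚ_[p] := (g⁻¹).val * N * g.val with hX
  have hgg : g.val * (g⁻¹).val = 1 := by
    rw [← Units.val_mul, mul_inv_cancel, Units.val_one]
  have hgg' : (g⁻¹).val * g.val = 1 := by
    rw [← Units.val_mul, inv_mul_cancel, Units.val_one]
  have hX2 : X * X = (p : ℚ_[p]) • (1 : Matrix (Fin 4) (Fin 4) ℚ_[p]) := by
    calc X * X = (g⁻¹).val * N * (g.val * (g⁻¹).val) * N * g.val := by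
            simp only [hX, Matrix.mul_assoc]
      _ = (g⁻¹).val * (N * N) * g.val := by rw [hgg, Matrix.mul_one, Matrix.mul_assoc (g⁻¹).val N N]
      _ = (p : ℚ_[p]) • 1 := by rw [hN2, Matrix.mul_smul, Matrix.mul_one, Matrix.smul_mul, hgg']
  -- the (0,0) entry
  have h00 : (X * X) 0 0 = (p : ℚ_[p]) := by
    rw [hX2]; simp
  have hsum : (X * X) 0 0 = X 0 0 * X 0 0 + X 0 1 * X 1 0 + X 0 2 * X 2 0 + X 0 3 * X 3 0 := by
    simp [Matrix.mul_apply, Fin.sum_univ_four]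
  have hp0 : (0 : ℝ) < (p : ℝ) := by exact_mod_cast (Fact.out : p.Prime).pos
  have hbound : ∀ i j, ‖X i j * X j i‖ ≤ ((p : ℝ))⁻¹ * ((p : ℝ))⁻¹ := fun i j => by
    rw [norm_mul]
    exact mul_le_mul (h i j) (h j i) (norm_nonneg _) (inv_nonneg.2 hp0.le)
  have hle : ‖(X * X) 0 0‖ ≤ ((p : ℝ))⁻¹ * ((p : ℝ))⁻¹ := by
    rw [hsum]
    refine (Padic.nonarchimedean _ _).trans (max_le ?_ (hbound 0 3))
    refine (Padic.nonarchimedean _ _).trans (max_le ?_ (hbound 0 2))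
    exact (Padic.nonarchimedean _ _).trans (max_le (hbound 0 0) (hbound 0 1))
  rw [h00] at hle
  have hnorm : ‖(p : ℚ_[p])‖ = ((p : ℝ))⁻¹ := Padic.norm_p
  rw [hnorm] at hle
  -- `p⁻¹ ≤ p⁻²` is false for `p ≥ 2`
  have hp1 : (1 : ℝ) < p := by exact_mod_cast (Fact.out : p.Prime).one_lt
  have hinv : (0 : ℝ) < ((p : ℝ))⁻¹ := inv_pos.2 hp0
  have : ((p : ℝ))⁻¹ * 1 ≤ ((p : ℝ))⁻¹ * ((p : ℝ))⁻¹ := by simpa using hle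
  have h1 : (1 : ℝ) ≤ ((p : ℝ))⁻¹ := le_of_mul_le_mul_left this hinv
  have : ((p : ℝ))⁻¹ < 1 := inv_lt_one_of_one_lt₀ hp1
  linarith


end SplitFrameShadow

example : CompactSpace (Field.absoluteGaloisGroup ℚ) := inferInstance -- 2d's `sup` input

/-- What 2d must use, and has: `p^{1/n} ∈ ℚ̄_p` (norm `p^{-1/n} < 1`) for every `n ≥ 1`. -/
theorem exists_norm_pow_eq_inv_prime (p : ℕ) [Fact p.Prime] {n : ℕ} (hn : 0 < n) :
    ∃ x : PadicAlgCl p, ‖x‖ ^ n = ((p : ℝ))⁻¹ ∧ ‖x‖ < 1 := by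
  obtain ⟨x, hx⟩ := IsAlgClosed.exists_pow_nat_eq (p : PadicAlgCl p) hn
  have hnorm : ‖x‖ ^ n = ((p : ℝ))⁻¹ := by
    rw [← norm_pow, hx, show (p : PadicAlgCl p) = algebraMap ℚ_[p] (PadicAlgCl p) (p : ℚ_[p]) from
      (map_natCast _ p).symm, norm_algebraMap', Padic.norm_p]
  refine ⟨x, hnorm, ?_⟩
  have hp1 : (1 : ℝ) < p := by exact_mod_cast (Fact.out : p.Prime).one_lt
  have hlt : ‖x‖ ^ n < 1 := by rw [hnorm]; exact inv_lt_one_of_one_lt₀ hp1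
  by_contra hge
  push Not at hge
  exact absurd (one_le_pow₀ hge) (not_le.2 hlt)



end Summit.Langlands.Langlands.Cruxes.ResiduallyYoshidaLifting.Disproof

end
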